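/-
Copyright: h21 hsemireg venture — plan-lens-HodgeAV-anomaly g10–g12 (workfile; kernel-checked, sorry-free).
VERSION v1.0 (g12).  Change log: v0.1 (g10) PART A + §B1–§B3 · v0.2–v0.4 (g11) §B4 exact-clause engines, CHARGE-STEP ARCHITECTURE, class lemmas,
general engines `aminus_fires_coord` ∕ `xplus_fires`, STAIRCASE TOP · v0.5 §B5 (L1)–(L3) · v0.6–v0.9 §B6 `C2`-column classes (L4)–(L8),
`lower_mem_of_top_ceiling'` · v1.0 §B6.0 CHARGE INDUCTION (L9)∕(L10): `P∕N[O|ℓ|tI+cℓ|C1]` absent ∀ h ∀ t ∀ c ((L4) now a corollary).  Verbatim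
module docs of every version: `PROOF-SKETCH-FLOORTOP-LAW.md` §22 (h)∕(k) and git history (v0.5 7067ef5f78e9, v0.9 d084ad96a000).

# LawCore — T1-core working file: RULE-D engines, the two `H₁` killers, `G₁` as an engine, the rungs of `NoThree`
PART A restates byte-for-byte the statements of the engine closure of `LawSpan` v2.5 (tree aad59c623fd4; docstrings one-lined, «doc: `LawSpan`»),
so `LawCore.NoThree = LawSpan.NoThree` definitionally and a tree landing imports ONE file; PART B holds the new T1-core content.
NOT PROVED HERE OR ANYWHERE: HC ∕ HC_AV ∕ HC_CM ∕ BlochSeedDiscOne (18881); `NoThree (2k)` and `Transport lawS2 (2k)` for `k ≥ 2`.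
-/

import Summits.Ventures.HSemireg.Pad4TowerB1OddBoostBlind

namespace Summit.Ventures.HSemireg.Pad4Tower

namespace AnomalyLens

namespace LawCore

open Finset

/-! # PART A — frozen copy of the engine closure of `LawSpan` v2.5 (do not edit here; edit `LawSpan` and re-copy) -/

/-- number of charged letters (`β ≠ 0`) of a cell. -/
abbrev chargedCount (Z : MCell) : ℕ := (univ.filter fun f : Fin 4 => (Z f).2 ≠ (0, 0)).card

/-- a cell is BI-ANCHORED at height `h`: one of its letters lies on the floor … (doc: `LawSpan`) -/
def BiAnchored (h : ℤ) (Z : MCell) : Prop := (∃ f, OnFloor (Z f)) ∧ ∃ f, OnCeiling h (Z f)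

/-- a THREE-CHARGED cell: exactly three charged letters (one apex letter). -/
abbrev ThreeCharged (Z : MCell) : Prop := chargedCount Z = 3

/-- signed-charge shift of a ray move: directions `0, 1` raise `chargeOf` by `e`, directions `2, 3` lower it by `e`. -/
theorem chargeOf_ray (x : BPoint) (k : Fin 4) (e : ℤ) :
    chargeOf (ray x k e) = chargeOf x + (![1, 1, -1, -1] k) * e := by
  fin_cases k <;> simp [chargeOf] <;> ring

theorem ray_fst (x : BPoint) (k : Fin 4) (e : ℤ) : (ray x k e).1 = x.1 + e := rfl

/-- the arithmetic core: on the ceiling, a forward ray move that stays under the … (doc: `LawSpan`) -/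
theorem abs_ceiling_core {A q s e h : ℤ} (he : 0 < e) (hs : s = 1 ∨ s = -1) (hc : A + |q| = h)
    (hle : A + e + |q + s * e| ≤ h) : e ≤ |q| ∧ A + e + |q + s * e| = h ∧ |q + s * e| = |q| - e := by
  rcases abs_cases q with ⟨h1, h2⟩ | ⟨h1, h2⟩ <;> rcases abs_cases (q + s * e) with ⟨h3, h4⟩ | ⟨h3, h4⟩ <;>
    rcases hs with rfl | rfl <;> omega

/-- **CEILING SERVICE LEMMA (h-uniform)**: a ceiling letter `x` moved forward … (doc: `LawSpan`) -/
theorem ceiling_service {h : ℤ} {x : BPoint} (hc : OnCeiling h x) {k : Fin 4} {e : ℤ} (he : 0 < e)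
    (hy : InDiamond h (ray x k e)) :
    e ≤ absCharge x ∧ OnCeiling h (ray x k e) ∧ absCharge (ray x k e) = absCharge x - e := by
  have hle := hy.2.2.2
  simp only [OnCeiling, absCharge, chargeOf_ray] at *
  have hs : (![1, 1, -1, -1] : Fin 4 → ℤ) k = 1 ∨ (![1, 1, -1, -1] : Fin 4 → ℤ) k = -1 := by
    fin_cases k <;> simp
  exact abs_ceiling_core he hs hc hle

/-- the arithmetic core at the floor. -/
theorem abs_floor_core {Y q s e : ℤ} (he : 0 < e) (hs : s = 1 ∨ s = -1) (hf : Y + e = |q + s * e|) (hle : |q| ≤ Y) :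
    e ≤ |q + s * e| ∧ Y = |q| ∧ |q| = |q + s * e| - e := by
  rcases abs_cases q with ⟨h1, h2⟩ | ⟨h1, h2⟩ <;> rcases abs_cases (q + s * e) with ⟨h3, h4⟩ | ⟨h3, h4⟩ <;>
    rcases hs with rfl | rfl <;> omega

/-- the same at the FLOOR: if `x = ray y k e` (`e > 0`) is a floor letter and … (doc: `LawSpan`) -/
theorem floor_service {h : ℤ} {x y : BPoint} (hf : OnFloor x) {k : Fin 4} {e : ℤ} (he : 0 < e) (hxy : x = ray y k e)
    (hy : InDiamond h y) :
    e ≤ absCharge x ∧ OnFloor y ∧ absCharge y = absCharge x - e := by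
  subst hxy
  simp only [OnFloor, absCharge, chargeOf_ray] at *
  have hs : (![1, 1, -1, -1] : Fin 4 → ℤ) k = 1 ∨ (![1, 1, -1, -1] : Fin 4 → ℤ) k = -1 := by
    fin_cases k <;> simp
  exact abs_floor_core he hs hf hy.2.1

/-- a charge-1 CEILING letter of phase `k`: `(h-2)·I + ℓ_{i^k}` = … (doc: `LawSpan`) -/
theorem ceiling_unit_move {h : ℤ} {k r : Fin 4} {e : ℤ} (he : 0 < e)
    (hy : InDiamond h (ray (ray ((h - 2, 0, 0) : BPoint) k 1) r e)) :
    r = k + 2 ∧ e = 1 ∧ ray (ray ((h - 2, 0, 0) : BPoint) k 1) r e = (h, 0, 0) := by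
  have hc : OnCeiling h (ray ((h - 2, 0, 0) : BPoint) k 1) := by
    fin_cases k <;> simp [OnCeiling, absCharge, chargeOf] <;> omega
  obtain ⟨hle, -, hdis⟩ := ceiling_service hc he hy
  have h1 : absCharge (ray ((h - 2, 0, 0) : BPoint) k 1) = 1 := by
    fin_cases k <;> simp [absCharge, chargeOf]
  have he1 : e = 1 := by omega
  subst he1
  rw [h1] at hdis
  have hax := hy.1
  fin_cases k <;> fin_cases r <;> simp [AxisPt, absCharge, chargeOf, Prod.ext_iff] at hax hdis ⊢ <;> omega

/-- a charge-1 FLOOR letter `ℓ_{i^k} = ray O k 1`: the only point of `◇_h` from … (doc: `LawSpan`) -/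
theorem floor_unit_move {h : ℤ} {k r : Fin 4} {e : ℤ} {y : BPoint} (he : 0 < e)
    (hxy : ray ((0, 0, 0) : BPoint) k 1 = ray y r e) (hy : InDiamond h y) :
    y = (0, 0, 0) ∧ e = 1 ∧ r = k := by
  have hf : OnFloor (ray ((0, 0, 0) : BPoint) k 1) := by
    fin_cases k <;> simp [OnFloor, absCharge, chargeOf]
  obtain ⟨hle, hfl, hdis⟩ := floor_service hf he hxy hy
  have h1 : absCharge (ray ((0, 0, 0) : BPoint) k 1) = 1 := by
    fin_cases k <;> simp [absCharge, chargeOf]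
  have he1 : e = 1 := by omega
  subst he1
  rw [h1] at hdis
  have hax := hy.1
  obtain ⟨a, b1, b2⟩ := y
  simp only [OnFloor, absCharge, chargeOf, AxisPt] at hfl hdis hax
  have h12 : b1 - b2 = 0 := abs_eq_zero.mp (by simpa using hdis)
  have hb : b1 = 0 ∧ b2 = 0 := by
    rcases hax with h0 | h0 <;> simp [Prod.ext_iff] at h0 <;> omega
  obtain ⟨rfl, rfl⟩ := hb
  have ha : a = 0 := by simpa using hfl
  subst ha
  refine ⟨rfl, rfl, ?_⟩
  fin_cases k <;> fin_cases r <;> simp [Prod.ext_iff] at hxy ⊢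

/-- charge of a letter `t·I + c·ℓ_{i^k}`. -/
theorem absCharge_ray_apex (t c : ℤ) (k : Fin 4) (hc : 0 ≤ c) : absCharge (ray ((t, 0, 0) : BPoint) k c) = c := by
  fin_cases k <;> simp [absCharge, chargeOf, abs_of_nonneg hc]

/-- **forward moves of a CEILING letter inside `◇_h`** (general charge): a letter … (doc: `LawSpan`) -/
theorem ceiling_move {h t c e : ℤ} {k r : Fin 4} (hc : 1 ≤ c) (hh : t + 2 * c = h) (he : 0 < e)
    (hy : InDiamond h (ray (ray ((t, 0, 0) : BPoint) k c) r e)) :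
    r = k + 2 ∧ e ≤ c ∧ ray (ray ((t, 0, 0) : BPoint) k c) r e = ray ((t + 2 * e, 0, 0) : BPoint) k (c - e) := by
  have hx : absCharge (ray ((t, 0, 0) : BPoint) k c) = c := absCharge_ray_apex t c k (by omega)
  have hceil : OnCeiling h (ray ((t, 0, 0) : BPoint) k c) := by
    show (ray ((t, 0, 0) : BPoint) k c).1 + absCharge (ray ((t, 0, 0) : BPoint) k c) = h
    rw [hx, ray_fst]; simp only; omega
  obtain ⟨hle, -, hdis⟩ := ceiling_service hceil he hy
  rw [hx] at hle hdis
  have hax := hy.1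
  simp only [absCharge] at hdis
  rw [abs_eq (by omega : (0 : ℤ) ≤ c - e)] at hdis
  refine ⟨?_, hle, ?_⟩
  · fin_cases k <;> fin_cases r <;> simp [chargeOf, AxisPt, Prod.ext_iff] at hdis hax ⊢ <;> omega
  · have hr : r = k + 2 := by
      fin_cases k <;> fin_cases r <;> simp [chargeOf, AxisPt, Prod.ext_iff] at hdis hax ⊢ <;> omega
    subst hr
    fin_cases k <;> simp [Prod.ext_iff] <;> ring_nf <;> trivial

/-- the own coordinate of the letter `t·I + c·ℓ_{i^k}` is `t + 2c` (its LINE) … -/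
theorem coord_ray_apex_self (t c : ℤ) (k : Fin 4) : coord (ray ((t, 0, 0) : BPoint) k c) k = t + 2 * c := by
  fin_cases k <;> simp [coord] <;> ring

/-- … and its antipodal coordinate is `t` (its NODE LEVEL). -/
theorem coord_ray_apex_antip (t c : ℤ) (k : Fin 4) : coord (ray ((t, 0, 0) : BPoint) k c) (k + 2) = t := by
  fin_cases k <;> simp [coord]

theorem adapted_ray_apex_self (t c : ℤ) (k : Fin 4) : Adapted (ray ((t, 0, 0) : BPoint) k c) k := by
  fin_cases k <;> simp [Adapted]

theorem adapted_ray_apex_antip (t c : ℤ) (k : Fin 4) : Adapted (ray ((t, 0, 0) : BPoint) k c) (k + 2) := by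
  fin_cases k <;> simp [Adapted]

/-- **THE CEILING ENGINE (PROVED, h-uniform)**: at a rule-D `P`-cell in `◇_h` a … (doc: `LawSpan`) -/
theorem settledAbove_of_ceiling {h : ℤ} {C : MConfig} (hU : C.InDiamond h) {P : MCell} (hD : RuleDMu4P C P)
    {f₀ k₀ : Fin 4} {t c : ℤ} (hc : 1 ≤ c) (hh : t + 2 * c = h) (h0 : P f₀ = ray ((t, 0, 0) : BPoint) k₀ c)
    {g k : Fin 4} (hg : g ≠ f₀) (hadk : Adapted (P g) k) (hne : coord (P g) k ≠ h) : SettledAbove C P g k := by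
  have hstuck : ¬ SettledAbove C P f₀ k₀ := by
    rintro ⟨r, hr, N, hN, -, hlt, hray⟩
    have hy : InDiamond h (ray (P f₀) r ((N f₀).1 - (P f₀).1)) := by rw [← hray]; exact hU.1 N hN f₀
    rw [h0] at hy hlt
    exact hr (ceiling_move hc hh (by rw [h0] at hray; simp at hlt ⊢; omega) hy).1
  have hnocov : ∀ j k', ¬ CoveredAbove C P f₀ k₀ j k' := by
    rintro j k' ⟨a, b, hdir, -, N, hN, -, hlt, hra, -⟩
    have hy : InDiamond h (ray (P f₀) a ((N f₀).1 - (P f₀).1)) := by rw [← hra]; exact hU.1 N hN f₀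
    rw [h0] at hy hlt
    have ha := (ceiling_move hc hh (by rw [h0] at hra; simp at hlt ⊢; omega) hy).1
    rcases hdir with hak | ⟨hapex, -⟩
    · rw [hak] at ha; exact absurd ha (by fin_cases k₀ <;> decide)
    · rw [h0] at hapex
      fin_cases k₀ <;> simp [isApex] at hapex <;> omega
  refine settledAbove_of_stuck hD (by rw [h0]; exact adapted_ray_apex_self t c k₀) hstuck hnocov hg hadk ?_
  rw [h0, coord_ray_apex_self]; rwa [← hh] at hne

/-- **moves INTO a FLOOR letter inside `◇_h`** (general charge): if the floor … (doc: `LawSpan`) -/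
theorem floor_move {h c e : ℤ} {k r : Fin 4} {y : BPoint} (hc : 1 ≤ c) (he : 0 < e)
    (hxy : ray ((0, 0, 0) : BPoint) k c = ray y r e) (hy : InDiamond h y) :
    r = k ∧ e ≤ c ∧ y = ray ((0, 0, 0) : BPoint) k (c - e) := by
  have hx : absCharge (ray ((0, 0, 0) : BPoint) k c) = c := absCharge_ray_apex 0 c k (by omega)
  have hf : OnFloor (ray ((0, 0, 0) : BPoint) k c) := by
    show (ray ((0, 0, 0) : BPoint) k c).1 = absCharge (ray ((0, 0, 0) : BPoint) k c)
    rw [hx, ray_fst]; simp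
  obtain ⟨hle, hfl, hdis⟩ := floor_service hf he hxy hy
  rw [hx] at hle hdis
  have hax := hy.1
  obtain ⟨a, b1, b2⟩ := y
  simp only [OnFloor, absCharge, chargeOf] at hfl hdis hax
  rw [hdis] at hfl
  rw [abs_eq (by omega : (0 : ℤ) ≤ c - e)] at hdis
  refine ⟨?_, hle, ?_⟩
  · fin_cases k <;> fin_cases r <;> simp [AxisPt, Prod.ext_iff] at hdis hax hxy ⊢ <;> omega
  · have hr : r = k := by
      fin_cases k <;> fin_cases r <;> simp [AxisPt, Prod.ext_iff] at hdis hax hxy ⊢ <;> omega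
    subst hr
    fin_cases r <;> simp [Prod.ext_iff] at hxy ⊢ <;> omega

/-- **THE FLOOR ENGINE (PROVED, h-uniform)** — dual of `settledAbove_of_ceiling` … (doc: `LawSpan`) -/
theorem settledBelow_of_floor {h : ℤ} {C : MConfig} (hU : C.InDiamond h) {Z : MCell} (hD : RuleDMu4N C Z)
    {f₀ k₀ : Fin 4} {c : ℤ} (hc : 1 ≤ c) (h0 : Z f₀ = ray ((0, 0, 0) : BPoint) k₀ c)
    {g k : Fin 4} (hg : g ≠ f₀) (hadk : Adapted (Z g) k) (hne : coord (Z g) k ≠ 0) : SettledBelow C Z g k := by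
  have hstuck : ¬ SettledBelow C Z f₀ (k₀ + 2) := by
    rintro ⟨r, hr, P, hP, -, hlt, hray⟩
    rw [h0] at hray hlt
    have := (floor_move hc (by simp at hlt ⊢; omega) hray (hU.2 P hP f₀)).1
    subst this
    exact hr (by fin_cases r <;> decide)
  have hnocov : ∀ j k', ¬ CoveredBelow C Z f₀ (k₀ + 2) j k' := by
    rintro j k' ⟨a, b, hdir, -, P, hP, -, hlt, hra, -⟩
    rw [h0] at hra hlt
    have ha := (floor_move hc (by simp at hlt ⊢; omega) hra (hU.2 P hP f₀)).1
    rcases hdir with hak | ⟨hapex, -⟩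
    · rw [hak] at ha; exact absurd ha (by fin_cases k₀ <;> decide)
    · rw [h0] at hapex
      fin_cases k₀ <;> simp [isApex] at hapex <;> omega
  refine settledBelow_of_stuck hD (by rw [h0]; exact adapted_ray_apex_antip 0 c k₀) hstuck hnocov hg hadk ?_
  rw [h0, coord_ray_apex_antip]; exact hne

/-- **chain step above (PROVED, h-uniform)**: two charged CEILING letters (f₀ … (doc: `LawSpan`) -/
theorem lower_mem_of_two_ceiling' {h : ℤ} {C : MConfig} (hU : C.InDiamond h) {P : MCell} (hD : RuleDMu4P C P)
    {f₀ f₁ k₀ k₁ : Fin 4} (hf : f₀ ≠ f₁) {t₀ c₀ t₁ c₁ : ℤ} (hc₀ : 1 ≤ c₀) (hh₀ : t₀ + 2 * c₀ = h) (hc₁ : 1 ≤ c₁) (hh₁ : t₁ + 2 * c₁ = h)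
    (h0 : P f₀ = ray ((t₀, 0, 0) : BPoint) k₀ c₀) (h1 : P f₁ = ray ((t₁, 0, 0) : BPoint) k₁ c₁) :
    ∃ e, 1 ≤ e ∧ e ≤ c₁ ∧ Function.update P f₁ (ray ((t₁ + 2 * e, 0, 0) : BPoint) k₁ (c₁ - e)) ∈ C.lower := by
  have hne : coord (P f₁) (k₁ + 2) ≠ h := by rw [h1, coord_ray_apex_antip]; omega
  obtain ⟨r, -, N, hN, hagree, hlt, hray⟩ :=
    settledAbove_of_ceiling hU hD hc₀ hh₀ h0 (Ne.symm hf) (by rw [h1]; exact adapted_ray_apex_antip t₁ c₁ k₁) hne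
  have hy : InDiamond h (ray (P f₁) r ((N f₁).1 - (P f₁).1)) := by rw [← hray]; exact hU.1 N hN f₁
  rw [h1] at hy hlt
  have he : 0 < (N f₁).1 - (ray ((t₁, 0, 0) : BPoint) k₁ c₁).1 := by simp at hlt ⊢; omega
  obtain ⟨-, hle, hpt⟩ := ceiling_move hc₁ hh₁ he hy
  refine ⟨(N f₁).1 - (ray ((t₁, 0, 0) : BPoint) k₁ c₁).1, by omega, hle, ?_⟩
  have hNeq : N = Function.update P f₁ (ray ((t₁ + 2 * ((N f₁).1 - (ray ((t₁, 0, 0) : BPoint) k₁ c₁).1), 0, 0) : BPoint) k₁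
      (c₁ - ((N f₁).1 - (ray ((t₁, 0, 0) : BPoint) k₁ c₁).1))) := by
    funext g
    by_cases hg : g = f₁
    · subst hg; rw [Function.update_self, ← hpt, ← h1]; nth_rewrite 1 [hray]; rw [h1]
    · rw [Function.update_of_ne hg]; exact (hagree g hg).symm
  rw [← hNeq]; exact hN

/-- **chain step below (PROVED, h-uniform)**: two charged FLOOR letters `c₀·ℓ_u` … (doc: `LawSpan`) -/
theorem upper_mem_of_two_floor' {h : ℤ} {C : MConfig} (hU : C.InDiamond h) {Z : MCell} (hD : RuleDMu4N C Z)
    {f₀ f₁ k₀ k₁ : Fin 4} (hf : f₀ ≠ f₁) {c₀ c₁ : ℤ} (hc₀ : 1 ≤ c₀) (hc₁ : 1 ≤ c₁)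
    (h0 : Z f₀ = ray ((0, 0, 0) : BPoint) k₀ c₀) (h1 : Z f₁ = ray ((0, 0, 0) : BPoint) k₁ c₁) :
    ∃ e, 1 ≤ e ∧ e ≤ c₁ ∧ Function.update Z f₁ (ray ((0, 0, 0) : BPoint) k₁ (c₁ - e)) ∈ C.upper := by
  have hne : coord (Z f₁) k₁ ≠ 0 := by rw [h1, coord_ray_apex_self]; omega
  obtain ⟨r, -, P, hP, hagree, hlt, hray⟩ :=
    settledBelow_of_floor hU hD hc₀ h0 (Ne.symm hf) (by rw [h1]; exact adapted_ray_apex_self 0 c₁ k₁) hne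
  rw [h1] at hray hlt
  have he : 0 < (ray ((0, 0, 0) : BPoint) k₁ c₁).1 - (P f₁).1 := by simp at hlt ⊢; omega
  obtain ⟨-, hle, hpt⟩ := floor_move hc₁ he hray (hU.2 P hP f₁)
  refine ⟨(ray ((0, 0, 0) : BPoint) k₁ c₁).1 - (P f₁).1, by omega, hle, ?_⟩
  have hPeq : P = Function.update Z f₁ (ray ((0, 0, 0) : BPoint) k₁ (c₁ - ((ray ((0, 0, 0) : BPoint) k₁ c₁).1 - (P f₁).1))) := by
    funext g
    by_cases hg : g = f₁
    · subst hg; rw [Function.update_self]; exact hpt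
    · rw [Function.update_of_ne hg]; exact hagree g hg
  rw [← hPeq]; exact hP

/-- **forcing at a UNIT ceiling letter (PROVED, h-uniform)**: a charged CEILING … (doc: `LawSpan`) -/
theorem lower_mem_of_unit_ceiling {h : ℤ} {C : MConfig} (hU : C.InDiamond h) {P : MCell} (hD : RuleDMu4P C P)
    {f₀ f₁ k₀ k₁ : Fin 4} (hf : f₀ ≠ f₁) {t₀ c₀ : ℤ} (hc₀ : 1 ≤ c₀) (hh₀ : t₀ + 2 * c₀ = h)
    (h0 : P f₀ = ray ((t₀, 0, 0) : BPoint) k₀ c₀) (h1 : P f₁ = ray ((h - 2, 0, 0) : BPoint) k₁ 1) :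
    Function.update P f₁ ((h, 0, 0) : BPoint) ∈ C.lower := by
  have hne : coord (P f₁) (k₁ + 2) ≠ h := by rw [h1, coord_ray_apex_antip]; omega
  obtain ⟨r, -, N, hN, hagree, hlt, hray⟩ :=
    settledAbove_of_ceiling hU hD hc₀ hh₀ h0 (Ne.symm hf) (by rw [h1]; exact adapted_ray_apex_antip (h - 2) 1 k₁) hne
  have hy : InDiamond h (ray (P f₁) r ((N f₁).1 - (P f₁).1)) := by rw [← hray]; exact hU.1 N hN f₁
  rw [h1] at hy hlt
  obtain ⟨-, -, hpt⟩ := ceiling_unit_move (by rw [h1] at hray; simp at hlt ⊢; omega) hy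
  have hNf : N f₁ = (h, 0, 0) := by rw [hray, h1]; exact hpt
  have hNeq : N = Function.update P f₁ ((h, 0, 0) : BPoint) := by
    funext g
    by_cases hg : g = f₁
    · subst hg; simp [hNf]
    · rw [Function.update_of_ne hg]; exact (hagree g hg).symm
  rw [← hNeq]; exact hN

/-- **forcing at a UNIT floor letter (PROVED, h-uniform)**: a charged FLOOR … (doc: `LawSpan`) -/
theorem upper_mem_of_unit_floor {h : ℤ} {C : MConfig} (hU : C.InDiamond h) {Z : MCell} (hD : RuleDMu4N C Z)
    {f₀ f₁ k₀ k₁ : Fin 4} (hf : f₀ ≠ f₁) {c₀ : ℤ} (hc₀ : 1 ≤ c₀)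
    (h0 : Z f₀ = ray ((0, 0, 0) : BPoint) k₀ c₀) (h1 : Z f₁ = ray ((0, 0, 0) : BPoint) k₁ 1) :
    Function.update Z f₁ ((0, 0, 0) : BPoint) ∈ C.upper := by
  have hne : coord (Z f₁) k₁ ≠ 0 := by rw [h1, coord_ray_apex_self]; omega
  obtain ⟨r, -, P, hP, hagree, hlt, hray⟩ :=
    settledBelow_of_floor hU hD hc₀ h0 (Ne.symm hf) (by rw [h1]; exact adapted_ray_apex_self 0 1 k₁) hne
  rw [h1] at hray hlt
  obtain ⟨hpt, -, -⟩ := floor_unit_move (by simp at hlt ⊢; omega) hray (hU.2 P hP f₁)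
  have hPeq : P = Function.update Z f₁ ((0, 0, 0) : BPoint) := by
    funext g
    by_cases hg : g = f₁
    · subst hg; simp [hpt]
    · rw [Function.update_of_ne hg]; exact hagree g hg
  rw [← hPeq]; exact hP

/-- replacing one letter of a fully charged cell by an apex leaves exactly three charged letters. -/
theorem threeCharged_update_apex {P : MCell} (hch : ∀ f, (P f).2 ≠ (0, 0)) (f₁ : Fin 4) (t : ℤ) :
    ThreeCharged (Function.update P f₁ ((t, 0, 0) : BPoint)) := by
  dsimp only [ThreeCharged, chargedCount]
  have hs : (univ.filter fun f : Fin 4 => (Function.update P f₁ ((t, 0, 0) : BPoint) f).2 ≠ (0, 0)) = univ.erase f₁ := by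
    ext g
    by_cases hg : g = f₁
    · subst hg; simp
    · simp [hch g, hg]
  rw [hs, card_erase_of_mem (mem_univ _)]; simp

/-- charging an apex letter raises the charged count by one. -/
theorem chargedCount_update_charged {P : MCell} {f₁ : Fin 4} (hap : (P f₁).2 = (0, 0)) {x : BPoint} (hx : x.2 ≠ (0, 0)) :
    chargedCount (Function.update P f₁ x) = chargedCount P + 1 := by
  dsimp only [chargedCount]
  have hs : (univ.filter fun f : Fin 4 => (Function.update P f₁ x f).2 ≠ (0, 0)) =
      insert f₁ (univ.filter fun f : Fin 4 => (P f).2 ≠ (0, 0)) := by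
    ext g
    by_cases hg : g = f₁
    · subst hg; simp [hx]
    · simp [hg]
  rw [hs, card_insert_of_notMem (by simp [hap])]

/-- **forcing at an APEX next to a charged ceiling letter (PROVED, h-uniform)** … (doc: `LawSpan`) -/
theorem lower_mem_of_ceiling_apex {h : ℤ} {C : MConfig} (hU : C.InDiamond h) {P : MCell} (hD : RuleDMu4P C P)
    {f₀ f₁ k₀ : Fin 4} (hf : f₀ ≠ f₁) {t₀ c₀ t : ℤ} (hc₀ : 1 ≤ c₀) (hh₀ : t₀ + 2 * c₀ = h)
    (h0 : P f₀ = ray ((t₀, 0, 0) : BPoint) k₀ c₀) (h1 : P f₁ = (t, 0, 0)) (ht : t ≠ h) :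
    ∃ r : Fin 4, ∃ e : ℤ, 1 ≤ e ∧ Function.update P f₁ (ray ((t, 0, 0) : BPoint) r e) ∈ C.lower := by
  obtain ⟨r, -, N, hN, hagree, hlt, hray⟩ := settledAbove_of_ceiling hU hD hc₀ hh₀ h0 (Ne.symm hf)
    (show Adapted (P f₁) 0 by rw [h1]; simp [Adapted]) (by rw [h1]; simpa [coord] using ht)
  rw [h1] at hray hlt
  refine ⟨r, (N f₁).1 - t, by simp at hlt; omega, ?_⟩
  have hNeq : N = Function.update P f₁ (ray ((t, 0, 0) : BPoint) r ((N f₁).1 - t)) := by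
    funext g
    by_cases hg : g = f₁
    · subst hg; rw [Function.update_self]; simpa using hray
    · rw [Function.update_of_ne hg]; exact (hagree g hg).symm
  rw [← hNeq]; exact hN

/-- **CLASS «q = 2 with a charged ceiling letter» (PROVED ∀ h)**: under the core … (doc: `LawSpan`) -/
theorem upper_mem_of_floor_apex {h : ℤ} {C : MConfig} (hU : C.InDiamond h) {Z : MCell} (hD : RuleDMu4N C Z)
    {f₀ f₁ k₀ : Fin 4} (hf : f₀ ≠ f₁) {c₀ t : ℤ} (hc₀ : 1 ≤ c₀)
    (h0 : Z f₀ = ray ((0, 0, 0) : BPoint) k₀ c₀) (h1 : Z f₁ = (t, 0, 0)) (ht : t ≠ 0) :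
    ∃ P ∈ C.upper, ∃ r : Fin 4, ∃ d : ℤ, 1 ≤ d ∧ (∀ g, g ≠ f₁ → P g = Z g) ∧ ray (P f₁) r d = (t, 0, 0) ∧ (P f₁).1 + d = t := by
  obtain ⟨r, -, P, hP, hagree, hlt, hray⟩ := settledBelow_of_floor hU hD hc₀ h0 (Ne.symm hf)
    (show Adapted (Z f₁) 0 by rw [h1]; simp [Adapted]) (by rw [h1]; simpa [coord] using ht)
  rw [h1] at hray hlt
  refine ⟨P, hP, r, t - (P f₁).1, by simp at hlt; omega, hagree, ?_, by omega⟩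
  simpa using hray.symm

/-- the letter `d ≥ 1` null steps below an apex `t·I` is charged with `|charge| = d`. -/
theorem absCharge_of_ray_eq_apex {z : BPoint} {r : Fin 4} {d t : ℤ} (hd : 0 ≤ d) (hz : ray z r d = (t, 0, 0)) : absCharge z = d := by
  obtain ⟨a, b1, b2⟩ := z
  fin_cases r <;> simp [Prod.ext_iff] at hz <;> simp [absCharge, chargeOf] <;>
    first | (rw [abs_of_nonpos (by omega)]; omega) | (rw [abs_of_nonneg (by omega)]; omega)

/-- **`Saturation A h` (lc-core), dual CLASS «q = 2 with a charged floor letter» — PROVED for every `h`.** -/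
theorem ray_ray_self (x : BPoint) (k : Fin 4) (c e : ℤ) : ray (ray x k c) k e = ray x k (c + e) := by
  obtain ⟨a, b1, b2⟩ := x
  fin_cases k <;> refine Prod.ext ?_ (Prod.ext ?_ ?_) <;> simp <;> ring

/-- a forward move of the charged FLOOR letter `c·ℓ_{i^k}` inside `◇_h` in a … (doc: `LawSpan`) -/
theorem floor_charge_move {h c e : ℤ} {k r : Fin 4} (hc : 1 ≤ c) (he : 0 < e) (hr : r ≠ k + 2)
    (hy : InDiamond h (ray (ray ((0, 0, 0) : BPoint) k c) r e)) : r = k ∧ 2 * (c + e) ≤ h := by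
  have hax := hy.1
  have hl := hy.2.2.2
  have h1 := le_abs_self (chargeOf (ray (ray ((0, 0, 0) : BPoint) k c) r e))
  have h2 := neg_abs_le (chargeOf (ray (ray ((0, 0, 0) : BPoint) k c) r e))
  simp only [absCharge] at hl
  fin_cases k <;> fin_cases r <;> simp [AxisPt, chargeOf, Prod.ext_iff] at hax hr hl h1 h2 ⊢ <;> omega

/-- **floor letter charged upward (P side)**: with a charged CEILING letter on … (doc: `LawSpan`) -/
theorem lower_mem_of_ceiling_floor {h : ℤ} {C : MConfig} (hU : C.InDiamond h) {P : MCell} (hD : RuleDMu4P C P)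
    {f₀ f₁ k₀ k₁ : Fin 4} (hf : f₀ ≠ f₁) {t₀ c₀ c₁ : ℤ} (hc₀ : 1 ≤ c₀) (hh₀ : t₀ + 2 * c₀ = h) (hc₁ : 1 ≤ c₁) (hnc : 2 * c₁ ≠ h)
    (h0 : P f₀ = ray ((t₀, 0, 0) : BPoint) k₀ c₀) (h1 : P f₁ = ray ((0, 0, 0) : BPoint) k₁ c₁) :
    ∃ e, 1 ≤ e ∧ 2 * (c₁ + e) ≤ h ∧ Function.update P f₁ (ray ((0, 0, 0) : BPoint) k₁ (c₁ + e)) ∈ C.lower := by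
  have hne : coord (P f₁) k₁ ≠ h := by rw [h1, coord_ray_apex_self]; omega
  obtain ⟨r, hr, N, hN, hagree, hlt, hray⟩ :=
    settledAbove_of_ceiling hU hD hc₀ hh₀ h0 (Ne.symm hf) (by rw [h1]; exact adapted_ray_apex_self 0 c₁ k₁) hne
  rw [h1] at hray hlt
  have he : 0 < (N f₁).1 - (ray ((0, 0, 0) : BPoint) k₁ c₁).1 := by simp at hlt ⊢; omega
  have hy : InDiamond h (ray (ray ((0, 0, 0) : BPoint) k₁ c₁) r ((N f₁).1 - (ray ((0, 0, 0) : BPoint) k₁ c₁).1)) := by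
    rw [← hray]; exact hU.1 N hN f₁
  obtain ⟨hrk, hline⟩ := floor_charge_move hc₁ he hr hy
  subst hrk
  rw [ray_ray_self] at hray
  refine ⟨(N f₁).1 - (ray ((0, 0, 0) : BPoint) r c₁).1, by omega, hline, ?_⟩
  have hNeq : N = Function.update P f₁ (ray ((0, 0, 0) : BPoint) r (c₁ + ((N f₁).1 - (ray ((0, 0, 0) : BPoint) r c₁).1))) := by
    funext g
    by_cases hg : g = f₁
    · subst hg; simp only [Function.update_self]; exact hray
    · rw [Function.update_of_ne hg]; exact (hagree g hg).symm
  rw [← hNeq]; exact hN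

/-- **CLASS «a charged ceiling letter and two unit floor letters» (P side, PROVED** … (doc: `LawSpan`) -/
theorem ceiling_charge_premove {h t c d : ℤ} {k r : Fin 4} {y : BPoint} (hc : 1 ≤ c) (hd : 0 < d) (hr : r ≠ k)
    (hxy : ray ((t, 0, 0) : BPoint) k c = ray y r d) (hy : InDiamond h y) :
    r = k + 2 ∧ 2 * d ≤ t ∧ y = ray ((t - 2 * d, 0, 0) : BPoint) k (c + d) := by
  obtain ⟨a, b1, b2⟩ := y
  have hax := hy.1
  have hle := abs_le.mp hy.2.1
  simp only [chargeOf] at hle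
  fin_cases k <;> fin_cases r <;> simp [AxisPt, Prod.ext_iff] at hxy hax hr hle ⊢ <;> omega

/-- **ceiling letter charged downward (N side)**: with a charged FLOOR letter on … (doc: `LawSpan`) -/
theorem upper_mem_of_floor_ceiling {h : ℤ} {C : MConfig} (hU : C.InDiamond h) {Z : MCell} (hD : RuleDMu4N C Z)
    {f₀ f₁ k₀ k₁ : Fin 4} (hf : f₀ ≠ f₁) {c₀ t₁ c₁ : ℤ} (hc₀ : 1 ≤ c₀) (hc₁ : 1 ≤ c₁) (ht₁ : 0 < t₁)
    (h0 : Z f₀ = ray ((0, 0, 0) : BPoint) k₀ c₀) (h1 : Z f₁ = ray ((t₁, 0, 0) : BPoint) k₁ c₁) :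
    ∃ d, 1 ≤ d ∧ 2 * d ≤ t₁ ∧ Function.update Z f₁ (ray ((t₁ - 2 * d, 0, 0) : BPoint) k₁ (c₁ + d)) ∈ C.upper := by
  have hne : coord (Z f₁) (k₁ + 2) ≠ 0 := by rw [h1, coord_ray_apex_antip]; omega
  obtain ⟨r, hr, P, hP, hagree, hlt, hray⟩ :=
    settledBelow_of_floor hU hD hc₀ h0 (Ne.symm hf) (by rw [h1]; exact adapted_ray_apex_antip t₁ c₁ k₁) hne
  rw [h1] at hray hlt
  have hd : 0 < (ray ((t₁, 0, 0) : BPoint) k₁ c₁).1 - (P f₁).1 := by simp at hlt ⊢; omega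
  have hrk : r ≠ k₁ := by
    intro hrk; apply hr; rw [hrk]; fin_cases k₁ <;> decide
  obtain ⟨-, hdt, hpt⟩ := ceiling_charge_premove hc₁ hd hrk hray (hU.2 P hP f₁)
  refine ⟨(ray ((t₁, 0, 0) : BPoint) k₁ c₁).1 - (P f₁).1, by omega, hdt, ?_⟩
  have hPeq : P = Function.update Z f₁ (ray ((t₁ - 2 * ((ray ((t₁, 0, 0) : BPoint) k₁ c₁).1 - (P f₁).1), 0, 0) : BPoint) k₁
      (c₁ + ((ray ((t₁, 0, 0) : BPoint) k₁ c₁).1 - (P f₁).1))) := by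
    funext g
    by_cases hg : g = f₁
    · subst hg; simp only [Function.update_self]; exact hpt
    · rw [Function.update_of_ne hg]; exact hagree g hg
  rw [← hPeq]; exact hP

/-- **`Saturation A h` (lc-core), dual CLASS «a charged floor letter below the** … (doc: `LawSpan`) -/
theorem settledAbove_of_top {h : ℤ} {C : MConfig} (hU : C.InDiamond h) {P : MCell} (hD : RuleDMu4P C P)
    {f₀ : Fin 4} (h0 : P f₀ = (h, 0, 0)) {g k : Fin 4} (hg : g ≠ f₀) (hadk : Adapted (P g) k) (hne : coord (P g) k ≠ h) :
    SettledAbove C P g k := by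
  have hstuck : ¬ SettledAbove C P f₀ 0 := by
    rintro ⟨r, -, N, hN, -, hlt, -⟩
    have h1 := (hU.1 N hN f₀).2.2.2
    have h2 := abs_nonneg (chargeOf (N f₀))
    rw [h0] at hlt; simp at hlt; simp only [absCharge] at h1; omega
  have hnocov : ∀ j k', ¬ CoveredAbove C P f₀ 0 j k' := by
    rintro j k' ⟨a, b, -, -, N, hN, -, hlt, -, -⟩
    have h1 := (hU.1 N hN f₀).2.2.2
    have h2 := abs_nonneg (chargeOf (N f₀))
    rw [h0] at hlt; simp at hlt; simp only [absCharge] at h1; omega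
  refine settledAbove_of_stuck hD (by rw [h0]; simp [Adapted]) hstuck hnocov hg hadk ?_
  rw [h0]; simpa [coord] using hne

/-- **the origin is stuck below**: no `P`-letter of `◇_h` lies strictly below … (doc: `LawSpan`) -/
theorem settledBelow_of_origin {h : ℤ} {C : MConfig} (hU : C.InDiamond h) {Z : MCell} (hD : RuleDMu4N C Z)
    {f₀ : Fin 4} (h0 : Z f₀ = (0, 0, 0)) {g k : Fin 4} (hg : g ≠ f₀) (hadk : Adapted (Z g) k) (hne : coord (Z g) k ≠ 0) :
    SettledBelow C Z g k := by
  have hfloor : ∀ P ∈ C.upper, ¬ (P f₀).1 < (Z f₀).1 := fun P hP hlt => by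
    have h1 := (hU.2 P hP f₀).2.1
    have h2 := abs_nonneg (chargeOf (P f₀))
    rw [h0] at hlt; simp at hlt; simp only [absCharge] at h1; omega
  obtain ⟨hstuck, hnocov⟩ := stuck_of_floor hfloor (0 : Fin 4)
  refine settledBelow_of_stuck hD (by rw [h0]; decide) hstuck hnocov hg hadk ?_
  rw [h0]; simpa [coord] using hne

/-- below an `N`-cell with the ORIGIN on `f₀` and an apex `t·I`, `t ≠ 0`, on … (doc: `LawSpan`) -/
theorem upper_mem_of_origin_apex {h : ℤ} {C : MConfig} (hU : C.InDiamond h) {Z : MCell} (hD : RuleDMu4N C Z)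
    {f₀ f₁ : Fin 4} (hf : f₀ ≠ f₁) {t : ℤ} (h0 : Z f₀ = (0, 0, 0)) (h1 : Z f₁ = (t, 0, 0)) (ht : t ≠ 0) :
    ∃ P ∈ C.upper, ∃ r : Fin 4, ∃ d : ℤ, 1 ≤ d ∧ (∀ g, g ≠ f₁ → P g = Z g) ∧ ray (P f₁) r d = (t, 0, 0) ∧ (P f₁).1 + d = t := by
  obtain ⟨r, -, P, hP, hagree, hlt, hray⟩ := settledBelow_of_origin hU hD h0 (Ne.symm hf)
    (show Adapted (Z f₁) 0 by rw [h1]; simp [Adapted]) (by rw [h1]; simpa [coord] using ht)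
  rw [h1] at hray hlt
  refine ⟨P, hP, r, t - (P f₁).1, by simp at hlt; omega, hagree, ?_, by omega⟩
  simpa using hray.symm

/-- above a `P`-cell with the TOP APEX `hI` on `f₀` and an apex `t·I`, `t ≠ h` … (doc: `LawSpan`) -/
theorem lower_mem_of_top_apex {h : ℤ} {C : MConfig} (hU : C.InDiamond h) {P : MCell} (hD : RuleDMu4P C P)
    {f₀ f₁ : Fin 4} (hf : f₀ ≠ f₁) {t : ℤ} (h0 : P f₀ = (h, 0, 0)) (h1 : P f₁ = (t, 0, 0)) (ht : t ≠ h) :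
    ∃ r : Fin 4, ∃ e : ℤ, 1 ≤ e ∧ Function.update P f₁ (ray ((t, 0, 0) : BPoint) r e) ∈ C.lower := by
  obtain ⟨r, -, N, hN, hagree, hlt, hray⟩ := settledAbove_of_top hU hD h0 (Ne.symm hf)
    (show Adapted (P f₁) 0 by rw [h1]; simp [Adapted]) (by rw [h1]; simpa [coord] using ht)
  rw [h1] at hray hlt
  refine ⟨r, (N f₁).1 - t, by simp at hlt; omega, ?_⟩
  have hNeq : N = Function.update P f₁ (ray ((t, 0, 0) : BPoint) r ((N f₁).1 - t)) := by
    funext g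
    by_cases hg : g = f₁
    · subst hg; rw [Function.update_self]; simpa using hray
    · rw [Function.update_of_ne hg]; exact (hagree g hg).symm
  rw [← hNeq]; exact hN

/-- **`Saturation A h` (lc-core), CLASS «q = 2 with the top apex `hI` and another** … (doc: `LawSpan`) -/
theorem exists_ray_of_charged {h : ℤ} {x : BPoint} (hx : InDiamond h x) (hch : x.2 ≠ (0, 0)) :
    ∃ (t c : ℤ) (k : Fin 4), 1 ≤ c ∧ 0 ≤ t ∧ t + 2 * c ≤ h ∧ x = ray ((t, 0, 0) : BPoint) k c := by
  obtain ⟨a, b1, b2⟩ := x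
  obtain ⟨hax, hle, -, hh⟩ := hx
  rcases hax with h0 | ⟨hb1, hb2⟩ | ⟨hb1, hb2⟩
  · exact absurd h0 hch
  · simp only at hb1 hb2
    subst hb2
    simp only [absCharge, chargeOf, sub_zero] at hle hh
    rcases lt_or_gt_of_ne hb1 with hneg | hpos
    · rw [abs_of_neg hneg] at hle hh
      exact ⟨a + b1, -b1, 2, by omega, by omega, by omega, by simp [Prod.ext_iff]⟩
    · rw [abs_of_pos hpos] at hle hh
      exact ⟨a - b1, b1, 0, by omega, by omega, by omega, by simp [Prod.ext_iff]⟩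
  · simp only at hb1 hb2
    subst hb1
    simp only [absCharge, chargeOf, zero_sub, abs_neg] at hle hh
    rcases lt_or_gt_of_ne hb2 with hneg | hpos
    · rw [abs_of_neg hneg] at hle hh
      exact ⟨a + b2, -b2, 1, by omega, by omega, by omega, by simp [Prod.ext_iff]⟩
    · rw [abs_of_pos hpos] at hle hh
      exact ⟨a - b2, b2, 3, by omega, by omega, by omega, by simp [Prod.ext_iff]⟩

theorem onFloor_ray_iff {t c : ℤ} (k : Fin 4) (hc : 0 ≤ c) : OnFloor (ray ((t, 0, 0) : BPoint) k c) ↔ t = 0 := by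
  have hx := absCharge_ray_apex t c k hc
  dsimp only [OnFloor] at hx ⊢; rw [hx]; constructor <;> intro e <;> omega

theorem onCeiling_ray_iff {h t c : ℤ} (k : Fin 4) (hc : 0 ≤ c) : OnCeiling h (ray ((t, 0, 0) : BPoint) k c) ↔ t + 2 * c = h := by
  have hx := absCharge_ray_apex t c k hc
  dsimp only [OnCeiling] at hx ⊢; rw [hx]; constructor <;> intro e <;> omega

/-- term-mode forms (no metavariables left to tactic blocks): node∕line of a … (doc: `LawSpan`) -/
theorem node_zero_of_onFloor {Z : MCell} {f k : Fin 4} {t c : ℤ} (hc : 0 ≤ c) (hZ : Z f = ray ((t, 0, 0) : BPoint) k c)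
    (hf : OnFloor (Z f)) : t = 0 := (onFloor_ray_iff k hc).1 (hZ ▸ hf)

theorem line_eq_of_onCeiling {h : ℤ} {Z : MCell} {f k : Fin 4} {t c : ℤ} (hc : 0 ≤ c) (hZ : Z f = ray ((t, 0, 0) : BPoint) k c)
    (hf : OnCeiling h (Z f)) : t + 2 * c = h := (onCeiling_ray_iff k hc).1 (hZ ▸ hf)

theorem onFloor_of_eq {Z : MCell} {f k : Fin 4} {c : ℤ} (hc : 0 ≤ c) (hZ : Z f = ray ((0, 0, 0) : BPoint) k c) : OnFloor (Z f) := by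
  rw [hZ]; exact (onFloor_ray_iff k hc).2 rfl

theorem onCeiling_of_eq {h : ℤ} {Z : MCell} {f k : Fin 4} {t c : ℤ} (hc : 0 ≤ c) (hh : t + 2 * c = h)
    (hZ : Z f = ray ((t, 0, 0) : BPoint) k c) : OnCeiling h (Z f) := by
  rw [hZ]; exact (onCeiling_ray_iff k hc).2 hh

theorem onCeiling_update_of_ne {h : ℤ} {Z : MCell} {f₁ g : Fin 4} (hg : g ≠ f₁) (x : BPoint) (hc : OnCeiling h (Z g)) :
    OnCeiling h (Function.update Z f₁ x g) := by rw [Function.update_of_ne hg]; exact hc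

theorem onFloor_update_of_ne {Z : MCell} {f₁ g : Fin 4} (hg : g ≠ f₁) (x : BPoint) (hf : OnFloor (Z g)) :
    OnFloor (Function.update Z f₁ x g) := by rw [Function.update_of_ne hg]; exact hf

theorem update_apply_of_ne_eq {Z : MCell} {f₁ g : Fin 4} (hg : g ≠ f₁) (x : BPoint) {y : BPoint} (he : Z g = y) :
    Function.update Z f₁ x g = y := by rw [Function.update_of_ne hg]; exact he

theorem line_le_of_ray_inDiamond {h t c : ℤ} {k : Fin 4} (hc : 0 ≤ c) (hx : InDiamond h (ray ((t, 0, 0) : BPoint) k c)) : t + 2 * c ≤ h := by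
  have hl := hx.2.2.2
  rw [absCharge_ray_apex t c k hc, ray_fst] at hl
  simp only at hl; omega

theorem node_nonneg_of_ray_inDiamond {h t c : ℤ} {k : Fin 4} (hc : 0 ≤ c) (hx : InDiamond h (ray ((t, 0, 0) : BPoint) k c)) : 0 ≤ t := by
  have hl := hx.2.1
  rw [absCharge_ray_apex t c k hc, ray_fst] at hl
  simp only at hl; omega

theorem line_le_of_eq {h : ℤ} {Z : MCell} {f k : Fin 4} {t c : ℤ} (hc : 0 ≤ c) (hZ : Z f = ray ((t, 0, 0) : BPoint) k c)
    (hD : InDiamond h (Z f)) : t + 2 * c ≤ h := line_le_of_ray_inDiamond hc (hZ ▸ hD)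

theorem node_nonneg_of_eq {h : ℤ} {Z : MCell} {f k : Fin 4} {t c : ℤ} (hc : 0 ≤ c) (hZ : Z f = ray ((t, 0, 0) : BPoint) k c)
    (hD : InDiamond h (Z f)) : 0 ≤ t := node_nonneg_of_ray_inDiamond hc (hZ ▸ hD)

theorem ray_charged (t : ℤ) (k : Fin 4) {c : ℤ} (hc : 1 ≤ c) : (ray ((t, 0, 0) : BPoint) k c).2 ≠ (0, 0) := by
  fin_cases k <;> simp [Prod.ext_iff] <;> omega

/-- replacing a letter of a fully charged cell by a charged letter keeps it fully charged. -/
theorem allCharged_update {P : MCell} (hch : ∀ f, (P f).2 ≠ (0, 0)) (f₁ : Fin 4) {x : BPoint} (hx : x.2 ≠ (0, 0)) :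
    ∀ f, (Function.update P f₁ x f).2 ≠ (0, 0) := by
  intro f
  by_cases hf : f = f₁
  · subst hf; rwa [Function.update_self]
  · rw [Function.update_of_ne hf]; exact hch f

theorem allCharged_iff_count_four (Z : MCell) : (∀ f, (Z f).2 ≠ (0, 0)) ↔ chargedCount Z = 4 := by
  dsimp only [chargedCount]
  constructor
  · intro h
    rw [Finset.filter_true_of_mem (fun f _ => h f)]; simp
  · intro h f hf
    have hsub : (univ.filter fun f : Fin 4 => (Z f).2 ≠ (0, 0)) ⊆ univ.erase f := by
      intro g hg
      simp only [mem_filter] at hg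
      exact mem_erase.2 ⟨fun e => hg.2 (e ▸ hf), mem_univ _⟩
    have hle := card_le_card hsub
    rw [card_erase_of_mem (mem_univ _), h] at hle
    simp at hle

theorem exists_ne_ne (a b : Fin 4) : ∃ y : Fin 4, y ≠ a ∧ y ≠ b := by
  revert a b; decide

/-- a forward move of a charged letter `t·I + c·ℓ_{i^k}` (`c ≥ 1`) inside `◇_h` … (doc: `LawSpan`) -/
theorem charge_move {h t c e : ℤ} {k r : Fin 4} (hc : 1 ≤ c) (he : 0 < e) (hr : r ≠ k + 2)
    (hy : InDiamond h (ray (ray ((t, 0, 0) : BPoint) k c) r e)) : r = k ∧ t + 2 * (c + e) ≤ h := by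
  have hax := hy.1
  have hl := hy.2.2.2
  have h1 := le_abs_self (chargeOf (ray (ray ((t, 0, 0) : BPoint) k c) r e))
  have h2 := neg_abs_le (chargeOf (ray (ray ((t, 0, 0) : BPoint) k c) r e))
  simp only [absCharge] at hl
  fin_cases k <;> fin_cases r <;> simp [AxisPt, chargeOf, Prod.ext_iff] at hax hr hl h1 h2 ⊢ <;> omega

/-- **line service upward (P side, PROVED, h-uniform)**: at a rule-D `P`-cell … (doc: `LawSpan`) -/
theorem lower_mem_of_ceiling_line {h : ℤ} {C : MConfig} (hU : C.InDiamond h) {P : MCell} (hD : RuleDMu4P C P)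
    {f₀ y k₀ v : Fin 4} (hf : f₀ ≠ y) {t₀ c₀ t c : ℤ} (hc₀ : 1 ≤ c₀) (hh₀ : t₀ + 2 * c₀ = h) (hc : 1 ≤ c) (hlow : t + 2 * c < h)
    (h0 : P f₀ = ray ((t₀, 0, 0) : BPoint) k₀ c₀) (h1 : P y = ray ((t, 0, 0) : BPoint) v c) :
    ∃ e, 1 ≤ e ∧ t + 2 * (c + e) ≤ h ∧ Function.update P y (ray ((t, 0, 0) : BPoint) v (c + e)) ∈ C.lower := by
  have hne : coord (P y) v ≠ h := by rw [h1, coord_ray_apex_self]; omega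
  obtain ⟨r, hr, N, hN, hagree, hlt, hray⟩ :=
    settledAbove_of_ceiling hU hD hc₀ hh₀ h0 (Ne.symm hf) (by rw [h1]; exact adapted_ray_apex_self t c v) hne
  rw [h1] at hray hlt
  have he : 0 < (N y).1 - (ray ((t, 0, 0) : BPoint) v c).1 := by simp at hlt ⊢; omega
  have hyD : InDiamond h (ray (ray ((t, 0, 0) : BPoint) v c) r ((N y).1 - (ray ((t, 0, 0) : BPoint) v c).1)) := by
    rw [← hray]; exact hU.1 N hN y
  obtain ⟨hrk, hline⟩ := charge_move hc he hr hyD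
  subst hrk
  rw [ray_ray_self] at hray
  refine ⟨(N y).1 - (ray ((t, 0, 0) : BPoint) r c).1, by omega, hline, ?_⟩
  have hNeq : N = Function.update P y (ray ((t, 0, 0) : BPoint) r (c + ((N y).1 - (ray ((t, 0, 0) : BPoint) r c).1))) := by
    funext g
    by_cases hg : g = y
    · subst hg; simp only [Function.update_self]; exact hray
    · rw [Function.update_of_ne hg]; exact (hagree g hg).symm
  rw [← hNeq]; exact hN

/-- `NoThree h` (= T1-core for `lawSS`, typed): no static `G₁`-closed support in … (doc: `LawSpan`) -/
def NoThree (h : ℤ) : Prop :=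
  ∀ C : MConfig, C.InDiamond h → C.G1Closed → C.StaticH1 →
    (∀ Z ∈ C.lower, BiAnchored h Z → ThreeCharged Z → False) ∧ ∀ P ∈ C.upper, BiAnchored h P → ThreeCharged P → False

/-- **node service downward forced by the ORIGIN (N side, PROVED, h-uniform)** … (doc: `LawSpan`) -/
theorem upper_mem_of_origin_node {h : ℤ} {C : MConfig} (hU : C.InDiamond h) {Z : MCell} (hD : RuleDMu4N C Z)
    {f₀ f₁ k₁ : Fin 4} (hf : f₀ ≠ f₁) {t₁ c₁ : ℤ} (hc₁ : 1 ≤ c₁) (ht₁ : 0 < t₁)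
    (h0 : Z f₀ = ((0, 0, 0) : BPoint)) (h1 : Z f₁ = ray ((t₁, 0, 0) : BPoint) k₁ c₁) :
    ∃ d, 1 ≤ d ∧ 2 * d ≤ t₁ ∧ Function.update Z f₁ (ray ((t₁ - 2 * d, 0, 0) : BPoint) k₁ (c₁ + d)) ∈ C.upper := by
  have hne : coord (Z f₁) (k₁ + 2) ≠ 0 := by rw [h1, coord_ray_apex_antip]; omega
  obtain ⟨r, hr, P, hP, hagree, hlt, hray⟩ :=
    settledBelow_of_origin hU hD h0 (Ne.symm hf) (by rw [h1]; exact adapted_ray_apex_antip t₁ c₁ k₁) hne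
  rw [h1] at hray hlt
  have hd : 0 < (ray ((t₁, 0, 0) : BPoint) k₁ c₁).1 - (P f₁).1 := by simp at hlt ⊢; omega
  have hrk : r ≠ k₁ := by
    intro hrk; apply hr; rw [hrk]; fin_cases k₁ <;> decide
  obtain ⟨-, hdt, hpt⟩ := ceiling_charge_premove hc₁ hd hrk hray (hU.2 P hP f₁)
  refine ⟨(ray ((t₁, 0, 0) : BPoint) k₁ c₁).1 - (P f₁).1, by omega, hdt, ?_⟩
  have hPeq : P = Function.update Z f₁ (ray ((t₁ - 2 * ((ray ((t₁, 0, 0) : BPoint) k₁ c₁).1 - (P f₁).1), 0, 0) : BPoint) k₁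
      (c₁ + ((ray ((t₁, 0, 0) : BPoint) k₁ c₁).1 - (P f₁).1))) := by
    funext g
    by_cases hg : g = f₁
    · subst hg; simp only [Function.update_self]; exact hpt
    · rw [Function.update_of_ne hg]; exact hagree g hg
  rw [← hPeq]; exact hP

/-- **line service upward forced by the TOP APEX (P side, PROVED, h-uniform)** … (doc: `LawSpan`) -/
theorem lower_mem_of_top_line {h : ℤ} {C : MConfig} (hU : C.InDiamond h) {P : MCell} (hD : RuleDMu4P C P)
    {f₀ y v : Fin 4} (hf : f₀ ≠ y) {t c : ℤ} (hc : 1 ≤ c) (hlow : t + 2 * c < h)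
    (h0 : P f₀ = ((h, 0, 0) : BPoint)) (h1 : P y = ray ((t, 0, 0) : BPoint) v c) :
    ∃ e, 1 ≤ e ∧ t + 2 * (c + e) ≤ h ∧ Function.update P y (ray ((t, 0, 0) : BPoint) v (c + e)) ∈ C.lower := by
  have hne : coord (P y) v ≠ h := by rw [h1, coord_ray_apex_self]; omega
  obtain ⟨r, hr, N, hN, hagree, hlt, hray⟩ :=
    settledAbove_of_top hU hD h0 (Ne.symm hf) (by rw [h1]; exact adapted_ray_apex_self t c v) hne
  rw [h1] at hray hlt
  have he : 0 < (N y).1 - (ray ((t, 0, 0) : BPoint) v c).1 := by simp at hlt ⊢; omega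
  have hyD : InDiamond h (ray (ray ((t, 0, 0) : BPoint) v c) r ((N y).1 - (ray ((t, 0, 0) : BPoint) v c).1)) := by
    rw [← hray]; exact hU.1 N hN y
  obtain ⟨hrk, hline⟩ := charge_move hc he hr hyD
  subst hrk
  rw [ray_ray_self] at hray
  refine ⟨(N y).1 - (ray ((t, 0, 0) : BPoint) r c).1, by omega, hline, ?_⟩
  have hNeq : N = Function.update P y (ray ((t, 0, 0) : BPoint) r (c + ((N y).1 - (ray ((t, 0, 0) : BPoint) r c).1))) := by
    funext g
    by_cases hg : g = y
    · subst hg; simp only [Function.update_self]; exact hray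
    · rw [Function.update_of_ne hg]; exact (hagree g hg).symm
  rw [← hNeq]; exact hN

/-- an uncharged letter on the floor is the origin … -/
theorem eq_origin_of_onFloor {x : BPoint} (hx : x.2 = (0, 0)) (hf : OnFloor x) : x = ((0, 0, 0) : BPoint) := by
  obtain ⟨a, b1, b2⟩ := x
  simp only [Prod.ext_iff] at hx
  obtain ⟨rfl, rfl⟩ := hx
  have ha : a = 0 := by simpa [OnFloor, absCharge, chargeOf] using hf
  subst ha; rfl

/-- … and on the ceiling, the top apex. -/
theorem eq_top_of_onCeiling {h : ℤ} {x : BPoint} (hx : x.2 = (0, 0)) (hc : OnCeiling h x) : x = ((h, 0, 0) : BPoint) := by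
  obtain ⟨a, b1, b2⟩ := x
  simp only [Prod.ext_iff] at hx
  obtain ⟨rfl, rfl⟩ := hx
  have ha : a = h := by simpa [OnCeiling, absCharge, chargeOf] using hc
  subst ha; rfl

/-- an uncharged letter is an apex `t·I`. -/
theorem eq_apex_of_uncharged {x : BPoint} (hx : x.2 = (0, 0)) : x = ((x.1, 0, 0) : BPoint) := by
  obtain ⟨a, b1, b2⟩ := x
  simp only [Prod.ext_iff] at hx
  obtain ⟨rfl, rfl⟩ := hx
  rfl

/-- replacing a charged letter by a charged letter keeps the charged count. -/
theorem chargedCount_update_of_charged {Z : MCell} {f₁ : Fin 4} (h1 : (Z f₁).2 ≠ (0, 0)) {x : BPoint} (hx : x.2 ≠ (0, 0)) :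
    chargedCount (Function.update Z f₁ x) = chargedCount Z := by
  dsimp only [chargedCount]
  congr 1
  ext f
  simp only [mem_filter, mem_univ, true_and]
  by_cases hf : f = f₁
  · subst hf; rw [Function.update_self]; exact ⟨fun _ => h1, fun _ => hx⟩
  · rw [Function.update_of_ne hf]

theorem chargedCount_le_four (Z : MCell) : chargedCount Z ≤ 4 := (card_le_univ _).trans (by simp)

/-- in a two-charged cell, next to a charged letter there is another charged letter … -/
theorem exists_charged_ne {Z : MCell} (hq : chargedCount Z = 2) (a : Fin 4) : ∃ b, b ≠ a ∧ (Z b).2 ≠ (0, 0) := by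
  obtain ⟨x, y, hxy, hs⟩ := card_eq_two.1 hq
  have hx : (Z x).2 ≠ (0, 0) := by
    have : x ∈ (univ.filter fun f : Fin 4 => (Z f).2 ≠ (0, 0)) := by rw [hs]; simp
    simpa using this
  have hy : (Z y).2 ≠ (0, 0) := by
    have : y ∈ (univ.filter fun f : Fin 4 => (Z f).2 ≠ (0, 0)) := by rw [hs]; simp
    simpa using this
  by_cases hxa : x = a
  · subst hxa; exact ⟨y, Ne.symm hxy, hy⟩
  · exact ⟨x, hxa, hx⟩

/-- … and the two other letters are uncharged. -/
theorem uncharged_of_two {Z : MCell} (hq : chargedCount Z = 2) {a b : Fin 4} (hab : a ≠ b) (ha : (Z a).2 ≠ (0, 0)) (hb : (Z b).2 ≠ (0, 0))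
    (f : Fin 4) (hfa : f ≠ a) (hfb : f ≠ b) : (Z f).2 = (0, 0) := by
  by_contra hf
  have hsub : ({a, b, f} : Finset (Fin 4)) ⊆ (univ.filter fun g : Fin 4 => (Z g).2 ≠ (0, 0)) := by
    intro x hx
    simp only [mem_insert, mem_singleton] at hx
    rcases hx with rfl | rfl | rfl <;> simpa
  have h3 : ({a, b, f} : Finset (Fin 4)).card = 3 := card_eq_three.2 ⟨a, b, f, hab, Ne.symm hfa, Ne.symm hfb, rfl⟩
  have := card_le_card hsub
  rw [h3] at this
  have hq' : (univ.filter fun g : Fin 4 => (Z g).2 ≠ (0, 0)).card = 2 := hq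
  omega

/-- **(A1) N side — PROVED for every `h`**: under the no-three-charged core (P … (doc: `LawSpan`) -/
theorem no_apex_of_two_lower {h : ℤ} {C : MConfig} (hU : C.InDiamond h) (hS : C.StaticH1)
    (noP : ∀ P ∈ C.upper, BiAnchored h P → ThreeCharged P → False)
    {Z : MCell} (hZ : Z ∈ C.lower) (hq : chargedCount Z = 2) (hB : BiAnchored h Z)
    {f₁ : Fin 4} {t : ℤ} (h1 : Z f₁ = ((t, 0, 0) : BPoint)) (ht : t ≠ 0) : False := by
  obtain ⟨⟨f₀, hf0⟩, ⟨g, hg⟩⟩ := hB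
  have hf : f₀ ≠ f₁ := by
    rintro rfl
    rw [h1] at hf0
    have : t = 0 := by simpa [OnFloor, absCharge, chargeOf] using hf0
    exact ht this
  obtain ⟨P, hP, r, d, hd, hagree, hray, hsum⟩ : ∃ P ∈ C.upper, ∃ r : Fin 4, ∃ d : ℤ, 1 ≤ d ∧ (∀ g, g ≠ f₁ → P g = Z g) ∧
      ray (P f₁) r d = (t, 0, 0) ∧ (P f₁).1 + d = t := by
    by_cases hch : (Z f₀).2 = (0, 0)
    · exact upper_mem_of_origin_apex hU (hS.1.1 Z hZ) hf (eq_origin_of_onFloor hch hf0) h1 ht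
    · obtain ⟨t₀, c₀, k₀, hc₀, -, -, h0⟩ := exists_ray_of_charged (hU.1 Z hZ f₀) hch
      have ht0 : t₀ = 0 := node_zero_of_onFloor (by omega) h0 hf0
      subst ht0
      exact upper_mem_of_floor_apex hU (hS.1.1 Z hZ) hf hc₀ h0 h1 ht
  have hzc : absCharge (P f₁) = d := absCharge_of_ray_eq_apex (by omega) hray
  have hPeq : P = Function.update Z f₁ (P f₁) := by
    funext g'
    by_cases hg' : g' = f₁
    · subst hg'; simp
    · rw [Function.update_of_ne hg']; exact hagree g' hg'
  have hx : (P f₁).2 ≠ (0, 0) := by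
    intro h0'
    have : absCharge (P f₁) = 0 := by simp [absCharge, chargeOf, h0']
    omega
  have h3 : ThreeCharged P := by
    show chargedCount P = 3
    rw [hPeq, chargedCount_update_charged (by rw [h1]) hx, hq]
  refine noP P hP ⟨⟨f₀, by rw [hagree f₀ hf]; exact hf0⟩, ?_⟩ h3
  by_cases hg1 : g = f₁
  · subst hg1
    have hth : t = h := by rw [h1] at hg; simpa [OnCeiling, absCharge, chargeOf] using hg
    exact ⟨g, by show (P g).1 + absCharge (P g) = h; rw [hzc]; omega⟩
  · exact ⟨g, by rw [hagree g hg1]; exact hg⟩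

/-- exactly two charged slots ⇒ `chargedCount = 2`. -/
theorem chargedCount_eq_two {Z : MCell} {a b : Fin 4} (hab : a ≠ b) (ha : (Z a).2 ≠ (0, 0)) (hb : (Z b).2 ≠ (0, 0))
    (hrest : ∀ f, f ≠ a → f ≠ b → (Z f).2 = (0, 0)) : chargedCount Z = 2 := by
  have hs : (univ.filter fun f : Fin 4 => (Z f).2 ≠ (0, 0)) = {a, b} := by
    ext f
    simp only [mem_filter, mem_univ, true_and, mem_insert, mem_singleton]
    constructor
    · intro hf
      by_contra hne
      rw [not_or] at hne
      exact hf (hrest f hne.1 hne.2)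
    · rintro (rfl | rfl)
      · exact ha
      · exact hb
  show (univ.filter fun f : Fin 4 => (Z f).2 ≠ (0, 0)).card = 2
  rw [hs, card_pair hab]

/-- the encoder charge `cabs` of a table letter `t·I + c·ℓ_{i^k}` is `c`. -/
theorem cabs_ray_apex (t c : ℤ) (k : Fin 4) (hc : 0 ≤ c) : cabs (ray ((t, 0, 0) : BPoint) k c) = c := by
  fin_cases k <;> simp [cabs, abs_of_nonneg hc, max_eq_left hc, max_eq_right hc]

/-- no letter of `◇_h` is spacelike-separated from the origin (`|β| = |c| ≤ α` on an axis letter). -/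
theorem not_spacelike_of_inDiamond {h : ℤ} {x : BPoint} (hx : InDiamond h x) : ¬ Spacelike (bsub x ((0, 0, 0) : BPoint)) := by
  obtain ⟨a, b1, b2⟩ := x
  obtain ⟨hax, hle, -, -⟩ := hx
  simp only [absCharge, chargeOf] at hle
  have hsq : (b1 - b2) * (b1 - b2) ≤ a * a := by
    have := mul_self_le_mul_self (abs_nonneg _) hle
    rwa [abs_mul_abs_self] at this
  have hprod : b1 * b2 = 0 := by
    rcases hax with h0 | ⟨-, h0⟩ | ⟨h0, -⟩ <;> simp_all
  simp only [Spacelike, sub_zero, not_lt]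
  nlinarith [hsq, hprod]

/-- **(DN) rule D under the origin**: the floor letter `c·ℓ_v` of a RULE-D … (doc: `LawSpan`) -/
theorem exists_partner_of_origin {h : ℤ} {C : MConfig} (hU : C.InDiamond h) {Z : MCell} (hD : RuleDMu4N C Z)
    {o b v : Fin 4} {c : ℤ} (hob : o ≠ b) (hc : 1 ≤ c) (hZo : Z o = ((0, 0, 0) : BPoint)) (hZb : Z b = ray ((0, 0, 0) : BPoint) v c) :
    ∃ P ∈ C.upper, ∃ d : ℤ, 1 ≤ d ∧ d ≤ c ∧ (∀ g, g ≠ b → P g = Z g) ∧ P b = ray ((0, 0, 0) : BPoint) v (c - d) := by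
  obtain ⟨r, -, P, hP, hagree, hlt, hray⟩ := settledBelow_of_origin hU hD hZo hob.symm
    (by rw [hZb]; exact adapted_ray_apex_self 0 c v) (by rw [hZb, coord_ray_apex_self]; omega)
  obtain ⟨-, hle, hPb⟩ := floor_move hc (by omega) (hZb.symm.trans hray) (hU.2 P hP b)
  exact ⟨P, hP, (Z b).1 - (P b).1, by omega, hle, hagree, hPb⟩

/-- two antipodal null moves from a table letter: `(t·I + c·ℓ_k) + e·n_{k+2} = (t+2e)·I + (c−e)·ℓ_k`. -/
theorem ray_ray_antip (t c e : ℤ) (k : Fin 4) :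
    ray (ray ((t, 0, 0) : BPoint) k c) (k + 2) e = ray ((t + 2 * e, 0, 0) : BPoint) k (c - e) := by
  fin_cases k <;> refine Prod.ext ?_ (Prod.ext ?_ ?_) <;> simp <;> ring

/-- the zero move. -/
theorem ray_zero (x : BPoint) (k : Fin 4) : ray x k 0 = x := by
  obtain ⟨a, b, c⟩ := x
  simp

/-- a letter `d ≥ 1` null steps below an apex is charged. -/
theorem charged_of_ray_eq_apex {z : BPoint} {r : Fin 4} {d t : ℤ} (hd : 0 < d) (hz : ray z r d = ((t, 0, 0) : BPoint)) : z.2 ≠ (0, 0) := by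
  obtain ⟨z1, z2, z3⟩ := z
  fin_cases r <;> simp [Prod.ext_iff] at hz ⊢ <;> omega

/-- in the dual world every letter of `◇_h` lies in the closed future cone of the … (doc: `LawSpan`) -/
theorem effective_dual_top {h : ℤ} {x : BPoint} (hx : InDiamond h x) : Effective (bsub (dualPt 0 x) (dualPt 0 ((h, 0, 0) : BPoint))) := by
  obtain ⟨a, b1, b2⟩ := x
  obtain ⟨hax, hle, -, hh⟩ := hx
  simp only [absCharge, chargeOf] at hle hh
  have h0 := abs_nonneg (b1 - b2)
  have hsq : (b1 - b2) * (b1 - b2) ≤ (h - a) * (h - a) := by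
    have := mul_self_le_mul_self (abs_nonneg _) (show |b1 - b2| ≤ h - a by omega)
    rwa [abs_mul_abs_self] at this
  have hprod : b1 * b2 = 0 := by
    rcases hax with h0 | ⟨-, h0⟩ | ⟨h0, -⟩ <;> simp_all
  refine ⟨by simp; omega, ?_⟩
  nlinarith [hsq, hprod]

/-- nothing of `◇_h` is null-below the dual top apex (it would have `α > h`): (H-b) and `W_f` are vacuous at an `hI`-slot. -/
theorem not_nullBelow_dual_top {h : ℤ} {x : BPoint} (hx : InDiamond h x) : ¬ NullBelow (dualPt 0 x) (dualPt 0 ((h, 0, 0) : BPoint)) := by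
  intro hnb
  have h1 := hnb.1
  have h2 := hx.2.2.2
  have h3 := abs_nonneg (chargeOf x)
  simp only [absCharge] at h2
  simp at h1
  omega

/-- **the (A1)-dead shape, `N` side**: an `N`-cell carrying the corner letter … (doc: `LawSpan`) -/
theorem false_of_cornerlike_lower {h : ℤ} {C : MConfig} (hU : C.InDiamond h) (hS : C.StaticH1) (hpos : 0 < h)
    (noP : ∀ P ∈ C.upper, BiAnchored h P → ThreeCharged P → False)
    {N : MCell} (hN : N ∈ C.lower) {a x y u : Fin 4} {m : ℤ} (hax : a ≠ x) (hm : 2 * m = h)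
    (hNa : N a = ray ((0, 0, 0) : BPoint) u m) (hNx : (N x).2 ≠ (0, 0)) (hNy : N y = ((h, 0, 0) : BPoint))
    (hrest : ∀ f, f ≠ a → f ≠ x → (N f).2 = (0, 0)) : False :=
  no_apex_of_two_lower hU hS noP hN (chargedCount_eq_two hax (by rw [hNa]; exact ray_charged 0 u (by omega)) hNx hrest)
    ⟨⟨a, onFloor_of_eq (by omega) hNa⟩, ⟨a, onCeiling_of_eq (by omega) (by omega : 0 + 2 * m = h) hNa⟩⟩ hNy (by omega)

/-- **every partner ABOVE a corner `P`-cell on the slot of `y` is the thin cell** … (doc: `LawSpan`) -/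
theorem partner_above_eq_top {h : ℤ} {C : MConfig} (hU : C.InDiamond h) (hS : C.StaticH1) (hpos : 0 < h)
    (noP : ∀ P ∈ C.upper, BiAnchored h P → ThreeCharged P → False)
    {P N : MCell} (hN : N ∈ C.lower) {a b g₁ u v r : Fin 4} {m t c : ℤ} (hab : a ≠ b) (hg₁b : g₁ ≠ b)
    (hm : 2 * m = h) (hc : 1 ≤ c) (hh : t + 2 * c = h) (hPa : P a = ray ((0, 0, 0) : BPoint) u m)
    (hPb : P b = ray ((t, 0, 0) : BPoint) v c) (hPg : P g₁ = ((h, 0, 0) : BPoint)) (hrest : ∀ f, f ≠ a → f ≠ b → (P f).2 = (0, 0))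
    (hup : UPartner N P b r) : N b = ((h, 0, 0) : BPoint) := by
  obtain ⟨hagree, hlt, hray⟩ := hup
  obtain ⟨e, he⟩ : ∃ e : ℤ, e = (N b).1 - (P b).1 := ⟨_, rfl⟩
  rw [← he] at hray
  have he0 : 0 < e := by omega
  have hyD : InDiamond h (ray (ray ((t, 0, 0) : BPoint) v c) r e) := by
    have := hU.1 N hN b
    rwa [hray, hPb] at this
  obtain ⟨-, hle, heq⟩ := ceiling_move hc hh he0 hyD
  have hNb : N b = ray ((t + 2 * e, 0, 0) : BPoint) v (c - e) := by rw [hray, hPb, heq]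
  by_cases hec : e < c
  · exact (false_of_cornerlike_lower hU hS hpos noP hN hab hm (by rw [← hagree a hab, hPa])
      (by rw [hNb]; exact ray_charged _ v (by omega)) (by rw [← hagree g₁ hg₁b, hPg])
      (fun f hfa hfb => by rw [← hagree f hfb]; exact hrest f hfa hfb)).elim
  · rw [hNb, show c - e = 0 by omega, ray_zero, show t + 2 * e = h by omega]

/-- **(DP) the thin cell above a corner `P`-cell is present**: `P₀(y ↦ hI) ∈ E₋`. -/
theorem lower_mem_of_top_node {h : ℤ} {C : MConfig} (hU : C.InDiamond h) (hS : C.StaticH1) (hpos : 0 < h)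
    (noP : ∀ P ∈ C.upper, BiAnchored h P → ThreeCharged P → False)
    {P : MCell} (hP : P ∈ C.upper) {a b g₁ u v : Fin 4} {m t c : ℤ} (hab : a ≠ b) (hg₁b : g₁ ≠ b)
    (hm : 2 * m = h) (hc : 1 ≤ c) (hh : t + 2 * c = h) (hPa : P a = ray ((0, 0, 0) : BPoint) u m)
    (hPb : P b = ray ((t, 0, 0) : BPoint) v c) (hPg : P g₁ = ((h, 0, 0) : BPoint)) (hrest : ∀ f, f ≠ a → f ≠ b → (P f).2 = (0, 0)) :
    Function.update P b ((h, 0, 0) : BPoint) ∈ C.lower := by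
  obtain ⟨r, -, N, hN, hup⟩ := settledAbove_of_top hU (hS.1.2 P hP) hPg hg₁b.symm
    (by rw [hPb]; exact adapted_ray_apex_antip t c v) (by rw [hPb, coord_ray_apex_antip]; omega)
  have hNb := partner_above_eq_top hU hS hpos noP hN hab hg₁b hm hc hh hPa hPb hPg hrest hup
  have hNeq : Function.update P b ((h, 0, 0) : BPoint) = N := by
    funext g
    by_cases hg : g = b
    · subst hg; rw [Function.update_self, hNb]
    · rw [Function.update_of_ne hg]; exact hup.1 g hg
  rw [hNeq]; exact hN

/-- the top apex is one antipodal unit step above a unit ceiling letter: `hI = ((h-2)·I + ℓ_v) + n_{v+2}`. -/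
theorem top_eq_ray_unit (h : ℤ) (v : Fin 4) : ((h, 0, 0) : BPoint) = ray (ray ((h - 2, 0, 0) : BPoint) v 1) (v + 2) 1 := by
  fin_cases v <;> refine Prod.ext ?_ (Prod.ext ?_ ?_) <;> simp <;> ring

/-- (DP) `P f₀ = hI`, `P f₁ = (h-2)·I + ℓ_v` force `P(f₁ ↦ hI) ∈ E₋` (h-uniform). -/
theorem lower_mem_of_unit_top {h : ℤ} {C : MConfig} (hU : C.InDiamond h) {P : MCell} (hD : RuleDMu4P C P)
    {f₀ f₁ k₁ : Fin 4} (hf : f₀ ≠ f₁) (h0 : P f₀ = ((h, 0, 0) : BPoint)) (h1 : P f₁ = ray ((h - 2, 0, 0) : BPoint) k₁ 1) :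
    Function.update P f₁ ((h, 0, 0) : BPoint) ∈ C.lower := by
  have hne : coord (P f₁) (k₁ + 2) ≠ h := by rw [h1, coord_ray_apex_antip]; omega
  obtain ⟨r, -, N, hN, hagree, hlt, hray⟩ :=
    settledAbove_of_top hU hD h0 (Ne.symm hf) (by rw [h1]; exact adapted_ray_apex_antip (h - 2) 1 k₁) hne
  have hy : InDiamond h (ray (P f₁) r ((N f₁).1 - (P f₁).1)) := by rw [← hray]; exact hU.1 N hN f₁
  rw [h1] at hy hlt
  obtain ⟨-, -, hpt⟩ := ceiling_unit_move (by rw [h1] at hray; simp at hlt ⊢; omega) hy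
  have hNf : N f₁ = (h, 0, 0) := by rw [hray, h1]; exact hpt
  have hNeq : N = Function.update P f₁ ((h, 0, 0) : BPoint) := by
    funext g
    by_cases hg : g = f₁
    · subst hg; simp [hNf]
    · rw [Function.update_of_ne hg]; exact (hagree g hg).symm
  rw [← hNeq]; exact hN

/-- (DN) `Z f₀ = O`, `Z f₁ = ℓ_v` force `Z(f₁ ↦ O) ∈ E₊` (h-uniform). -/
theorem upper_mem_of_unit_origin {h : ℤ} {C : MConfig} (hU : C.InDiamond h) {Z : MCell} (hD : RuleDMu4N C Z)
    {f₀ f₁ k₁ : Fin 4} (hf : f₀ ≠ f₁) (h0 : Z f₀ = ((0, 0, 0) : BPoint)) (h1 : Z f₁ = ray ((0, 0, 0) : BPoint) k₁ 1) :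
    Function.update Z f₁ ((0, 0, 0) : BPoint) ∈ C.upper := by
  have hne : coord (Z f₁) k₁ ≠ 0 := by rw [h1, coord_ray_apex_self]; omega
  obtain ⟨r, -, P, hP, hagree, hlt, hray⟩ :=
    settledBelow_of_origin hU hD h0 (Ne.symm hf) (by rw [h1]; exact adapted_ray_apex_self 0 1 k₁) hne
  rw [h1] at hray hlt
  obtain ⟨hpt, -, -⟩ := floor_unit_move (by simp at hlt ⊢; omega) hray (hU.2 P hP f₁)
  have hPeq : P = Function.update Z f₁ ((0, 0, 0) : BPoint) := by
    funext g
    by_cases hg : g = f₁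
    · subst hg; simp [hpt]
    · rw [Function.update_of_ne hg]; exact hagree g hg
  rw [← hPeq]; exact hP

/-- **(Xp_d) THE TOP-SLOT `X⁺` KILL AT SIBLING DEPTH `d` (PROVED, h-uniform)**: a … (doc: `LawSpan`) -/
theorem not_upper_unit_top_depth {h : ℤ} {C : MConfig} (hU : C.InDiamond h) (hS : C.StaticH1)
    {P : MCell} (hP : P ∈ C.upper) {b g₁ v : Fin 4} (hg₁b : g₁ ≠ b)
    (hPb : P b = ray ((h - 2, 0, 0) : BPoint) v 1) (hPg : P g₁ = ((h, 0, 0) : BPoint))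
    {P₁ : MCell} (hP₁ : P₁ ∈ C.upper) {r : Fin 4} (hr : r ≠ v + 2)
    (hsib : UPartner (Function.update P b ((h, 0, 0) : BPoint)) P₁ b r)
    (hcomp : ∀ N ∈ C.lower, (∀ g, g ≠ b → N g = P g) → (P₁ b).1 < (N b).1 → (N b).1 < h →
      N b ≠ ray (P₁ b) r ((N b).1 - (P₁ b).1)) : False := by
  have hN₀ := lower_mem_of_unit_top hU (hS.1.2 P hP) hg₁b hPg hPb
  set N₀ : MCell := Function.update P b ((h, 0, 0) : BPoint) with hN₀def
  have hN₀b : N₀ b = ((h, 0, 0) : BPoint) := Function.update_self ..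
  have hN₀g : ∀ g, g ≠ b → N₀ g = P g := fun g hg => Function.update_of_ne hg ..
  -- every partner above the unit ceiling letter sits at the top apex
  have htop : ∀ N ∈ C.lower, ∀ w : Fin 4, UPartner N P b w → N b = ((h, 0, 0) : BPoint) := by
    rintro N hN w ⟨-, hlt, hray⟩
    have hy : InDiamond h (ray (P b) w ((N b).1 - (P b).1)) := by rw [← hray]; exact hU.1 N hN b
    rw [hPb] at hy hlt
    obtain ⟨-, -, hpt⟩ := ceiling_unit_move (by rw [hPb] at hray; simp at hlt ⊢; omega) hy
    rw [hray, hPb]; exact hpt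
  refine hS.2.1 (dualCell 0 P) (dualCell_mem_dual_lower hP) (dualCell 0 N₀) (dualCell_mem_dual_upper hN₀)
    (dualCell 0 P₁) (dualCell_mem_dual_lower hP₁) b (v + 2) r g₁ ⟨?_, hg₁b, ?_, ?_, hr, ?_, ?_, ?_, ?_, ?_⟩
  · -- the unit letter is charged
    change ¬ isApex (dualPt 0 (P b))
    rw [isApex_dual, hPb]
    fin_cases v <;> simp [isApex]
  · -- `N₀^∨` is a `(v+2)`-partner of the head
    refine (uPartner_dual 0 N₀ P b (v + 2)).mpr ⟨fun g hg => (hN₀g g hg).symm, by rw [hPb, hN₀b]; simp; omega, ?_⟩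
    have h1 : ((h, 0, 0) : BPoint).1 - (ray ((h - 2, 0, 0) : BPoint) v 1).1 = 1 := by simp; omega
    rw [hN₀b, hPb, h1]
    exact top_eq_ray_unit h v
  · -- … and the topmost one
    intro Q hQ hup
    obtain ⟨N, hN, rfl⟩ : ∃ N ∈ C.lower, dualCell 0 N = Q := ⟨_, mem_dual_upper.mp hQ, dualCell_dualCell 0 Q⟩
    have hNb := htop N hN (v + 2) ((uPartner_dual 0 N P b (v + 2)).mp hup)
    change 0 - (N b).1 ≤ 0 - (N₀ b).1
    exact le_of_eq (by rw [hNb, hN₀b])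
  · -- the sibling `P₁^∨`
    obtain ⟨hag', hlt', hray'⟩ := (uPartner_dual 0 N₀ P₁ b r).mpr hsib
    exact ⟨fun g hg => (hag' g hg).symm, hlt', hray'⟩
  · -- no companion strictly between `P₁ b` and `hI` on the ray (hypothesis `hcomp`, read in the dual world)
    intro Q hQ hag hlt1 hlt2 hray
    obtain ⟨N, hN, rfl⟩ : ∃ N ∈ C.lower, dualCell 0 N = Q := ⟨_, mem_dual_upper.mp hQ, dualCell_dualCell 0 Q⟩
    have h1 : (0 : ℤ) - (N₀ b).1 < 0 - (N b).1 := hlt1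
    have h2 : (0 : ℤ) - (N b).1 < 0 - (P₁ b).1 := hlt2
    rw [hN₀b] at h1
    simp at h1
    have hNg : ∀ g, g ≠ b → N g = P g := fun g hg => by
      have e := hag g hg
      change dualPt 0 (N g) = dualPt 0 (N₀ g) at e
      rw [hN₀g g hg] at e
      have e' := congrArg (dualPt 0) e
      simpa [dualPt] using e'
    refine hcomp N hN hNg (by omega) h1 ?_
    -- the ray equation: from `Q_σ = q_σ + c′·n_r` (dual) and `hI = P₁ b + d·n_r`
    obtain ⟨-, -, hsray⟩ := hsib
    rw [hN₀b] at hsray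
    change dualPt 0 (N b) = ray (dualPt 0 (N₀ b)) r ((dualPt 0 (N b)).1 - (dualPt 0 (N₀ b)).1) at hray
    rw [hN₀b] at hray
    generalize N b = nb at hray h1 ⊢
    generalize P₁ b = pb at hsray ⊢
    obtain ⟨n1, n2, n3⟩ := nb
    obtain ⟨p1, p2, p3⟩ := pb
    simp only [dualPt, ray, Prod.mk.injEq] at hray hsray ⊢
    obtain ⟨-, hr2, hr3⟩ := hray
    obtain ⟨hs1, hs2, hs3⟩ := hsray
    exact ⟨by ring, by linear_combination hs2 - hr2, by linear_combination hs3 - hr3⟩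
  · -- (H-e′) is automatic: every letter of `◇_h` is causally below `hI`
    intro Q hQ _ _ _ _
    obtain ⟨N, hN, rfl⟩ : ∃ N ∈ C.lower, dualCell 0 N = Q := ⟨_, mem_dual_upper.mp hQ, dualCell_dualCell 0 Q⟩
    change Effective (bsub (dualPt 0 (N b)) (dualPt 0 (N₀ b)))
    rw [hN₀b]
    exact effective_dual_top (hU.1 N hN b)
  · -- (H-b) is vacuous at the `hI`-slot `g₁`
    intro Q hQ _ hnb _
    obtain ⟨N, hN, rfl⟩ : ∃ N ∈ C.lower, dualCell 0 N = Q := ⟨_, mem_dual_upper.mp hQ, dualCell_dualCell 0 Q⟩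
    change NullBelow (dualPt 0 (N g₁)) (dualPt 0 (P g₁)) at hnb
    rw [hPg] at hnb
    exact absurd hnb (not_nullBelow_dual_top (hU.1 N hN g₁))
  · -- `W_f = ∅` is vacuous at `g₁`
    intro Q hQ hnb
    obtain ⟨N, hN, rfl⟩ : ∃ N ∈ C.lower, dualCell 0 N = Q := ⟨_, mem_dual_upper.mp hQ, dualCell_dualCell 0 Q⟩
    change NullBelow (dualPt 0 (N g₁)) (dualPt 0 (P g₁)) at hnb
    rw [hPg] at hnb
    exact absurd hnb (not_nullBelow_dual_top (hU.1 N hN g₁))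

/-- **(Xp) the depth-one case (PROVED, h-uniform)**: the sibling `P₁` sits one … (doc: `LawSpan`) -/
theorem not_upper_unit_top {h : ℤ} {C : MConfig} (hU : C.InDiamond h) (hS : C.StaticH1)
    {P : MCell} (hP : P ∈ C.upper) {b g₁ v : Fin 4} (hg₁b : g₁ ≠ b)
    (hPb : P b = ray ((h - 2, 0, 0) : BPoint) v 1) (hPg : P g₁ = ((h, 0, 0) : BPoint))
    {P₁ : MCell} (hP₁ : P₁ ∈ C.upper) {r : Fin 4} (hr : r ≠ v + 2)
    (hsib : UPartner (Function.update P b ((h, 0, 0) : BPoint)) P₁ b r) (hlev : (P₁ b).1 = h - 1) : False :=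
  not_upper_unit_top_depth hU hS hP hg₁b hPb hPg hP₁ hr hsib fun N _ _ hlt1 hlt2 _ => by omega

/-- **(Am) THE SELF-SERVED `A2I⁻` KILL AT A UNIT FLOOR LETTER (PROVED** … (doc: `LawSpan`) -/
theorem not_lower_unit_origin {h : ℤ} {C : MConfig} (hU : C.InDiamond h) (hG : C.G1Closed) (hS : C.StaticH1)
    {Z : MCell} (hZ : Z ∈ C.lower) {b o a : Fin 4} (hob : o ≠ b)
    (hZb : Z b = ray ((0, 0, 0) : BPoint) a 1) (hZo : Z o = ((0, 0, 0) : BPoint))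
    (hkill : ∀ P ∈ C.upper, P o = ray ((0, 0, 0) : BPoint) a 1 → P b = ((0, 0, 0) : BPoint) →
      (∀ g, g ≠ b → g ≠ o → P g = Z g) → False) : False := by
  have hα : ∀ P ∈ C.upper, ∀ f, 0 ≤ (P f).1 := fun P hP f => by
    have h1 := (hU.2 P hP f).2.1
    have h2 := abs_nonneg (chargeOf (P f))
    simp only [absCharge] at h1
    omega
  -- (DN) the partner `q = Z(b ↦ O)` is present
  have hq := upper_mem_of_unit_origin hU (hS.1.1 Z hZ) hob hZo hZb
  set q : MCell := Function.update Z b ((0, 0, 0) : BPoint) with hqdef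
  have hqb0 : q b = ((0, 0, 0) : BPoint) := Function.update_self ..
  have hagree : ∀ g, g ≠ b → q g = Z g := fun g hg => Function.update_of_ne hg ..
  -- (Am) the server `N′ = Z ∘ swap(b, o)` is present by `G₁`-closure
  obtain ⟨N', hN'⟩ : ∃ N' : MCell, N' = Z.perm (Equiv.swap b o) := ⟨_, rfl⟩
  have hN'mem : N' ∈ C.lower := by rw [hN']; exact hG.1 _ Z hZ
  have hN'b : N' b = ((0, 0, 0) : BPoint) := by
    rw [hN']; show Z (Equiv.swap b o b) = _; rw [Equiv.swap_apply_left, hZo]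
  have hN'o : N' o = ray ((0, 0, 0) : BPoint) a 1 := by
    rw [hN']; show Z (Equiv.swap b o o) = _; rw [Equiv.swap_apply_right, hZb]
  have hN'g : ∀ g, g ≠ b → g ≠ o → N' g = Z g := fun g hgb hgo => by
    rw [hN']; show Z (Equiv.swap b o g) = _; rw [Equiv.swap_apply_of_ne_of_ne hgb hgo]
  refine hS.2.2 Z hZ q hq N' hN'mem b a o a ⟨?_, ?_, ?_, ?_, hob, ?_, ?_, ?_, ?_, ?_, ?_⟩
  · -- `Z_b = ℓ_a` is charged
    rw [hZb]; fin_cases a <;> simp [isApex]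
  · -- `EncDir`: the partner direction is the own phase `a`
    rw [hZb]
    left
    refine ⟨by simp, ?_⟩
    rw [cabs_ray_apex 0 1 a (by omega)]
    simp
  · -- `q` is the `a`-partner at depth `1`
    exact ⟨hagree, by rw [hqb0, hZb]; simp, by rw [hqb0, hZb]; simp⟩
  · -- the guard `d ≤ cabs`
    intro _
    rw [hqb0, hZb, cabs_ray_apex 0 1 a (by omega)]
    simp
  · -- `N′ = q(o ↦ ℓ_a)` is the server along `a`
    refine ⟨fun g hgo => ?_, by rw [hagree o hob, hZo, hN'o]; simp, by rw [hagree o hob, hZo, hN'o]; simp⟩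
    by_cases hgb : g = b
    · subst hgb; rw [hqb0, hN'b]
    · rw [hagree g hgb, hN'g g hgb hgo]
  · -- `A2IPRES`: a partner in another direction would have its letter outside `◇_h`
    rintro P hP w hw ⟨-, hlt, hray⟩
    exact hw (floor_unit_move (by omega) (hZb.symm.trans hray) (hU.2 P hP b)).2.2
  · -- `inter`: every `a`-partner is `q` itself (one step to the origin)
    rintro P hP ⟨-, hlt, hray⟩
    obtain ⟨hPb, -, -⟩ := floor_unit_move (by omega) (hZb.symm.trans hray) (hU.2 P hP b)
    rw [hqb0, hPb]
  · -- `deeper`: nothing lies below `O`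
    rintro P hP ⟨-, hlt, -⟩
    have := hα P hP b
    rw [hqb0] at hlt
    simp at hlt
    omega
  · -- `A1W`: nothing is null-below `O`
    intro P hP hnb _
    have := hα P hP o
    have h2 := hnb.1
    rw [hZo] at h2
    simp at h2
    omega
  · -- polluters: species (3b) is the killed `P`-cell `Z ∘ swap(b, o)`, species (3d) needs a spacelike offset from `O` inside `◇_h`
    intro P hP hag hul
    have hPb : P b = ((0, 0, 0) : BPoint) := by
      obtain ⟨hle, heq⟩ := hul
      rw [hqb0] at hle heq
      have h0 : (P b).1 = 0 := by have := hα P hP b; simp at hle; omega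
      have h1 : (P b).2.1 = 0 := by have := congrArg (fun p : BPoint => p.2.1) heq; simp [h0] at this; omega
      have h2 : (P b).2.2 = 0 := by have := congrArg (fun p : BPoint => p.2.2) heq; simp [h0] at this; omega
      exact Prod.ext h0 (Prod.ext h1 h2)
    refine ⟨?_, ?_⟩
    · rintro ⟨hlt, hle, hray⟩
      rw [hZo] at hlt hray
      rw [hN'o] at hle
      have h1 : (P o).1 = 1 := by simp at hlt hle; omega
      have hPo : P o = ray ((0, 0, 0) : BPoint) a 1 := by
        rw [hray]
        fin_cases a <;> refine Prod.ext ?_ (Prod.ext ?_ ?_) <;> simp [h1]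
      exact hkill P hP hPo hPb hag
    · rintro ⟨-, hsp⟩
      rw [hZo] at hsp
      exact not_spacelike_of_inDiamond (hU.2 P hP o) hsp

/-- at `h = 2` a charged letter is a unit letter `ℓ_v` (floor AND ceiling). -/
theorem h2_eq_unit {x : BPoint} (hx : InDiamond 2 x) (hch : x.2 ≠ (0, 0)) : ∃ v : Fin 4, x = ray ((0, 0, 0) : BPoint) v 1 := by
  obtain ⟨t, c, k, hc, ht, hh, rfl⟩ := exists_ray_of_charged hx hch
  obtain rfl : c = 1 := by omega
  obtain rfl : t = 0 := by omega
  exact ⟨k, rfl⟩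

/-- at `h = 2` an uncharged letter is `O` or the top apex `2I` (node levels are even). -/
theorem h2_eq_apex {x : BPoint} (hx : InDiamond 2 x) (h0 : x.2 = (0, 0)) : x = ((0, 0, 0) : BPoint) ∨ x = ((2, 0, 0) : BPoint) := by
  obtain ⟨a, b⟩ := x
  simp only at h0
  subst h0
  obtain ⟨-, hle, hpar, hh⟩ := hx
  simp [absCharge, chargeOf] at hle hpar hh
  have : a = 0 ∨ a = 2 := by omega
  rcases this with rfl | rfl <;> simp

/-- `δ` fixes apexes. -/
theorem deltaPt_apex (t : ℤ) : deltaPt ((t, 0, 0) : BPoint) = (t, 0, 0) := by simp [deltaPt]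

/-- `δ` rotates a ray about an apex by one phase step: `δ(t·I + c·n_k) = t·I + c·n_{k+3}`. -/
theorem deltaPt_ray_apex (t c : ℤ) (k : Fin 4) :
    deltaPt (ray ((t, 0, 0) : BPoint) k c) = ray ((t, 0, 0) : BPoint) (k + 3) c := by
  fin_cases k <;> simp [deltaPt, ray]

/-- iterated: `δ^m (t·I + c·n_k) = t·I + c·n_{k+3m}` (`m` read in `Fin 4`). -/
theorem deltaPt_iter_ray_apex (t c : ℤ) (k m : Fin 4) :
    deltaPt^[m.val] (ray ((t, 0, 0) : BPoint) k c) = ray ((t, 0, 0) : BPoint) (k + 3 * m) c := by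
  fin_cases m <;> fin_cases k <;> simp [deltaPt, ray]

theorem deltaPt_iter_apex (t : ℤ) (m : Fin 4) : deltaPt^[m.val] ((t, 0, 0) : BPoint) = (t, 0, 0) := by
  fin_cases m <;> simp [deltaPt]

/-- iterated `Δ`-closure of `E₋`. -/
theorem delta_iter_mem_lower {C : MConfig} (hG : C.G1Closed) :
    ∀ (n : ℕ) {Z : MCell}, Z ∈ C.lower → (fun f => deltaPt^[n] (Z f)) ∈ C.lower
  | 0, Z, hZ => by simpa using hZ
  | n + 1, Z, hZ => by
      have e : (fun f => deltaPt^[n + 1] (Z f)) = MCell.delta (fun f => deltaPt^[n] (Z f)) := by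
        funext f; simp only [MCell.delta, Function.iterate_succ_apply']
      rw [e]; exact hG.2.2.1 _ (delta_iter_mem_lower hG n hZ)

/-- phase bookkeeping (`decide`): the rotation count `3(b - a)` carries `ℓ_a` to … (doc: `LawSpan`) -/
theorem rot_phase (a b : Fin 4) : a + 3 * (3 * (b - a)) = b := by revert a b; decide

theorem rot_ne {a b : Fin 4} (hab : a ≠ b) (v : Fin 4) : v + 3 * (3 * (b - a)) ≠ v := by revert hab; revert a b v; decide

theorem phase_d1_ne (v : Fin 4) : v + 3 ≠ v := by revert v; decide

theorem phase_d2_ne (v : Fin 4) : v + 3 + 3 ≠ v := by revert v; decide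

theorem phase_d2_antip (a : Fin 4) : a + 2 + 3 + 3 = a := by revert a; decide

theorem phase_d2 (a : Fin 4) : a + 3 + 3 = a + 2 := by revert a; decide

/-- four pairwise distinct slots exhaust `Fin 4` (`decide`). -/
theorem fin4_cover {s₀ s₁ s₂ s₃ : Fin 4} (h01 : s₀ ≠ s₁) (h02 : s₀ ≠ s₂) (h03 : s₀ ≠ s₃) (h12 : s₁ ≠ s₂) (h13 : s₁ ≠ s₃)
    (h23 : s₂ ≠ s₃) (g : Fin 4) : g = s₀ ∨ g = s₁ ∨ g = s₂ ∨ g = s₃ := by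
  revert g s₀ s₁ s₂ s₃; decide

/-- **PHASE UNIQUENESS AT A UNIT CEILING LETTER (PROVED, h-uniform)** — §32's … (doc: `LawSpan`) -/
theorem not_upper_unit_top_pair {h : ℤ} {C : MConfig} (hU : C.InDiamond h) (hS : C.StaticH1)
    {P : MCell} (hP : P ∈ C.upper) {b g₁ v w : Fin 4} (hg₁b : g₁ ≠ b)
    (hPb : P b = ray ((h - 2, 0, 0) : BPoint) v 1) (hPg : P g₁ = ((h, 0, 0) : BPoint))
    {Q : MCell} (hQ : Q ∈ C.upper) (hwv : w ≠ v) (hQb : Q b = ray ((h - 2, 0, 0) : BPoint) w 1)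
    (hQg : ∀ g, g ≠ b → Q g = P g) : False := by
  have h1 : ((h, 0, 0) : BPoint).1 - (ray ((h - 2, 0, 0) : BPoint) w 1).1 = 1 := by simp; omega
  refine not_upper_unit_top hU hS hP hg₁b hPb hPg hQ (r := w + 2) (fun heq => hwv (add_right_cancel heq)) ⟨?_, ?_, ?_⟩
    (by rw [hQb]; simp; omega)
  · intro g hg; rw [Function.update_of_ne hg]; exact hQg g hg
  · rw [hQb, Function.update_self]; simp; omega
  · rw [Function.update_self, hQb, h1]; exact top_eq_ray_unit h w

/-- **(K1′) (PROVED, h-uniform)**: a `P`-cell whose letters off `b` are apexes … (doc: `LawSpan`) -/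
theorem not_upper_apex_unit_top {h : ℤ} {C : MConfig} (hU : C.InDiamond h) (hG : C.G1Closed) (hS : C.StaticH1)
    {P : MCell} (hP : P ∈ C.upper) {b g₁ v : Fin 4} (hg₁b : g₁ ≠ b)
    (hPb : P b = ray ((h - 2, 0, 0) : BPoint) v 1) (hPg : P g₁ = ((h, 0, 0) : BPoint))
    (hapex : ∀ g, g ≠ b → (P g).2 = (0, 0)) : False := by
  refine not_upper_unit_top_pair hU hS hP hg₁b hPb hPg (hG.2.2.2 P hP) (phase_d1_ne v)
    (show deltaPt (P b) = _ by rw [hPb, deltaPt_ray_apex]) fun g hg => ?_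
  show deltaPt (P g) = P g
  have h2 := hapex g hg
  rcases hx : P g with ⟨x1, x2, x3⟩
  rw [hx] at h2
  simp only [Prod.mk.injEq] at h2
  obtain ⟨rfl, rfl⟩ := h2
  simp [deltaPt]

/-- **(R1-P) (PROVED, h-uniform)**: `P = [O | ℓ_a | (h-2)I+ℓ_v | (h-2)I+ℓ_w]` is … (doc: `LawSpan`) -/
theorem no_upper_origin_unit_two_unit_ceilings {h : ℤ} {C : MConfig} (hU : C.InDiamond h) (hG : C.G1Closed) (hS : C.StaticH1)
    {P : MCell} (hP : P ∈ C.upper) {s₀ s₁ s₂ s₃ : Fin 4} (h01 : s₀ ≠ s₁) (h02 : s₀ ≠ s₂) (h03 : s₀ ≠ s₃)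
    (h12 : s₁ ≠ s₂) (h13 : s₁ ≠ s₃) (h23 : s₂ ≠ s₃) {a v w : Fin 4}
    (hP0 : P s₀ = ((0, 0, 0) : BPoint)) (hP1 : P s₁ = ray ((0, 0, 0) : BPoint) a 1)
    (hP2 : P s₂ = ray ((h - 2, 0, 0) : BPoint) v 1) (hP3 : P s₃ = ray ((h - 2, 0, 0) : BPoint) w 1) : False := by
  have hN₁ := lower_mem_of_unit_ceiling hU (hS.1.2 P hP) h23 (t₀ := h - 2) (c₀ := 1) le_rfl (by ring) hP2 hP3
  set N₁ := Function.update P s₃ ((h, 0, 0) : BPoint) with hN₁def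
  have hN₁0 : N₁ s₀ = ((0, 0, 0) : BPoint) := by rw [hN₁def, Function.update_of_ne h03, hP0]
  have hN₁1 : N₁ s₁ = ray ((0, 0, 0) : BPoint) a 1 := by rw [hN₁def, Function.update_of_ne h13, hP1]
  have hP₂ := upper_mem_of_unit_origin hU (hS.1.1 N₁ hN₁) h01 hN₁0 hN₁1
  set P₂ := Function.update N₁ s₁ ((0, 0, 0) : BPoint) with hP₂def
  have hP₂3 : P₂ s₃ = ((h, 0, 0) : BPoint) := by
    rw [hP₂def, Function.update_of_ne h13.symm, hN₁def, Function.update_self]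
  refine not_upper_apex_unit_top hU hG hS hP₂ h23.symm
    (by rw [hP₂def, Function.update_of_ne h12.symm, hN₁def, Function.update_of_ne h23, hP2]) hP₂3 fun g hg => ?_
  rcases fin4_cover h01 h02 h03 h12 h13 h23 g with rfl | rfl | rfl | rfl
  · rw [hP₂def, Function.update_of_ne h01, hN₁0]
  · rw [hP₂def, Function.update_self]
  · exact absurd rfl hg
  · rw [hP₂3]

/-- **(R1-N₀) (PROVED, h-uniform)**: `N = [O | ℓ_a | (h-2)I+ℓ_v | (h-2)I+ℓ_w]` is … (doc: `LawSpan`) -/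
theorem no_lower_origin_unit_two_unit_ceilings {h : ℤ} {C : MConfig} (hU : C.InDiamond h) (hG : C.G1Closed) (hS : C.StaticH1)
    {Z : MCell} (hZ : Z ∈ C.lower) {s₀ s₁ s₂ s₃ : Fin 4} (h01 : s₀ ≠ s₁) (h02 : s₀ ≠ s₂) (h03 : s₀ ≠ s₃)
    (h12 : s₁ ≠ s₂) (h13 : s₁ ≠ s₃) (h23 : s₂ ≠ s₃) {a v w : Fin 4}
    (hZ0 : Z s₀ = ((0, 0, 0) : BPoint)) (hZ1 : Z s₁ = ray ((0, 0, 0) : BPoint) a 1)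
    (hZ2 : Z s₂ = ray ((h - 2, 0, 0) : BPoint) v 1) (hZ3 : Z s₃ = ray ((h - 2, 0, 0) : BPoint) w 1) : False := by
  refine not_lower_unit_origin hU hG hS hZ h01 hZ1 hZ0 fun P hP hPo hPb hPg => ?_
  exact no_upper_origin_unit_two_unit_ceilings hU hG hS hP h01.symm h12 h13 h02 h03 h23 hPb hPo
    (by rw [hPg s₂ h12.symm h02.symm, hZ2]) (by rw [hPg s₃ h13.symm h03.symm, hZ3])

/-- **(R1-N) (PROVED, h-uniform)**: `N = [ℓ_a | ℓ_b | (h-2)I+ℓ_v | hI]` with … (doc: `LawSpan`) -/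
theorem no_lower_two_units_unit_ceiling_top {h : ℤ} {C : MConfig} (hU : C.InDiamond h) (hG : C.G1Closed) (hS : C.StaticH1)
    {Z : MCell} (hZ : Z ∈ C.lower) {s₀ s₁ s₂ s₃ : Fin 4} (h01 : s₀ ≠ s₁) (h02 : s₀ ≠ s₂) (h03 : s₀ ≠ s₃)
    (h12 : s₁ ≠ s₂) (h13 : s₁ ≠ s₃) (h23 : s₂ ≠ s₃) {a b v : Fin 4} (hab : a ≠ b)
    (hZ0 : Z s₀ = ray ((0, 0, 0) : BPoint) a 1) (hZ1 : Z s₁ = ray ((0, 0, 0) : BPoint) b 1)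
    (hZ2 : Z s₂ = ray ((h - 2, 0, 0) : BPoint) v 1) (hZ3 : Z s₃ = ((h, 0, 0) : BPoint)) : False := by
  -- (DN) P = N(s₀ ↦ O) ∈ E₊ (the floor letter on s₁ is stuck)
  have hP := upper_mem_of_unit_floor hU (hS.1.1 Z hZ) h01.symm (c₀ := 1) le_rfl hZ1 hZ0
  -- the rotate N′ = δ^m N, m = 3(b - a)
  set m : Fin 4 := 3 * (b - a) with hmdef
  have hZ' := delta_iter_mem_lower hG m.val hZ
  set Z' : MCell := fun f => deltaPt^[m.val] (Z f) with hZ'def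
  have hZ'0 : Z' s₀ = ray ((0, 0, 0) : BPoint) b 1 := by
    show deltaPt^[m.val] (Z s₀) = _; rw [hZ0, deltaPt_iter_ray_apex, hmdef, rot_phase]
  have hZ'1 : Z' s₁ = ray ((0, 0, 0) : BPoint) (b + 3 * m) 1 := by
    show deltaPt^[m.val] (Z s₁) = _; rw [hZ1, deltaPt_iter_ray_apex]
  -- (DN) at N′: discharge the floor letter on s₁ (`ℓ_b` on s₀ is stuck); then swap the two floor slots
  have hP' := upper_mem_of_unit_floor hU (hS.1.1 Z' hZ') h01 (c₀ := 1) le_rfl hZ'0 hZ'1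
  obtain ⟨P₁, hP₁⟩ : ∃ P₁ : MCell, P₁ = MCell.perm (Equiv.swap s₀ s₁) (Function.update Z' s₁ ((0, 0, 0) : BPoint)) :=
    ⟨_, rfl⟩
  have hev : ∀ g, P₁ g = Function.update Z' s₁ ((0, 0, 0) : BPoint) (Equiv.swap s₀ s₁ g) := fun g => by rw [hP₁]; rfl
  refine not_upper_unit_top_pair hU hS hP h23.symm (by rw [Function.update_of_ne h02.symm, hZ2])
    (by rw [Function.update_of_ne h03.symm, hZ3]) (Q := P₁) (by rw [hP₁]; exact hG.2.1 _ _ hP') (rot_ne hab v)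
    (by rw [hev, Equiv.swap_apply_of_ne_of_ne h02.symm h12.symm, Function.update_of_ne h12.symm]
        show deltaPt^[m.val] (Z s₂) = _; rw [hZ2, deltaPt_iter_ray_apex]) fun g hg => ?_
  rcases fin4_cover h01 h02 h03 h12 h13 h23 g with rfl | rfl | rfl | rfl
  · rw [hev, Equiv.swap_apply_left, Function.update_self, Function.update_self]
  · rw [hev, Equiv.swap_apply_right, Function.update_of_ne h01, hZ'0, Function.update_of_ne h01.symm, hZ1]
  · exact absurd rfl hg
  · rw [hev, Equiv.swap_apply_of_ne_of_ne h03.symm h13.symm, Function.update_of_ne h13.symm, Function.update_of_ne h03.symm,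
      hZ3]
    show deltaPt^[m.val] (Z _) = _; rw [hZ3, deltaPt_iter_apex]

/-- **(R1-P′) (PROVED, h-uniform)**: `P = [ℓ_a | ℓ_{a+2} | (h-2)I+ℓ_v | hI]` (two … (doc: `LawSpan`) -/
theorem no_upper_antipodal_units_unit_ceiling_top {h : ℤ} {C : MConfig} (hU : C.InDiamond h) (hG : C.G1Closed) (hS : C.StaticH1)
    {P : MCell} (hP : P ∈ C.upper) {s₀ s₁ s₂ s₃ : Fin 4} (h01 : s₀ ≠ s₁) (h02 : s₀ ≠ s₂) (h03 : s₀ ≠ s₃)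
    (h12 : s₁ ≠ s₂) (h13 : s₁ ≠ s₃) (h23 : s₂ ≠ s₃) {a v : Fin 4}
    (hP0 : P s₀ = ray ((0, 0, 0) : BPoint) a 1) (hP1 : P s₁ = ray ((0, 0, 0) : BPoint) (a + 2) 1)
    (hP2 : P s₂ = ray ((h - 2, 0, 0) : BPoint) v 1) (hP3 : P s₃ = ((h, 0, 0) : BPoint)) : False := by
  obtain ⟨P₁, hP₁⟩ : ∃ P₁ : MCell, P₁ = MCell.perm (Equiv.swap s₀ s₁) P.delta.delta := ⟨_, rfl⟩
  have hev : ∀ g, P₁ g = deltaPt (deltaPt (P (Equiv.swap s₀ s₁ g))) := fun g => by rw [hP₁]; rfl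
  refine not_upper_unit_top_pair hU hS hP h23.symm hP2 hP3 (Q := P₁)
    (by rw [hP₁]; exact hG.2.1 _ _ (hG.2.2.2 _ (hG.2.2.2 P hP)))
    (phase_d2_ne v) (by rw [hev, Equiv.swap_apply_of_ne_of_ne h02.symm h12.symm, hP2, deltaPt_ray_apex, deltaPt_ray_apex])
    fun g hg => ?_
  rcases fin4_cover h01 h02 h03 h12 h13 h23 g with rfl | rfl | rfl | rfl
  · rw [hev, Equiv.swap_apply_left, hP1, deltaPt_ray_apex, deltaPt_ray_apex, phase_d2_antip, hP0]
  · rw [hev, Equiv.swap_apply_right, hP0, deltaPt_ray_apex, deltaPt_ray_apex, phase_d2, hP1]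
  · exact absurd rfl hg
  · rw [hev, Equiv.swap_apply_of_ne_of_ne h03.symm h13.symm, hP3, deltaPt_apex, deltaPt_apex]

/-! # PART B — T1-core content beyond `LawSpan` v2.5
THE ENGINE-COMPLETENESS INSTRUMENT (M7, `q2g10/m7.py`; machine ≠ kernel; census rows read ◇₈ r3 j305149, kit j334158, kit j336215): the clause set … (abridged at v0.6; verbatim: v0.5 tree commit 7067ef5f78e9 and sketch §22 (i)). -/

/-! ## §B1 (v0.1) THE GENERAL TOP-PARTNER `X⁺` ENGINE (PROVED, h-uniform) — doc: sketch §22 (h)∕(k). -/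

/-- the full antipodal discharge of a ceiling letter is the top apex. -/
theorem top_eq_ray_ceiling {h t c : ℤ} (hh : t + 2 * c = h) (v : Fin 4) :
    ((h, 0, 0) : BPoint) = ray (ray ((t, 0, 0) : BPoint) v c) (v + 2) c := by
  subst hh
  fin_cases v <;> refine Prod.ext ?_ (Prod.ext ?_ ?_) <;> simp <;> ring

/-- `NullBelow` read through the duality: `y^∨` strictly null-below `x^∨` iff `x` strictly null-below `y`. -/
theorem nullBelow_dual_iff (x y : BPoint) : NullBelow (dualPt 0 y) (dualPt 0 x) ↔ NullBelow x y := by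
  obtain ⟨x1, x2, x3⟩ := x
  obtain ⟨y1, y2, y3⟩ := y
  simp only [NullBelow]
  constructor
  · rintro ⟨h1, h2⟩
    exact ⟨by omega, by linear_combination h2⟩
  · rintro ⟨h1, h2⟩
    exact ⟨by omega, by linear_combination h2⟩

theorem eq_of_dualPt_eq {x y : BPoint} (e : dualPt 0 x = dualPt 0 y) : x = y := by
  have e' := congrArg (dualPt 0) e
  simpa [dualPt] using e'

theorem bsub_dualPt (x y : BPoint) : bsub (dualPt 0 x) (dualPt 0 y) = bsub y x := by
  refine Prod.ext ?_ (Prod.ext ?_ ?_) <;> simp <;> ring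

/-- nothing in `◇_h` lies strictly null-above the top apex `hI`. -/
theorem not_nullBelow_top {h : ℤ} {y : BPoint} (hy : InDiamond h y) : ¬ NullBelow ((h, 0, 0) : BPoint) y := fun hnb =>
  not_nullBelow_dual_top hy ((nullBelow_dual_iff _ _).mpr hnb)

/-- a letter of `◇_h` has level `≤ h`. -/
theorem fst_le_of_inDiamond {h : ℤ} {y : BPoint} (hy : InDiamond h y) : y.1 ≤ h := by
  have h0 : 0 ≤ absCharge y := abs_nonneg _
  have h4 := hy.2.2.2
  omega

/-- **THE TOP-PARTNER `X⁺` ENGINE (PROVED, h-uniform).**  See the §B1 header: every hypothesis is an ORIGINAL-world statement about present cells; the conclusion is `False` (the … (doc: sketch §22) -/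
theorem xplus_top_fires {h : ℤ} {C : MConfig} (hU : C.InDiamond h) (hS : C.StaticH1)
    {P : MCell} (hP : P ∈ C.upper) {b f v : Fin 4} (hfb : f ≠ b) {t c : ℤ} (hc : 1 ≤ c) (hh : t + 2 * c = h)
    (hPb : P b = ray ((t, 0, 0) : BPoint) v c)
    (hN₀ : Function.update P b ((h, 0, 0) : BPoint) ∈ C.lower)
    (htop : ∀ N ∈ C.lower, ∀ w : Fin 4, UPartner N P b w → (N b).1 = h)
    {P₁ : MCell} (hP₁ : P₁ ∈ C.upper) {r : Fin 4} (hr : r ≠ v + 2)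
    (hsib : UPartner (Function.update P b ((h, 0, 0) : BPoint)) P₁ b r)
    (hcomp : ∀ N ∈ C.lower, (∀ g, g ≠ b → N g = P g) → (P₁ b).1 < (N b).1 → (N b).1 < h →
      N b ≠ ray (P₁ b) r ((N b).1 - (P₁ b).1))
    (hHb : ∀ N ∈ C.lower, (∀ g, g ≠ b → g ≠ f → N g = P g) → NullBelow (P f) (N f) → Effective (bsub (N b) (P₁ b)) →
      Timelike (bsub (P b) (N b)))
    (hW1 : ∀ N ∈ C.lower, (∀ g, g ≠ f → N g = P g) → ¬ NullBelow (P f) (N f))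
    (hW2 : ∀ N ∈ C.lower, ∀ g, g ≠ f → (∀ g', g' ≠ f → g' ≠ g → N g' = P g') → NullBelow (P f) (N f) → ¬ NullBelow (P g) (N g)) :
    False := by
  set N₀ : MCell := Function.update P b ((h, 0, 0) : BPoint) with hN₀def
  have hN₀b : N₀ b = ((h, 0, 0) : BPoint) := Function.update_self ..
  have hN₀g : ∀ g, g ≠ b → N₀ g = P g := fun g hg => Function.update_of_ne hg ..
  have hPb1 : (P b).1 = t + c := by rw [hPb]
  refine hS.2.1 (dualCell 0 P) (dualCell_mem_dual_lower hP) (dualCell 0 N₀) (dualCell_mem_dual_upper hN₀)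
    (dualCell 0 P₁) (dualCell_mem_dual_lower hP₁) b (v + 2) r f ⟨?_, hfb, ?_, ?_, hr, ?_, ?_, ?_, ?_, ?_⟩
  · -- the ceiling letter is charged
    change ¬ isApex (dualPt 0 (P b))
    rw [isApex_dual, hPb]
    fin_cases v <;> simp [isApex] <;> omega
  · -- `N₀^∨` is a `(v+2)`-partner of the head
    refine (uPartner_dual 0 N₀ P b (v + 2)).mpr ⟨fun g hg => (hN₀g g hg).symm, by rw [hN₀b, hPb1]; simp; omega, ?_⟩
    have h1 : ((h, 0, 0) : BPoint).1 - (P b).1 = c := by rw [hPb1]; simp; omega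
    rw [hN₀b, h1, hPb]
    exact top_eq_ray_ceiling hh v
  · -- … and the topmost one
    intro Q hQ hup
    obtain ⟨N, hN, rfl⟩ : ∃ N ∈ C.lower, dualCell 0 N = Q := ⟨_, mem_dual_upper.mp hQ, dualCell_dualCell 0 Q⟩
    have hNb := htop N hN (v + 2) ((uPartner_dual 0 N P b (v + 2)).mp hup)
    change 0 - (N b).1 ≤ 0 - (N₀ b).1
    rw [hNb, hN₀b]
  · -- the sibling `P₁^∨`
    obtain ⟨hag', hlt', hray'⟩ := (uPartner_dual 0 N₀ P₁ b r).mpr hsib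
    exact ⟨fun g hg => (hag' g hg).symm, hlt', hray'⟩
  · -- no companion strictly between `P₁ b` and `hI` on the ray (hypothesis `hcomp`, read in the dual world)
    intro Q hQ hag hlt1 hlt2 hray
    obtain ⟨N, hN, rfl⟩ : ∃ N ∈ C.lower, dualCell 0 N = Q := ⟨_, mem_dual_upper.mp hQ, dualCell_dualCell 0 Q⟩
    have h1 : (0 : ℤ) - (N₀ b).1 < 0 - (N b).1 := hlt1
    have h2 : (0 : ℤ) - (N b).1 < 0 - (P₁ b).1 := hlt2
    rw [hN₀b] at h1
    simp at h1
    have hNg : ∀ g, g ≠ b → N g = P g := fun g hg => by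
      have e := hag g hg
      change dualPt 0 (N g) = dualPt 0 (N₀ g) at e
      rw [hN₀g g hg] at e
      exact eq_of_dualPt_eq e
    refine hcomp N hN hNg (by omega) h1 ?_
    obtain ⟨-, -, hsray⟩ := hsib
    rw [hN₀b] at hsray
    change dualPt 0 (N b) = ray (dualPt 0 (N₀ b)) r ((dualPt 0 (N b)).1 - (dualPt 0 (N₀ b)).1) at hray
    rw [hN₀b] at hray
    generalize N b = nb at hray h1 ⊢
    generalize P₁ b = pb at hsray ⊢
    obtain ⟨n1, n2, n3⟩ := nb
    obtain ⟨p1, p2, p3⟩ := pb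
    simp only [dualPt, ray, Prod.mk.injEq] at hray hsray ⊢
    obtain ⟨-, hr2, hr3⟩ := hray
    obtain ⟨hs1, hs2, hs3⟩ := hsray
    exact ⟨by ring, by linear_combination hs2 - hr2, by linear_combination hs3 - hr3⟩
  · -- (H-e′) is automatic: every letter of `◇_h` is causally below `hI`
    intro Q hQ _ _ _ _
    obtain ⟨N, hN, rfl⟩ : ∃ N ∈ C.lower, dualCell 0 N = Q := ⟨_, mem_dual_upper.mp hQ, dualCell_dualCell 0 Q⟩
    change Effective (bsub (dualPt 0 (N b)) (dualPt 0 (N₀ b)))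
    rw [hN₀b]
    exact effective_dual_top (hU.1 N hN b)
  · -- (H-b), original-world form `hHb`
    intro Q hQ hag2 hnb heff
    obtain ⟨N, hN, rfl⟩ : ∃ N ∈ C.lower, dualCell 0 N = Q := ⟨_, mem_dual_upper.mp hQ, dualCell_dualCell 0 Q⟩
    change NullBelow (dualPt 0 (N f)) (dualPt 0 (P f)) at hnb
    change Effective (bsub (dualPt 0 (P₁ b)) (dualPt 0 (N b))) at heff
    change Timelike (bsub (dualPt 0 (N b)) (dualPt 0 (P b)))
    rw [nullBelow_dual_iff] at hnb
    rw [bsub_dualPt] at heff ⊢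
    exact hHb N hN (fun g hgb hgf => eq_of_dualPt_eq (hag2 g hgb hgf)) hnb heff
  · -- `W_f = ∅`, original-world form `hW1` ∕ `hW2`
    intro Q hQ hnb
    obtain ⟨N, hN, rfl⟩ : ∃ N ∈ C.lower, dualCell 0 N = Q := ⟨_, mem_dual_upper.mp hQ, dualCell_dualCell 0 Q⟩
    change NullBelow (dualPt 0 (N f)) (dualPt 0 (P f)) at hnb
    rw [nullBelow_dual_iff] at hnb
    refine ⟨fun hag => hW1 N hN (fun g hg => eq_of_dualPt_eq (hag g hg)) hnb, fun g hgf hag2 hnb' => ?_⟩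
    change NullBelow (dualPt 0 (N g)) (dualPt 0 (P g)) at hnb'
    rw [nullBelow_dual_iff] at hnb'
    exact hW2 N hN g hgf (fun g' hg'f hg'g => eq_of_dualPt_eq (hag2 g' hg'f hg'g)) hnb hnb'

/-- partners above a UNIT ceiling letter sit at the top (`ceiling_unit_move`): `htop` of `xplus_top_fires` for `c = 1`. -/
theorem partners_top_of_unit {h : ℤ} {C : MConfig} (hU : C.InDiamond h) {P : MCell} {b v : Fin 4}
    (hPb : P b = ray ((h - 2, 0, 0) : BPoint) v 1) : ∀ N ∈ C.lower, ∀ w : Fin 4, UPartner N P b w → (N b).1 = h := by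
  rintro N hN w ⟨-, hlt, hray⟩
  have hy : InDiamond h (ray (P b) w ((N b).1 - (P b).1)) := by rw [← hray]; exact hU.1 N hN b
  rw [hPb] at hy hlt
  obtain ⟨-, -, hpt⟩ := ceiling_unit_move (by rw [hPb] at hray; simp at hlt ⊢; omega) hy
  rw [hray, hPb, hpt]

/-- `htop` of `xplus_top_fires` for a charge-`c` ceiling letter: it suffices that no present `N` agreeing with `P` off `b` has its `b`-letter strictly between `P b` and the top … (doc: sketch §22) -/
theorem partners_top_of_noPartial {h : ℤ} {C : MConfig} (hU : C.InDiamond h) {P : MCell} {b : Fin 4}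
    (hno : ∀ N ∈ C.lower, (∀ g, g ≠ b → N g = P g) → (P b).1 < (N b).1 → (N b).1 < h → False) :
    ∀ N ∈ C.lower, ∀ w : Fin 4, UPartner N P b w → (N b).1 = h := by
  rintro N hN w ⟨hag, hlt, -⟩
  have hle := fst_le_of_inDiamond (hU.1 N hN b)
  rcases lt_or_eq_of_le hle with hlt' | heq
  · exact absurd hlt' fun hlt' => hno N hN (fun g hg => (hag g hg).symm) hlt hlt'
  · exact heq

/-- **the breaker slot at an `hI` letter**: (H-b) and `W_f` are vacuous, so `xplus_top_fires` needs only `htop` and `hcomp`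
(`not_upper_unit_top_depth` is the case `c = 1`). -/
theorem xplus_top_fires_topslot {h : ℤ} {C : MConfig} (hU : C.InDiamond h) (hS : C.StaticH1)
    {P : MCell} (hP : P ∈ C.upper) {b f v : Fin 4} (hfb : f ≠ b) {t c : ℤ} (hc : 1 ≤ c) (hh : t + 2 * c = h)
    (hPb : P b = ray ((t, 0, 0) : BPoint) v c) (hPf : P f = ((h, 0, 0) : BPoint))
    (hN₀ : Function.update P b ((h, 0, 0) : BPoint) ∈ C.lower)
    (htop : ∀ N ∈ C.lower, ∀ w : Fin 4, UPartner N P b w → (N b).1 = h)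
    {P₁ : MCell} (hP₁ : P₁ ∈ C.upper) {r : Fin 4} (hr : r ≠ v + 2)
    (hsib : UPartner (Function.update P b ((h, 0, 0) : BPoint)) P₁ b r)
    (hcomp : ∀ N ∈ C.lower, (∀ g, g ≠ b → N g = P g) → (P₁ b).1 < (N b).1 → (N b).1 < h →
      N b ≠ ray (P₁ b) r ((N b).1 - (P₁ b).1)) : False :=
  xplus_top_fires hU hS hP hfb hc hh hPb hN₀ htop hP₁ hr hsib hcomp
    (fun N hN _ hnb _ => absurd hnb (by rw [hPf]; exact not_nullBelow_top (hU.1 N hN f)))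
    (fun N hN _ hnb => by rw [hPf] at hnb; exact not_nullBelow_top (hU.1 N hN f) hnb)
    (fun N hN _ _ _ hnb _ => absurd hnb (by rw [hPf]; exact not_nullBelow_top (hU.1 N hN f)))


/-! ## §B2 (v0.1) NULL-ABOVE A CEILING LETTER = ANTIPODAL DISCHARGE (PROVED, h-uniform) — doc: sketch §22 (h)∕(k). -/

/-- arithmetic core of `nullAbove_ceiling` (one direction; the other three are sign ∕ swap variants). -/
theorem nullAbove_aux {c e y2 y3 : ℤ} (he : 0 < e) (hsum : |y2| + |y3| ≤ c - e) (hsq : (y2 - c) ^ 2 + y3 ^ 2 = e ^ 2) :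
    y3 = 0 ∧ y2 = c - e ∧ e ≤ c := by
  have h2 : y2 ≤ |y2| := le_abs_self _
  have h2' : 0 ≤ |y2| := abs_nonneg _
  have h3 : 0 ≤ |y3| := abs_nonneg _
  have h1 : e ≤ c - y2 := by omega
  have hsq' : e ^ 2 ≤ (c - y2) ^ 2 := by nlinarith
  have hy3 : y3 ^ 2 = 0 := le_antisymm (by nlinarith) (sq_nonneg _)
  have hy3' : y3 = 0 := pow_eq_zero_iff two_ne_zero |>.mp hy3
  refine ⟨hy3', ?_, by omega⟩
  have hcy : (c - y2) ^ 2 = e ^ 2 := by nlinarith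
  have hfac : (c - y2 - e) * (c - y2 + e) = 0 := by linear_combination hcy
  rcases mul_eq_zero.mp hfac with h0 | h0
  · omega
  · omega

/-- **NULL-ABOVE A CEILING LETTER (PROVED, h-uniform)**: a letter of `◇_h` strictly null-above the ceiling letter `t·I + c·ℓ_v` (`t + 2c = h`) is
`(t+2e)·I + (c-e)·ℓ_v` for some `1 ≤ e ≤ c`. -/
theorem nullAbove_ceiling {h t c : ℤ} {v : Fin 4} {y : BPoint} (hh : t + 2 * c = h) (hy : InDiamond h y)
    (hnb : NullBelow (ray ((t, 0, 0) : BPoint) v c) y) : ∃ e, 1 ≤ e ∧ e ≤ c ∧ y = ray (ray ((t, 0, 0) : BPoint) v c) (v + 2) e := by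
  obtain ⟨y1, y2, y3⟩ := y
  obtain ⟨hax, -, -, hle⟩ := hy
  obtain ⟨hlt, hsq⟩ := hnb
  have habs : |y2| + |y3| = absCharge ((y1, y2, y3) : BPoint) := by
    rcases hax with h0 | ⟨-, h0⟩ | ⟨h0, -⟩
    · simp only [Prod.mk.injEq] at h0
      obtain ⟨rfl, rfl⟩ := h0
      simp [absCharge, chargeOf]
    · simp at h0
      subst h0
      simp [absCharge, chargeOf]
    · simp at h0
      subst h0
      simp [absCharge, chargeOf]
  have hle' : y1 + absCharge ((y1, y2, y3) : BPoint) ≤ h := hle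
  have hsum0 : |y2| + |y3| ≤ h - y1 := by rw [habs]; omega
  refine ⟨y1 - (t + c), ?_⟩
  fin_cases v
  · simp at hlt hsq
    obtain ⟨h3, h2, h4⟩ := nullAbove_aux (c := c) (e := y1 - (t + c)) (y2 := y2) (y3 := y3) (by omega) (by omega)
      (by linear_combination hsq)
    exact ⟨by omega, h4, Prod.ext (by simp) (Prod.ext (by simp; omega) (by simp; omega))⟩
  · simp at hlt hsq
    obtain ⟨h3, h2, h4⟩ := nullAbove_aux (c := c) (e := y1 - (t + c)) (y2 := -y3) (y3 := y2) (by omega)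
      (by rw [abs_neg]; omega) (by linear_combination hsq)
    exact ⟨by omega, h4, Prod.ext (by simp) (Prod.ext (by simp; omega) (by simp; omega))⟩
  · simp at hlt hsq
    obtain ⟨h3, h2, h4⟩ := nullAbove_aux (c := c) (e := y1 - (t + c)) (y2 := -y2) (y3 := y3) (by omega)
      (by rw [abs_neg]; omega) (by linear_combination hsq)
    exact ⟨by omega, h4, Prod.ext (by simp) (Prod.ext (by simp; omega) (by simp; omega))⟩
  · simp at hlt hsq
    obtain ⟨h3, h2, h4⟩ := nullAbove_aux (c := c) (e := y1 - (t + c)) (y2 := y3) (y3 := y2) (by omega) (by omega)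
      (by linear_combination hsq)
    exact ⟨by omega, h4, Prod.ext (by simp) (Prod.ext (by simp; omega) (by simp; omega))⟩


/-! ## §B3 (v0.1) THE GENERAL FLOOR `A2I⁻` ENGINE (PROVED, h-uniform) — doc: sketch §22 (h)∕(k). -/

/-- a letter of `◇_h` has level `≥ 0`. -/
theorem fst_nonneg_of_inDiamond {h : ℤ} {y : BPoint} (hy : InDiamond h y) : 0 ≤ y.1 := by
  have h0 : 0 ≤ absCharge y := abs_nonneg _
  have h4 := hy.2.1
  omega

/-- **THE FLOOR `A2I⁻` ENGINE (PROVED, h-uniform)** — see the §B3 header. -/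
theorem aminus_floor_fires {h : ℤ} {C : MConfig} (hU : C.InDiamond h) (hS : C.StaticH1)
    {Z : MCell} (hZ : Z ∈ C.lower) {b o a : Fin 4} (hob : o ≠ b) {c : ℤ} (hc : 1 ≤ c)
    (hZb : Z b = ray ((0, 0, 0) : BPoint) a c)
    (hq : Function.update Z b ((0, 0, 0) : BPoint) ∈ C.upper)
    (hinter : ∀ P ∈ C.upper, (∀ g, g ≠ b → P g = Z g) → 0 < (P b).1 → (P b).1 < c → False)
    {N' : MCell} (hN' : N' ∈ C.lower) {v : Fin 4} (hsrv : UPartner N' (Function.update Z b ((0, 0, 0) : BPoint)) o v)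
    (hA1W : ∀ P ∈ C.upper, NullBelow (P o) (Z o) →
      (MAgree P Z o ∨ ∃ g : Fin 4, g ≠ o ∧ MAgree2 P Z o g ∧ NullBelow (P g) (Z g)) → Z o = ray (P o) v ((Z o).1 - (P o).1))
    (h3b : ∀ P ∈ C.upper, (∀ g, g ≠ b → g ≠ o → P g = Z g) → P b = ((0, 0, 0) : BPoint) → (Z o).1 < (P o).1 →
      (P o).1 ≤ (N' o).1 → P o = ray (Z o) v ((P o).1 - (Z o).1) → False)
    (h3d : ∀ P ∈ C.upper, (∀ g, g ≠ b → g ≠ o → P g = Z g) → P b = ((0, 0, 0) : BPoint) → Effective (bsub (N' o) (P o)) →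
      Spacelike (bsub (P o) (Z o)) → False) : False := by
  have hα : ∀ P ∈ C.upper, ∀ f, 0 ≤ (P f).1 := fun P hP f => fst_nonneg_of_inDiamond (hU.2 P hP f)
  set q : MCell := Function.update Z b ((0, 0, 0) : BPoint) with hqdef
  have hqb0 : q b = ((0, 0, 0) : BPoint) := Function.update_self ..
  have hagree : ∀ g, g ≠ b → q g = Z g := fun g hg => Function.update_of_ne hg ..
  have hZb1 : (Z b).1 = c := by rw [hZb]; simp
  refine hS.2.2 Z hZ q hq N' hN' b a o v ⟨?_, ?_, ?_, ?_, hob, hsrv, ?_, ?_, ?_, hA1W, ?_⟩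
  · -- `Z_b = c·ℓ_a` is charged
    rw [hZb]; fin_cases a <;> simp [isApex] <;> omega
  · -- `EncDir`: the partner direction is the own phase `a`
    rw [hZb]
    left
    refine ⟨by simp; omega, ?_⟩
    rw [cabs_ray_apex 0 c a (by omega)]
    simp
  · -- `q` is the `a`-partner at full depth `c`
    exact ⟨hagree, by rw [hqb0, hZb1]; simp; omega, by rw [hqb0, hZb1, hZb]; simp⟩
  · -- the guard `d ≤ cabs`
    intro _
    rw [hqb0, hZb, cabs_ray_apex 0 c a (by omega)]
    simp
  · -- `A2IPRES`: a partner in another direction would have its letter outside `◇_h`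
    rintro P hP w hw ⟨-, hlt, hray⟩
    exact hw (floor_move hc (sub_pos.mpr hlt) (hZb.symm.trans hray) (hU.2 P hP b)).1
  · -- `inter`: a shallower `a`-partner is a partial discharge, absent by `hinter`
    rintro P hP ⟨hag, hlt, -⟩
    rw [hqb0]
    by_contra hgt
    exact hinter P hP hag (by simp at hgt; omega) (by omega)
  · -- `deeper`: nothing lies below `O`
    rintro P hP ⟨-, hlt, -⟩
    have := hα P hP b
    rw [hqb0] at hlt
    simp at hlt
    omega
  · -- polluters: species (3b) = `h3b`, (3d) = `h3d`, after `P b = O` (the only point of the `a`-line at or below `O` inside `◇_h`)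
    intro P hP hag hul
    have hPb : P b = ((0, 0, 0) : BPoint) := by
      obtain ⟨hle, heq⟩ := hul
      rw [hqb0] at hle heq
      have h0 : (P b).1 = 0 := by have := hα P hP b; simp at hle; omega
      have h1 : (P b).2.1 = 0 := by have := congrArg (fun p : BPoint => p.2.1) heq; simp [h0] at this; omega
      have h2 : (P b).2.2 = 0 := by have := congrArg (fun p : BPoint => p.2.2) heq; simp [h0] at this; omega
      exact Prod.ext h0 (Prod.ext h1 h2)
    exact ⟨fun ⟨hlt, hle, hray⟩ => h3b P hP hag hPb hlt hle hray, fun ⟨heff, hsp⟩ => h3d P hP hag hPb heff hsp⟩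

/-- **the server slot at an `O` letter**: `A1W` and species (3d) are vacuous (nothing of `◇_h` lies null-below `O`, no letter of `◇_h` is spacelike from `O`), so only the partial … (doc: sketch §22) -/
theorem aminus_floor_origin_fires {h : ℤ} {C : MConfig} (hU : C.InDiamond h) (hS : C.StaticH1)
    {Z : MCell} (hZ : Z ∈ C.lower) {b o a : Fin 4} (hob : o ≠ b) {c : ℤ} (hc : 1 ≤ c)
    (hZb : Z b = ray ((0, 0, 0) : BPoint) a c) (hZo : Z o = ((0, 0, 0) : BPoint))
    (hq : Function.update Z b ((0, 0, 0) : BPoint) ∈ C.upper)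
    (hinter : ∀ P ∈ C.upper, (∀ g, g ≠ b → P g = Z g) → 0 < (P b).1 → (P b).1 < c → False)
    {N' : MCell} (hN' : N' ∈ C.lower) {v : Fin 4} (hsrv : UPartner N' (Function.update Z b ((0, 0, 0) : BPoint)) o v)
    (h3b : ∀ P ∈ C.upper, (∀ g, g ≠ b → g ≠ o → P g = Z g) → P b = ((0, 0, 0) : BPoint) → 0 < (P o).1 →
      (P o).1 ≤ (N' o).1 → P o = ray ((0, 0, 0) : BPoint) v (P o).1 → False) : False :=
  aminus_floor_fires hU hS hZ hob hc hZb hq hinter hN' hsrv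
    (fun P hP hnb _ => by
      exfalso
      have h0 := fst_nonneg_of_inDiamond (hU.2 P hP o)
      have h1 := hnb.1
      rw [hZo] at h1
      simp at h1
      omega)
    (fun P hP hag hPb hlt hle hray => by
      rw [hZo] at hlt hray
      simp at hlt hray
      exact h3b P hP hag hPb hlt hle hray)
    (fun P hP _ _ _ hsp => not_spacelike_of_inDiamond (hU.2 P hP o) (by rw [hZo] at hsp; exact hsp))

/-! ## §B4 (v0.2) EXACT-CLAUSE ENGINES · THE CHARGE-STEP ARCHITECTURE OF `NoThree h` · ONE h-UNIFORM CHARGE-STEP CLASS (all PROVED) — doc: sketch §22 (h)∕(k). -/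

/-- `htop` of `xplus_top_fires` from the absence of the `c - 1` NAMED partial discharges `P(b ↦ (t+2e)·I + (c-e)·ℓ_v)`, `0 < e < c` (exact-clause form of … (doc: sketch §22) -/
theorem partners_top_of_noPartialCells {h : ℤ} {C : MConfig} (hU : C.InDiamond h) {P : MCell} {b v : Fin 4} {t c : ℤ}
    (hc : 1 ≤ c) (hh : t + 2 * c = h) (hPb : P b = ray ((t, 0, 0) : BPoint) v c)
    (hno : ∀ e, 0 < e → e < c → Function.update P b (ray ((t + 2 * e, 0, 0) : BPoint) v (c - e)) ∉ C.lower) :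
    ∀ N ∈ C.lower, ∀ w : Fin 4, UPartner N P b w → (N b).1 = h := by
  rintro N hN w ⟨hag, hlt, hray⟩
  have hy : InDiamond h (ray (P b) w ((N b).1 - (P b).1)) := by rw [← hray]; exact hU.1 N hN b
  have htop := fst_le_of_inDiamond (hU.1 N hN b)
  rw [hPb] at hy hlt
  have he : 0 < (N b).1 - (ray ((t, 0, 0) : BPoint) v c).1 := by simp at hlt ⊢; omega
  obtain ⟨-, hle, hpt⟩ := ceiling_move hc hh he hy
  by_contra hne
  have hlt' : (N b).1 - (ray ((t, 0, 0) : BPoint) v c).1 < c := by simp at hne ⊢; omega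
  refine hno _ he hlt' ?_
  have hNeq : N = Function.update P b (ray ((t + 2 * ((N b).1 - (ray ((t, 0, 0) : BPoint) v c).1), 0, 0) : BPoint) v
      (c - ((N b).1 - (ray ((t, 0, 0) : BPoint) v c).1))) := by
    funext g
    by_cases hg : g = b
    · subst hg; rw [Function.update_self, ← hpt, ← hPb]; nth_rewrite 1 [hray]; rw [hPb]
    · rw [Function.update_of_ne hg]; exact (hag g hg).symm
  rw [← hNeq]; exact hN

/-- **THE TOP-SLOT `X⁺` ENGINE, EXACT-CLAUSE FORM (PROVED, h-uniform)** — `xplus_top_fires_topslot` with BOTH quantified side conditions replaced by the absence of named … (sketch §22). -/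
theorem xplus_top_fires_topslot_cells {h : ℤ} {C : MConfig} (hU : C.InDiamond h) (hS : C.StaticH1)
    {P : MCell} (hP : P ∈ C.upper) {b f v : Fin 4} (hfb : f ≠ b) {t c : ℤ} (hc : 1 ≤ c) (hh : t + 2 * c = h)
    (hPb : P b = ray ((t, 0, 0) : BPoint) v c) (hPf : P f = ((h, 0, 0) : BPoint))
    (hN₀ : Function.update P b ((h, 0, 0) : BPoint) ∈ C.lower)
    (hpart : ∀ e, 0 < e → e < c → Function.update P b (ray ((t + 2 * e, 0, 0) : BPoint) v (c - e)) ∉ C.lower)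
    {P₁ : MCell} (hP₁ : P₁ ∈ C.upper) {r : Fin 4} (hr : r ≠ v + 2)
    (hsib : UPartner (Function.update P b ((h, 0, 0) : BPoint)) P₁ b r)
    (hcomp : ∀ d, 0 < d → (P₁ b).1 + d < h → Function.update P b (ray (P₁ b) r d) ∉ C.lower) : False :=
  xplus_top_fires_topslot hU hS hP hfb hc hh hPb hPf hN₀ (partners_top_of_noPartialCells hU hc hh hPb hpart) hP₁ hr hsib
    fun N hN hag h1 h2 heq => hcomp ((N b).1 - (P₁ b).1) (by omega) (by omega) (by
      have hNeq : N = Function.update P b (ray (P₁ b) r ((N b).1 - (P₁ b).1)) := by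
        funext g
        by_cases hg : g = b
        · subst hg; rw [Function.update_self]; exact heq
        · rw [Function.update_of_ne hg]; exact hag g hg
      rw [← hNeq]; exact hN)

/-- **THE FLOOR `A2I⁻` ENGINE, EXACT-CLAUSE FORM (PROVED, h-uniform)** — `aminus_floor_fires` with `hinter` replaced by the absence of the named partial discharges … (doc: sketch §22) -/
theorem aminus_floor_fires_cells {h : ℤ} {C : MConfig} (hU : C.InDiamond h) (hS : C.StaticH1)
    {Z : MCell} (hZ : Z ∈ C.lower) {b o a : Fin 4} (hob : o ≠ b) {c : ℤ} (hc : 1 ≤ c)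
    (hZb : Z b = ray ((0, 0, 0) : BPoint) a c)
    (hq : Function.update Z b ((0, 0, 0) : BPoint) ∈ C.upper)
    (hpart : ∀ d, 0 < d → d < c → Function.update Z b (ray ((0, 0, 0) : BPoint) a (c - d)) ∉ C.upper)
    {N' : MCell} (hN' : N' ∈ C.lower) {v : Fin 4} (hsrv : UPartner N' (Function.update Z b ((0, 0, 0) : BPoint)) o v)
    (hA1W : ∀ P ∈ C.upper, NullBelow (P o) (Z o) →
      (MAgree P Z o ∨ ∃ g : Fin 4, g ≠ o ∧ MAgree2 P Z o g ∧ NullBelow (P g) (Z g)) → Z o = ray (P o) v ((Z o).1 - (P o).1))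
    (h3b : ∀ P ∈ C.upper, (∀ g, g ≠ b → g ≠ o → P g = Z g) → P b = ((0, 0, 0) : BPoint) → (Z o).1 < (P o).1 →
      (P o).1 ≤ (N' o).1 → P o = ray (Z o) v ((P o).1 - (Z o).1) → False)
    (h3d : ∀ P ∈ C.upper, (∀ g, g ≠ b → g ≠ o → P g = Z g) → P b = ((0, 0, 0) : BPoint) → Effective (bsub (N' o) (P o)) →
      Spacelike (bsub (P o) (Z o)) → False) : False := by
  have hα : ∀ P ∈ C.upper, ∀ f, 0 ≤ (P f).1 := fun P hP f => fst_nonneg_of_inDiamond (hU.2 P hP f)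
  set q : MCell := Function.update Z b ((0, 0, 0) : BPoint) with hqdef
  have hqb0 : q b = ((0, 0, 0) : BPoint) := Function.update_self ..
  have hagree : ∀ g, g ≠ b → q g = Z g := fun g hg => Function.update_of_ne hg ..
  have hZb1 : (Z b).1 = c := by rw [hZb]; simp
  refine hS.2.2 Z hZ q hq N' hN' b a o v ⟨?_, ?_, ?_, ?_, hob, hsrv, ?_, ?_, ?_, hA1W, ?_⟩
  · rw [hZb]; fin_cases a <;> simp [isApex] <;> omega
  · rw [hZb]
    left
    refine ⟨by simp; omega, ?_⟩
    rw [cabs_ray_apex 0 c a (by omega)]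
    simp
  · exact ⟨hagree, by rw [hqb0, hZb1]; simp; omega, by rw [hqb0, hZb1, hZb]; simp⟩
  · intro _
    rw [hqb0, hZb, cabs_ray_apex 0 c a (by omega)]
    simp
  · rintro P hP w hw ⟨-, hlt, hray⟩
    exact hw (floor_move hc (sub_pos.mpr hlt) (hZb.symm.trans hray) (hU.2 P hP b)).1
  · -- `inter`: a shallower `a`-partner `P` of `Z` at `b` is one of the NAMED partial discharges (`floor_move`), absent by `hpart`
    rintro P hP ⟨hag, hlt, hray⟩
    rw [hqb0]
    by_contra hgt
    have he : 0 < (Z b).1 - (P b).1 := sub_pos.mpr hlt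
    obtain ⟨-, hle, hpt⟩ := floor_move hc he (hZb.symm.trans hray) (hU.2 P hP b)
    rw [hZb1] at hpt he hle
    have hgt' : 0 < (P b).1 := by simp at hgt; omega
    refine hpart (c - (P b).1) he (by omega) ?_
    have hPeq : P = Function.update Z b (ray ((0, 0, 0) : BPoint) a (c - (c - (P b).1))) := by
      funext g
      by_cases hg : g = b
      · subst hg; rw [Function.update_self]; exact hpt
      · rw [Function.update_of_ne hg]; exact hag g hg
    rw [← hPeq]; exact hP
  · rintro P hP ⟨-, hlt, -⟩
    have := hα P hP b
    rw [hqb0] at hlt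
    simp at hlt
    omega
  · intro P hP hag hul
    have hPb : P b = ((0, 0, 0) : BPoint) := by
      obtain ⟨hle, heq⟩ := hul
      rw [hqb0] at hle heq
      have h0 : (P b).1 = 0 := by have := hα P hP b; simp at hle; omega
      have h1 : (P b).2.1 = 0 := by have := congrArg (fun p : BPoint => p.2.1) heq; simp [h0] at this; omega
      have h2 : (P b).2.2 = 0 := by have := congrArg (fun p : BPoint => p.2.2) heq; simp [h0] at this; omega
      exact Prod.ext h0 (Prod.ext h1 h2)
    exact ⟨fun ⟨hlt, hle, hray⟩ => h3b P hP hag hPb hlt hle hray, fun ⟨heff, hsp⟩ => h3d P hP hag hPb heff hsp⟩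

/-- **THE FLOOR-ORIGIN `A2I⁻` ENGINE, EXACT-CLAUSE FORM (PROVED, h-uniform)** — `aminus_floor_origin_fires` with `hinter` AND the (3b) polluter condition replaced by the … (sketch §22). -/
theorem aminus_floor_origin_fires_cells {h : ℤ} {C : MConfig} (hU : C.InDiamond h) (hS : C.StaticH1)
    {Z : MCell} (hZ : Z ∈ C.lower) {b o a : Fin 4} (hob : o ≠ b) {c : ℤ} (hc : 1 ≤ c)
    (hZb : Z b = ray ((0, 0, 0) : BPoint) a c) (hZo : Z o = ((0, 0, 0) : BPoint))
    (hq : Function.update Z b ((0, 0, 0) : BPoint) ∈ C.upper)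
    (hpart : ∀ d, 0 < d → d < c → Function.update Z b (ray ((0, 0, 0) : BPoint) a (c - d)) ∉ C.upper)
    {N' : MCell} (hN' : N' ∈ C.lower) {v : Fin 4} (hsrv : UPartner N' (Function.update Z b ((0, 0, 0) : BPoint)) o v)
    (hpol : ∀ e, 0 < e → e ≤ (N' o).1 →
      Function.update (Function.update Z b ((0, 0, 0) : BPoint)) o (ray ((0, 0, 0) : BPoint) v e) ∉ C.upper) : False :=
  aminus_floor_fires_cells hU hS hZ hob hc hZb hq hpart hN' hsrv
    (fun P hP hnb _ => by
      exfalso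
      have h0 := fst_nonneg_of_inDiamond (hU.2 P hP o)
      have h1 := hnb.1
      rw [hZo] at h1
      simp at h1
      omega)
    (fun P hP hag hPb hlt hle hray => by
      rw [hZo] at hlt hray
      simp at hlt hray
      refine hpol (P o).1 hlt hle ?_
      have hPeq : P = Function.update (Function.update Z b ((0, 0, 0) : BPoint)) o (ray ((0, 0, 0) : BPoint) v (P o).1) := by
        funext g
        by_cases hgo : g = o
        · subst hgo; rw [Function.update_self]; exact hray
        · rw [Function.update_of_ne hgo]
          by_cases hgb : g = b
          · subst hgb; rw [Function.update_self]; exact hPb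
          · rw [Function.update_of_ne hgb]; exact hag g hgb hgo
      rw [← hPeq]; exact hP)
    (fun P hP _ _ _ hsp => not_spacelike_of_inDiamond (hU.2 P hP o) (by rw [hZo] at hsp; exact hsp))

/-! ### §B4.2 The charge-step architecture (typed; the reduction PROVED) -/

/-- the TOTAL CHARGE `Σc` of a cell. -/
def totalCharge (Z : MCell) : ℤ := absCharge (Z 0) + absCharge (Z 1) + absCharge (Z 2) + absCharge (Z 3)

theorem totalCharge_eq_sum (Z : MCell) : totalCharge Z = ∑ f : Fin 4, absCharge (Z f) := by
  rw [Fin.sum_univ_four]; rfl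

/-- a three-charged cell of `◇_h` has total charge `≥ 3`. -/
theorem three_le_totalCharge {h : ℤ} {Z : MCell} (hZ : MCell.InDiamond h Z) (h3 : ThreeCharged Z) : 3 ≤ totalCharge Z := by
  have hpt : ∀ f ∈ (univ : Finset (Fin 4)), (if (Z f).2 ≠ (0, 0) then (1 : ℤ) else 0) ≤ absCharge (Z f) := fun f _ => by
    split_ifs with hch
    · obtain ⟨t, c, k, hc, -, -, hx⟩ := exists_ray_of_charged (hZ f) hch
      rw [hx, absCharge_ray_apex t c k (by omega)]; exact hc
    · exact abs_nonneg _
  have hsum := Finset.sum_le_sum hpt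
  rw [Finset.sum_boole, ← totalCharge_eq_sum] at hsum
  dsimp only [ThreeCharged, chargedCount] at h3
  rw [h3] at hsum
  simpa using hsum

/-- **`NoThreeBelow h C s`**: every bi-anchored three-charged cell of total charge `< s` is absent from `C` (both levels) — the induction hypothesis
of the charge step. -/
def NoThreeBelow (h : ℤ) (C : MConfig) (s : ℤ) : Prop :=
  (∀ Z ∈ C.lower, BiAnchored h Z → ThreeCharged Z → totalCharge Z < s → False) ∧
    ∀ P ∈ C.upper, BiAnchored h P → ThreeCharged P → totalCharge P < s → False

/-- **THE CHARGE STEP AT TOTAL CHARGE `s`**: in every static `G₁`-closed support in `◇_h`, if all bi-anchored three-charged cells of total charge `< s` are absent then so … (sketch §22). -/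
def ChargeStepAt (h s : ℤ) : Prop :=
  ∀ C : MConfig, C.InDiamond h → C.G1Closed → C.StaticH1 → NoThreeBelow h C s → NoThreeBelow h C (s + 1)

theorem noThreeBelow_three {h : ℤ} {C : MConfig} (hU : C.InDiamond h) : NoThreeBelow h C 3 :=
  ⟨fun Z hZ _ h3 hlt => by have := three_le_totalCharge (hU.1 Z hZ) h3; omega,
    fun P hP _ h3 hlt => by have := three_le_totalCharge (hU.2 P hP) h3; omega⟩

theorem noThreeBelow_mono {h : ℤ} {C : MConfig} {s s' : ℤ} (hs : s' ≤ s) (H : NoThreeBelow h C s) : NoThreeBelow h C s' :=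
  ⟨fun Z hZ hB h3 hlt => H.1 Z hZ hB h3 (by omega), fun P hP hB h3 hlt => H.2 P hP hB h3 (by omega)⟩

theorem chargeStepAt_of_le_two {h s : ℤ} (hs : s ≤ 2) : ChargeStepAt h s :=
  fun _ hU _ _ _ => noThreeBelow_mono (by omega) (noThreeBelow_three hU)

/-- **`NoThree h` FROM THE CHARGE STEPS (PROVED)** — strong induction on the total charge. -/
theorem noThree_of_chargeSteps {h : ℤ} (step : ∀ s : ℤ, 3 ≤ s → ChargeStepAt h s) : NoThree h := by
  intro C hU hG hS
  have hall : ∀ n : ℕ, NoThreeBelow h C (3 + n) := by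
    intro n
    induction n with
    | zero => simpa using noThreeBelow_three hU
    | succ n ih =>
      have hstep := step (3 + n) (by omega) C hU hG hS ih
      have e : (3 : ℤ) + (((n + 1 : ℕ)) : ℤ) = 3 + n + 1 := by push_cast; ring
      rw [e]; exact hstep
  refine ⟨fun Z hZ hB h3 => ?_, fun P hP hB h3 => ?_⟩
  · have h0 := three_le_totalCharge (hU.1 Z hZ) h3
    have hn : (((totalCharge Z - 2).toNat : ℕ) : ℤ) = totalCharge Z - 2 := Int.toNat_of_nonneg (by omega)
    exact (hall (totalCharge Z - 2).toNat).1 Z hZ hB h3 (by omega)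
  · have h0 := three_le_totalCharge (hU.2 P hP) h3
    have hn : (((totalCharge P - 2).toNat : ℕ) : ℤ) = totalCharge P - 2 := Int.toNat_of_nonneg (by omega)
    exact (hall (totalCharge P - 2).toNat).2 P hP hB h3 (by omega)

/-- **THE ARCHITECTURE (PROVED reduction)**: `NoThree h` follows from the UNIT CORE (`ChargeStepAt h 3`) and the CHARGE STEPS `s ≥ 4`. -/
theorem noThree_of_unitCore_and_chargeSteps {h : ℤ} (unit : ChargeStepAt h 3) (step : ∀ s : ℤ, 4 ≤ s → ChargeStepAt h s) : NoThree h :=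
  noThree_of_chargeSteps fun s hs => by
    rcases eq_or_lt_of_le hs with rfl | hlt
    · exact unit
    · exact step s (by omega)

/-- conversely the charge steps are necessary: `NoThree h` gives every `ChargeStepAt h s` (so the architecture loses nothing). -/
theorem chargeStepAt_of_noThree {h : ℤ} (H : NoThree h) (s : ℤ) : ChargeStepAt h s :=
  fun C hU hG hS _ => ⟨fun Z hZ hB h3 _ => (H C hU hG hS).1 Z hZ hB h3, fun P hP hB h3 _ => (H C hU hG hS).2 P hP hB h3⟩

/-! ### §B4.3 The first h-uniform charge-step class: `P[c₁ℓ_a | c₂ℓ_b | (h-2)I | (h-2)I+ℓ_v]`, `c₂ ≥ 2` (PROVED) — doc: sketch §22 (h)∕(k). -/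

theorem fin4_cases (f : Fin 4) : f = 0 ∨ f = 1 ∨ f = 2 ∨ f = 3 := by revert f; decide

/-- **CLASS `P[c₁ℓ_a | c₂ℓ_b | (h-2)I | (h-2)I+ℓ_v]`, `c₁ ≥ 1`, `c₂ ≥ 2` (PROVED, h-uniform charge-step class).** -/
theorem no_upper_twoFloor_subapex_unitCeiling {h : ℤ} {C : MConfig} (hU : C.InDiamond h) (hS : C.StaticH1)
    {P : MCell} (hP : P ∈ C.upper) {a b v : Fin 4} {c₁ c₂ : ℤ} (hc₁ : 1 ≤ c₁) (hc₂ : 2 ≤ c₂)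
    (hP0 : P 0 = ray ((0, 0, 0) : BPoint) a c₁) (hP1 : P 1 = ray ((0, 0, 0) : BPoint) b c₂)
    (hP2 : P 2 = ((h - 2, 0, 0) : BPoint)) (hP3 : P 3 = ray ((h - 2, 0, 0) : BPoint) v 1)
    (hIH : NoThreeBelow h C (c₁ + c₂ + 1)) : False := by
  have h23 : (2 : Fin 4) ≠ 3 := by decide
  have h01 : (0 : Fin 4) ≠ 1 := by decide
  obtain ⟨r, e, he, hN⟩ := lower_mem_of_ceiling_apex hU (hS.1.2 P hP) h23.symm (t₀ := h - 2) (c₀ := 1) (t := h - 2) le_rfl (by ring)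
    hP3 hP2 (by omega)
  set N : MCell := Function.update P 2 (ray ((h - 2, 0, 0) : BPoint) r e) with hNdef
  have he1 : e = 1 := by
    have hx : InDiamond h (N 2) := hU.1 N hN 2
    rw [hNdef, Function.update_self] at hx
    have := line_le_of_ray_inDiamond (by omega : (0 : ℤ) ≤ e) hx
    omega
  have hN0 : N 0 = ray ((0, 0, 0) : BPoint) a c₁ := by rw [hNdef, Function.update_of_ne (by decide), hP0]
  have hN1 : N 1 = ray ((0, 0, 0) : BPoint) b c₂ := by rw [hNdef, Function.update_of_ne (by decide), hP1]
  have hN2 : N 2 = ray ((h - 2, 0, 0) : BPoint) r 1 := by rw [hNdef, Function.update_self, he1]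
  have hN3 : N 3 = ray ((h - 2, 0, 0) : BPoint) v 1 := by rw [hNdef, Function.update_of_ne (by decide), hP3]
  obtain ⟨e', he'1, he'2, hP'⟩ := upper_mem_of_two_floor' hU (hS.1.1 N hN) h01 hc₁ (by omega : (1 : ℤ) ≤ c₂) hN0 hN1
  set P' : MCell := Function.update N 1 (ray ((0, 0, 0) : BPoint) b (c₂ - e')) with hP'def
  have hP'0 : P' 0 = ray ((0, 0, 0) : BPoint) a c₁ := by rw [hP'def, Function.update_of_ne (by decide), hN0]
  have hP'1 : P' 1 = ray ((0, 0, 0) : BPoint) b (c₂ - e') := by rw [hP'def, Function.update_self]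
  have hP'2 : P' 2 = ray ((h - 2, 0, 0) : BPoint) r 1 := by rw [hP'def, Function.update_of_ne (by decide), hN2]
  have hP'3 : P' 3 = ray ((h - 2, 0, 0) : BPoint) v 1 := by rw [hP'def, Function.update_of_ne (by decide), hN3]
  rcases lt_or_eq_of_le he'2 with hlt | rfl
  · -- (3a) `e′ < c₂`: `P′` is fully charged; discharge its unit ceiling letter on slot 3 (slot 2 is stuck): `N′ = P′(3 ↦ hI) ∈ E₋`
    have hN' := lower_mem_of_unit_ceiling hU (hS.1.2 P' hP') h23 (t₀ := h - 2) (c₀ := 1) le_rfl (by ring) hP'2 hP'3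
    have hch : ∀ f, (P' f).2 ≠ (0, 0) := fun f => by
      rcases fin4_cases f with rfl | rfl | rfl | rfl
      · rw [hP'0]; exact ray_charged 0 a hc₁
      · rw [hP'1]; exact ray_charged 0 b (by omega)
      · rw [hP'2]; exact ray_charged (h - 2) r le_rfl
      · rw [hP'3]; exact ray_charged (h - 2) v le_rfl
    refine hIH.1 _ hN' ⟨⟨0, onFloor_update_of_ne (by decide) _ (onFloor_of_eq (by omega) hP'0)⟩,
      ⟨2, onCeiling_update_of_ne h23 _ (onCeiling_of_eq (by omega) (by ring) hP'2)⟩⟩ (threeCharged_update_apex hch 3 h) ?_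
    show absCharge (Function.update P' 3 ((h, 0, 0) : BPoint) 0) + absCharge (Function.update P' 3 ((h, 0, 0) : BPoint) 1) +
        absCharge (Function.update P' 3 ((h, 0, 0) : BPoint) 2) + absCharge (Function.update P' 3 ((h, 0, 0) : BPoint) 3) < c₁ + c₂ + 1
    rw [Function.update_of_ne (by decide), Function.update_of_ne (by decide), Function.update_of_ne (by decide), Function.update_self,
      hP'0, hP'1, hP'2, absCharge_ray_apex 0 c₁ a (by omega), absCharge_ray_apex 0 (c₂ - e') b (by omega),
      absCharge_ray_apex (h - 2) 1 r (by omega)]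
    simp [absCharge, chargeOf]
    omega
  · -- (3b) `e′ = c₂`: `P′ = [c₁ℓ_a | O | C1 | C1]` itself is bi-anchored, three-charged, of total charge `c₁ + 2`
    have hch : ∀ f, (N f).2 ≠ (0, 0) := fun f => by
      rcases fin4_cases f with rfl | rfl | rfl | rfl
      · rw [hN0]; exact ray_charged 0 a hc₁
      · rw [hN1]; exact ray_charged 0 b (by omega)
      · rw [hN2]; exact ray_charged (h - 2) r le_rfl
      · rw [hN3]; exact ray_charged (h - 2) v le_rfl
    have hP'eq : P' = Function.update N 1 ((0, 0, 0) : BPoint) := by rw [hP'def, sub_self, ray_zero]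
    refine hIH.2 _ hP' ⟨⟨1, onFloor_of_eq (by omega) hP'1⟩, ⟨3, onCeiling_of_eq (by omega) (by ring) hP'3⟩⟩
      (by rw [hP'eq]; exact threeCharged_update_apex hch 1 0) ?_
    show absCharge (P' 0) + absCharge (P' 1) + absCharge (P' 2) + absCharge (P' 3) < c₁ + e' + 1
    rw [hP'0, hP'1, hP'2, hP'3, absCharge_ray_apex 0 c₁ a (by omega), absCharge_ray_apex 0 (e' - e') b (by omega),
      absCharge_ray_apex (h - 2) 1 r (by omega), absCharge_ray_apex (h - 2) 1 v (by omega)]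
    omega

/-- a letter one or more null steps below the apex `2·I` inside `◇_h` is a unit floor letter `ℓ_k`. -/
theorem eq_unit_floor_of_ray_eq_apexTwo {h : ℤ} {y : BPoint} (hy : InDiamond h y) {r : Fin 4} {d : ℤ} (hd : 1 ≤ d)
    (hray : ray y r d = ((2, 0, 0) : BPoint)) (hsum : y.1 + d = 2) : ∃ k : Fin 4, y = ray ((0, 0, 0) : BPoint) k 1 := by
  have habs : absCharge y = d := absCharge_of_ray_eq_apex (by omega) hray
  have hch : y.2 ≠ (0, 0) := by
    intro h0
    have : absCharge y = 0 := by
      obtain ⟨a, b⟩ := y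
      simp only at h0
      subst h0
      simp [absCharge, chargeOf]
    omega
  obtain ⟨t, c, k, hc, ht, -, hyx⟩ := exists_ray_of_charged hy hch
  rw [hyx, absCharge_ray_apex t c k (by omega)] at habs
  rw [hyx] at hsum
  simp at hsum
  refine ⟨k, ?_⟩
  rw [hyx, show t = 0 by omega, show c = 1 by omega]

/-- **DUAL CLASS `N[(h-2c₁)I+c₁ℓ_a | (h-2c₂)I+c₂ℓ_b | 2I | ℓ_v]`, `c₁ ≥ 1`, `c₂ ≥ 2` (PROVED, h-uniform charge-step class)** — the `E₋`-mirror of … (sketch §22). -/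
theorem no_lower_twoCeiling_apexTwo_unitFloor {h : ℤ} {C : MConfig} (hU : C.InDiamond h) (hS : C.StaticH1)
    {N : MCell} (hN : N ∈ C.lower) {a b v : Fin 4} {c₁ c₂ : ℤ} (hc₁ : 1 ≤ c₁) (hc₂ : 2 ≤ c₂)
    (hN0 : N 0 = ray ((h - 2 * c₁, 0, 0) : BPoint) a c₁) (hN1 : N 1 = ray ((h - 2 * c₂, 0, 0) : BPoint) b c₂)
    (hN2 : N 2 = ((2, 0, 0) : BPoint)) (hN3 : N 3 = ray ((0, 0, 0) : BPoint) v 1)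
    (hIH : NoThreeBelow h C (c₁ + c₂ + 1)) : False := by
  have h01 : (0 : Fin 4) ≠ 1 := by decide
  have h23 : (2 : Fin 4) ≠ 3 := by decide
  obtain ⟨P, hP, r, d, hd, hag, hray, hsum⟩ := upper_mem_of_floor_apex hU (hS.1.1 N hN) h23.symm le_rfl hN3 hN2 (by norm_num)
  obtain ⟨k, hP2⟩ := eq_unit_floor_of_ray_eq_apexTwo (hU.2 P hP 2) hd hray hsum
  have hP0 : P 0 = ray ((h - 2 * c₁, 0, 0) : BPoint) a c₁ := by rw [hag 0 (by decide), hN0]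
  have hP1 : P 1 = ray ((h - 2 * c₂, 0, 0) : BPoint) b c₂ := by rw [hag 1 (by decide), hN1]
  have hP3 : P 3 = ray ((0, 0, 0) : BPoint) v 1 := by rw [hag 3 (by decide), hN3]
  obtain ⟨e, he1, he2, hN'⟩ := lower_mem_of_two_ceiling' hU (hS.1.2 P hP) h01 hc₁ (by ring) (by omega : (1 : ℤ) ≤ c₂) (by ring) hP0 hP1
  set N' : MCell := Function.update P 1 (ray ((h - 2 * c₂ + 2 * e, 0, 0) : BPoint) b (c₂ - e)) with hN'def
  have hN'0 : N' 0 = ray ((h - 2 * c₁, 0, 0) : BPoint) a c₁ := by rw [hN'def, Function.update_of_ne (by decide), hP0]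
  have hN'1 : N' 1 = ray ((h - 2 * c₂ + 2 * e, 0, 0) : BPoint) b (c₂ - e) := by rw [hN'def, Function.update_self]
  have hN'2 : N' 2 = ray ((0, 0, 0) : BPoint) k 1 := by rw [hN'def, Function.update_of_ne (by decide), hP2]
  have hN'3 : N' 3 = ray ((0, 0, 0) : BPoint) v 1 := by rw [hN'def, Function.update_of_ne (by decide), hP3]
  rcases lt_or_eq_of_le he2 with hlt | rfl
  · -- (3a) `e < c₂`: `N′` is fully charged; its unit floor letter on slot 3 is replaced by `O` (slot 2 is stuck): `P″ = N′(3 ↦ O) ∈ E₊`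
    have hP'' := upper_mem_of_unit_floor hU (hS.1.1 N' hN') h23 le_rfl hN'2 hN'3
    have hch : ∀ f, (N' f).2 ≠ (0, 0) := fun f => by
      rcases fin4_cases f with rfl | rfl | rfl | rfl
      · rw [hN'0]; exact ray_charged _ a hc₁
      · rw [hN'1]; exact ray_charged _ b (by omega)
      · rw [hN'2]; exact ray_charged 0 k le_rfl
      · rw [hN'3]; exact ray_charged 0 v le_rfl
    refine hIH.2 _ hP'' ⟨⟨2, onFloor_update_of_ne h23 _ (onFloor_of_eq (by omega) hN'2)⟩,
      ⟨0, onCeiling_update_of_ne (by decide) _ (onCeiling_of_eq (by omega) (by ring) hN'0)⟩⟩ (threeCharged_update_apex hch 3 0) ?_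
    show absCharge (Function.update N' 3 ((0, 0, 0) : BPoint) 0) + absCharge (Function.update N' 3 ((0, 0, 0) : BPoint) 1) +
        absCharge (Function.update N' 3 ((0, 0, 0) : BPoint) 2) + absCharge (Function.update N' 3 ((0, 0, 0) : BPoint) 3) < c₁ + c₂ + 1
    rw [Function.update_of_ne (by decide), Function.update_of_ne (by decide), Function.update_of_ne (by decide), Function.update_self,
      hN'0, hN'1, hN'2, absCharge_ray_apex _ c₁ a (by omega), absCharge_ray_apex _ (c₂ - e) b (by omega),
      absCharge_ray_apex 0 1 k (by omega)]
    simp [absCharge, chargeOf]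
    omega
  · -- (3b) `e = c₂`: `N′ = [C_{c₁} | hI | ℓ_k | ℓ_v]` itself is bi-anchored, three-charged, of total charge `c₁ + 2`
    have hch : ∀ f, (P f).2 ≠ (0, 0) := fun f => by
      rcases fin4_cases f with rfl | rfl | rfl | rfl
      · rw [hP0]; exact ray_charged _ a hc₁
      · rw [hP1]; exact ray_charged _ b (by omega)
      · rw [hP2]; exact ray_charged 0 k le_rfl
      · rw [hP3]; exact ray_charged 0 v le_rfl
    have hN'eq : N' = Function.update P 1 ((h, 0, 0) : BPoint) := by
      rw [hN'def, sub_self, ray_zero, show h - 2 * e + 2 * e = h by ring]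
    refine hIH.1 _ hN' ⟨⟨3, onFloor_of_eq (by omega) hN'3⟩, ⟨0, onCeiling_of_eq (by omega) (by ring) hN'0⟩⟩
      (by rw [hN'eq]; exact threeCharged_update_apex hch 1 h) ?_
    show absCharge (N' 0) + absCharge (N' 1) + absCharge (N' 2) + absCharge (N' 3) < c₁ + e + 1
    rw [hN'0, hN'1, hN'2, hN'3, absCharge_ray_apex _ c₁ a (by omega), absCharge_ray_apex _ (e - e) b (by omega),
      absCharge_ray_apex 0 1 k (by omega), absCharge_ray_apex 0 1 v (by omega)]
    omega

/-- the same class at ARBITRARY slots (`G₁` contains the slot permutations). -/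
theorem exists_perm_fin4 {s₀ s₁ s₂ s₃ : Fin 4} (h01 : s₀ ≠ s₁) (h02 : s₀ ≠ s₂) (h03 : s₀ ≠ s₃) (h12 : s₁ ≠ s₂) (h13 : s₁ ≠ s₃)
    (h23 : s₂ ≠ s₃) : ∃ σ : Equiv.Perm (Fin 4), σ 0 = s₀ ∧ σ 1 = s₁ ∧ σ 2 = s₂ ∧ σ 3 = s₃ := by
  revert s₀ s₁ s₂ s₃; decide

theorem no_upper_twoFloor_subapex_unitCeiling' {h : ℤ} {C : MConfig} (hU : C.InDiamond h) (hG : C.G1Closed) (hS : C.StaticH1)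
    {P : MCell} (hP : P ∈ C.upper) {s₀ s₁ s₂ s₃ : Fin 4} (h01 : s₀ ≠ s₁) (h02 : s₀ ≠ s₂) (h03 : s₀ ≠ s₃)
    (h12 : s₁ ≠ s₂) (h13 : s₁ ≠ s₃) (h23 : s₂ ≠ s₃) {a b v : Fin 4} {c₁ c₂ : ℤ} (hc₁ : 1 ≤ c₁) (hc₂ : 2 ≤ c₂)
    (hP0 : P s₀ = ray ((0, 0, 0) : BPoint) a c₁) (hP1 : P s₁ = ray ((0, 0, 0) : BPoint) b c₂)
    (hP2 : P s₂ = ((h - 2, 0, 0) : BPoint)) (hP3 : P s₃ = ray ((h - 2, 0, 0) : BPoint) v 1)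
    (hIH : NoThreeBelow h C (c₁ + c₂ + 1)) : False := by
  obtain ⟨σ, h0, h1, h2, h3⟩ := exists_perm_fin4 h01 h02 h03 h12 h13 h23
  have hPσ : MCell.perm σ P ∈ C.upper := hG.2.1 _ _ hP
  have hev : ∀ g, MCell.perm σ P g = P (σ g) := fun g => rfl
  exact no_upper_twoFloor_subapex_unitCeiling hU hS hPσ hc₁ hc₂ (by rw [hev, h0, hP0]) (by rw [hev, h1, hP1])
    (by rw [hev, h2, hP2]) (by rw [hev, h3, hP3]) hIH


theorem no_lower_twoCeiling_apexTwo_unitFloor' {h : ℤ} {C : MConfig} (hU : C.InDiamond h) (hG : C.G1Closed) (hS : C.StaticH1)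
    {N : MCell} (hN : N ∈ C.lower) {s₀ s₁ s₂ s₃ : Fin 4} (h01 : s₀ ≠ s₁) (h02 : s₀ ≠ s₂) (h03 : s₀ ≠ s₃)
    (h12 : s₁ ≠ s₂) (h13 : s₁ ≠ s₃) (h23 : s₂ ≠ s₃) {a b v : Fin 4} {c₁ c₂ : ℤ} (hc₁ : 1 ≤ c₁) (hc₂ : 2 ≤ c₂)
    (hN0 : N s₀ = ray ((h - 2 * c₁, 0, 0) : BPoint) a c₁) (hN1 : N s₁ = ray ((h - 2 * c₂, 0, 0) : BPoint) b c₂)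
    (hN2 : N s₂ = ((2, 0, 0) : BPoint)) (hN3 : N s₃ = ray ((0, 0, 0) : BPoint) v 1)
    (hIH : NoThreeBelow h C (c₁ + c₂ + 1)) : False := by
  obtain ⟨σ, h0, h1, h2, h3⟩ := exists_perm_fin4 h01 h02 h03 h12 h13 h23
  have hNσ : MCell.perm σ N ∈ C.lower := hG.1 _ _ hN
  have hev : ∀ g, MCell.perm σ N g = N (σ g) := fun g => rfl
  exact no_lower_twoCeiling_apexTwo_unitFloor hU hS hNσ hc₁ hc₂ (by rw [hev, h0, hN0]) (by rw [hev, h1, hN1])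
    (by rw [hev, h2, hN2]) (by rw [hev, h3, hN3]) hIH

/-! ### §B4.4 A three-parameter charge-step class with an APEX-POSITION inequality: `P[c₀ℓ_a | C_c | C_{c′} | tI]`, `0 < t < 2c′` (PROVED) — doc: sketch §22 (h)∕(k). -/

/-- a letter `d ≥ 1` null steps below an apex `t·I` inside `◇_h` is `(t-2d)·I + d·ℓ_k` with `t - 2d ≥ 0`. -/
theorem exists_ray_of_ray_eq_apex {h : ℤ} {y : BPoint} (hy : InDiamond h y) {r : Fin 4} {d t : ℤ} (hd : 1 ≤ d)
    (hray : ray y r d = ((t, 0, 0) : BPoint)) (hsum : y.1 + d = t) : ∃ k : Fin 4, 0 ≤ t - 2 * d ∧ y = ray ((t - 2 * d, 0, 0) : BPoint) k d := by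
  have habs : absCharge y = d := absCharge_of_ray_eq_apex (by omega) hray
  have hch : y.2 ≠ (0, 0) := by
    intro h0
    have : absCharge y = 0 := by
      obtain ⟨a, b⟩ := y
      simp only at h0
      subst h0
      simp [absCharge, chargeOf]
    omega
  obtain ⟨t', c, k, hc, ht', -, hyx⟩ := exists_ray_of_charged hy hch
  rw [hyx, absCharge_ray_apex t' c k (by omega)] at habs
  rw [hyx] at hsum
  simp at hsum
  refine ⟨k, by omega, ?_⟩
  rw [hyx, show t' = t - 2 * d by omega, habs]

/-- a cell with an apex on slot `f₁` and charged letters elsewhere is three-charged. -/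
theorem threeCharged_of_apex_slot {Z : MCell} (f₁ : Fin 4) {t : ℤ} (h1 : Z f₁ = ((t, 0, 0) : BPoint))
    (hch : ∀ g, g ≠ f₁ → (Z g).2 ≠ (0, 0)) : ThreeCharged Z := by
  have hZ : Z = Function.update (Function.update Z f₁ (ray ((0, 0, 0) : BPoint) 0 1)) f₁ ((t, 0, 0) : BPoint) := by
    rw [Function.update_idem, ← h1, Function.update_eq_self]
  rw [hZ]
  refine threeCharged_update_apex (fun g => ?_) f₁ t
  by_cases hg : g = f₁
  · subst hg; rw [Function.update_self]; exact ray_charged 0 0 le_rfl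
  · rw [Function.update_of_ne hg]; exact hch g hg

/-- **CLASS `P[c₀ℓ_a | (h-2c)I+cℓ_b | (h-2c′)I+c′ℓ_{b′} | tI]`, `c₀, c, c′ ≥ 1`, `0 < t < 2c′` (PROVED, h-uniform charge-step class).** -/
theorem no_upper_floor_twoCeiling_lowApex {h : ℤ} {C : MConfig} (hU : C.InDiamond h) (hS : C.StaticH1)
    {P : MCell} (hP : P ∈ C.upper) {a b b' : Fin 4} {c₀ c c' t : ℤ} (hc₀ : 1 ≤ c₀) (hc : 1 ≤ c) (hc' : 1 ≤ c') (ht₀ : 0 < t) (ht : t < 2 * c')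
    (hP0 : P 0 = ray ((0, 0, 0) : BPoint) a c₀) (hP1 : P 1 = ray ((h - 2 * c, 0, 0) : BPoint) b c)
    (hP2 : P 2 = ray ((h - 2 * c', 0, 0) : BPoint) b' c') (hP3 : P 3 = ((t, 0, 0) : BPoint))
    (hIH : NoThreeBelow h C (c₀ + c + c')) : False := by
  have h12 : (1 : Fin 4) ≠ 2 := by decide
  have h03 : (0 : Fin 4) ≠ 3 := by decide
  obtain ⟨e, he1, he2, hN⟩ := lower_mem_of_two_ceiling' hU (hS.1.2 P hP) h12 hc (by ring) hc' (by ring) hP1 hP2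
  set N : MCell := Function.update P 2 (ray ((h - 2 * c' + 2 * e, 0, 0) : BPoint) b' (c' - e)) with hNdef
  have hN0 : N 0 = ray ((0, 0, 0) : BPoint) a c₀ := by rw [hNdef, Function.update_of_ne (by decide), hP0]
  have hN1 : N 1 = ray ((h - 2 * c, 0, 0) : BPoint) b c := by rw [hNdef, Function.update_of_ne (by decide), hP1]
  have hN2 : N 2 = ray ((h - 2 * c' + 2 * e, 0, 0) : BPoint) b' (c' - e) := by rw [hNdef, Function.update_self]
  have hN3 : N 3 = ((t, 0, 0) : BPoint) := by rw [hNdef, Function.update_of_ne (by decide), hP3]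
  rcases lt_or_eq_of_le he2 with hlt | rfl
  · -- (1a) `e < c′`: `N` is bi-anchored, three-charged, of total charge `c₀ + c + c′ - e`
    refine hIH.1 N hN ⟨⟨0, onFloor_of_eq (by omega) hN0⟩, ⟨1, onCeiling_of_eq (by omega) (by ring) hN1⟩⟩
      (threeCharged_of_apex_slot 3 hN3 fun g hg => ?_) ?_
    · rcases fin4_cases g with rfl | rfl | rfl | rfl
      · rw [hN0]; exact ray_charged 0 a hc₀
      · rw [hN1]; exact ray_charged _ b hc
      · rw [hN2]; exact ray_charged _ b' (by omega)
      · exact absurd rfl hg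
    · show absCharge (N 0) + absCharge (N 1) + absCharge (N 2) + absCharge (N 3) < c₀ + c + c'
      rw [hN0, hN1, hN2, hN3, absCharge_ray_apex 0 c₀ a (by omega), absCharge_ray_apex _ c b (by omega), absCharge_ray_apex _ (c' - e) b' (by omega)]
      simp [absCharge, chargeOf]
      omega
  · -- (1b) `e = c′`: `N = [c₀ℓ_a | C_c | hI | tI]`; the floor letter is stuck below, the apex `tI` is served below by `(t-2d)I + dℓ_k`
    have hN2' : N 2 = ((h, 0, 0) : BPoint) := by rw [hN2, sub_self, ray_zero, show h - 2 * e + 2 * e = h by ring]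
    obtain ⟨P', hP', r, d, hd, hag, hray, hsum⟩ := upper_mem_of_floor_apex hU (hS.1.1 N hN) h03 hc₀ hN0 hN3 (by omega)
    obtain ⟨k, hnode, hP'3⟩ := exists_ray_of_ray_eq_apex (hU.2 P' hP' 3) hd hray hsum
    have hP'0 : P' 0 = ray ((0, 0, 0) : BPoint) a c₀ := by rw [hag 0 (by decide), hN0]
    have hP'1 : P' 1 = ray ((h - 2 * c, 0, 0) : BPoint) b c := by rw [hag 1 (by decide), hN1]
    have hP'2 : P' 2 = ((h, 0, 0) : BPoint) := by rw [hag 2 (by decide), hN2']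
    refine hIH.2 P' hP' ⟨⟨0, onFloor_of_eq (by omega) hP'0⟩, ⟨1, onCeiling_of_eq (by omega) (by ring) hP'1⟩⟩
      (threeCharged_of_apex_slot 2 hP'2 fun g hg => ?_) ?_
    · rcases fin4_cases g with rfl | rfl | rfl | rfl
      · rw [hP'0]; exact ray_charged 0 a hc₀
      · rw [hP'1]; exact ray_charged _ b hc
      · exact absurd rfl hg
      · rw [hP'3]; exact ray_charged _ k hd
    · show absCharge (P' 0) + absCharge (P' 1) + absCharge (P' 2) + absCharge (P' 3) < c₀ + c + e
      rw [hP'0, hP'1, hP'2, hP'3, absCharge_ray_apex 0 c₀ a (by omega), absCharge_ray_apex _ c b (by omega), absCharge_ray_apex _ d k (by omega)]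
      simp [absCharge, chargeOf]
      omega
/-- **DUAL CLASS `N[(h-2c₀)I+c₀ℓ_a | cℓ_b | c′ℓ_{b′} | tI]`, `c₀, c, c′ ≥ 1`, `0 < h - t < 2c′` (PROVED, h-uniform charge-step class)** — the `E₋`-mirror of … (sketch §22). -/
theorem no_lower_ceiling_twoFloor_highApex {h : ℤ} {C : MConfig} (hU : C.InDiamond h) (hS : C.StaticH1)
    {N : MCell} (hN : N ∈ C.lower) {a b b' : Fin 4} {c₀ c c' t : ℤ} (hc₀ : 1 ≤ c₀) (hc : 1 ≤ c) (hc' : 1 ≤ c') (ht₁ : t < h) (ht : h < t + 2 * c')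
    (hN0 : N 0 = ray ((h - 2 * c₀, 0, 0) : BPoint) a c₀) (hN1 : N 1 = ray ((0, 0, 0) : BPoint) b c)
    (hN2 : N 2 = ray ((0, 0, 0) : BPoint) b' c') (hN3 : N 3 = ((t, 0, 0) : BPoint))
    (hIH : NoThreeBelow h C (c₀ + c + c')) : False := by
  have h12 : (1 : Fin 4) ≠ 2 := by decide
  have h03 : (0 : Fin 4) ≠ 3 := by decide
  obtain ⟨e, he1, he2, hP⟩ := upper_mem_of_two_floor' hU (hS.1.1 N hN) h12 hc hc' hN1 hN2
  set P : MCell := Function.update N 2 (ray ((0, 0, 0) : BPoint) b' (c' - e)) with hPdef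
  have hP0 : P 0 = ray ((h - 2 * c₀, 0, 0) : BPoint) a c₀ := by rw [hPdef, Function.update_of_ne (by decide), hN0]
  have hP1 : P 1 = ray ((0, 0, 0) : BPoint) b c := by rw [hPdef, Function.update_of_ne (by decide), hN1]
  have hP2 : P 2 = ray ((0, 0, 0) : BPoint) b' (c' - e) := by rw [hPdef, Function.update_self]
  have hP3 : P 3 = ((t, 0, 0) : BPoint) := by rw [hPdef, Function.update_of_ne (by decide), hN3]
  rcases lt_or_eq_of_le he2 with hlt | rfl
  · -- (1a) `e < c′`: `P` is bi-anchored, three-charged, of total charge `c₀ + c + c′ - e`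
    refine hIH.2 P hP ⟨⟨1, onFloor_of_eq (by omega) hP1⟩, ⟨0, onCeiling_of_eq (by omega) (by ring) hP0⟩⟩
      (threeCharged_of_apex_slot 3 hP3 fun g hg => ?_) ?_
    · rcases fin4_cases g with rfl | rfl | rfl | rfl
      · rw [hP0]; exact ray_charged _ a hc₀
      · rw [hP1]; exact ray_charged 0 b hc
      · rw [hP2]; exact ray_charged 0 b' (by omega)
      · exact absurd rfl hg
    · show absCharge (P 0) + absCharge (P 1) + absCharge (P 2) + absCharge (P 3) < c₀ + c + c'
      rw [hP0, hP1, hP2, hP3, absCharge_ray_apex _ c₀ a (by omega), absCharge_ray_apex 0 c b (by omega), absCharge_ray_apex 0 (c' - e) b' (by omega)]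
      simp [absCharge, chargeOf]
      omega
  · -- (1b) `e = c′`: `P = [C_{c₀} | cℓ_b | O | tI]`; the ceiling letter is stuck above, the apex `tI` is charged above by `e′ ≤ (h - t)∕2`
    have hP2' : P 2 = ((0, 0, 0) : BPoint) := by rw [hP2, sub_self, ray_zero]
    obtain ⟨r, e', he', hN'⟩ := lower_mem_of_ceiling_apex hU (hS.1.2 P hP) h03 hc₀ (by ring) hP0 hP3 (by omega)
    set N' : MCell := Function.update P 3 (ray ((t, 0, 0) : BPoint) r e') with hN'def
    have hN'0 : N' 0 = ray ((h - 2 * c₀, 0, 0) : BPoint) a c₀ := by rw [hN'def, Function.update_of_ne (by decide), hP0]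
    have hN'1 : N' 1 = ray ((0, 0, 0) : BPoint) b c := by rw [hN'def, Function.update_of_ne (by decide), hP1]
    have hN'2 : N' 2 = ((0, 0, 0) : BPoint) := by rw [hN'def, Function.update_of_ne (by decide), hP2']
    have hN'3 : N' 3 = ray ((t, 0, 0) : BPoint) r e' := by rw [hN'def, Function.update_self]
    have hle : t + 2 * e' ≤ h := line_le_of_ray_inDiamond (by omega) (hN'3 ▸ hU.1 N' hN' 3)
    refine hIH.1 N' hN' ⟨⟨1, onFloor_of_eq (by omega) hN'1⟩, ⟨0, onCeiling_of_eq (by omega) (by ring) hN'0⟩⟩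
      (threeCharged_of_apex_slot 2 hN'2 fun g hg => ?_) ?_
    · rcases fin4_cases g with rfl | rfl | rfl | rfl
      · rw [hN'0]; exact ray_charged _ a hc₀
      · rw [hN'1]; exact ray_charged 0 b hc
      · exact absurd rfl hg
      · rw [hN'3]; exact ray_charged t r he'
    · show absCharge (N' 0) + absCharge (N' 1) + absCharge (N' 2) + absCharge (N' 3) < c₀ + c + e
      rw [hN'0, hN'1, hN'2, hN'3, absCharge_ray_apex _ c₀ a (by omega), absCharge_ray_apex 0 c b (by omega), absCharge_ray_apex t e' r (by omega)]
      simp [absCharge, chargeOf]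
      omega

/-! ### §B4.5 UNIT CORE, first unconditional h-uniform class beyond §33: `P[ℓ_a | ℓ_b | (h-2)I | (h-2)I+ℓ_v] ∉ E₊` for ALL phases (PROVED, no IH) — doc: sketch §22 (h)∕(k). -/

/-- **UNIT CLASS `P[ℓ_a | ℓ_b | (h-2)I | (h-2)I+ℓ_v] ∉ E₊` (PROVED, h-uniform, every phase triple `a, b, v`, no induction hypothesis).** -/
theorem no_upper_two_units_subapex_unitCeiling {h : ℤ} {C : MConfig} (hU : C.InDiamond h) (hG : C.G1Closed) (hS : C.StaticH1)
    {P : MCell} (hP : P ∈ C.upper) {a b v : Fin 4}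
    (hP0 : P 0 = ray ((0, 0, 0) : BPoint) a 1) (hP1 : P 1 = ray ((0, 0, 0) : BPoint) b 1)
    (hP2 : P 2 = ((h - 2, 0, 0) : BPoint)) (hP3 : P 3 = ray ((h - 2, 0, 0) : BPoint) v 1) : False := by
  have h23 : (2 : Fin 4) ≠ 3 := by decide
  have h01 : (0 : Fin 4) ≠ 1 := by decide
  obtain ⟨r, e, he, hN⟩ := lower_mem_of_ceiling_apex hU (hS.1.2 P hP) h23.symm (t₀ := h - 2) (c₀ := 1) (t := h - 2) le_rfl (by ring)
    hP3 hP2 (by omega)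
  set N : MCell := Function.update P 2 (ray ((h - 2, 0, 0) : BPoint) r e) with hNdef
  have he1 : e = 1 := by
    have hx : InDiamond h (N 2) := hU.1 N hN 2
    rw [hNdef, Function.update_self] at hx
    have := line_le_of_ray_inDiamond (by omega : (0 : ℤ) ≤ e) hx
    omega
  have hN0 : N 0 = ray ((0, 0, 0) : BPoint) a 1 := by rw [hNdef, Function.update_of_ne (by decide), hP0]
  have hN1 : N 1 = ray ((0, 0, 0) : BPoint) b 1 := by rw [hNdef, Function.update_of_ne (by decide), hP1]
  have hN2 : N 2 = ray ((h - 2, 0, 0) : BPoint) r 1 := by rw [hNdef, Function.update_self, he1]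
  have hN3 : N 3 = ray ((h - 2, 0, 0) : BPoint) v 1 := by rw [hNdef, Function.update_of_ne (by decide), hP3]
  obtain ⟨e', he'1, he'2, hP'⟩ := upper_mem_of_two_floor' hU (hS.1.1 N hN) h01 le_rfl le_rfl hN0 hN1
  have he' : e' = 1 := le_antisymm he'2 he'1
  set P' : MCell := Function.update N 1 (ray ((0, 0, 0) : BPoint) b (1 - e')) with hP'def
  have hP'0 : P' 0 = ray ((0, 0, 0) : BPoint) a 1 := by rw [hP'def, Function.update_of_ne (by decide), hN0]
  have hP'1 : P' 1 = ((0, 0, 0) : BPoint) := by rw [hP'def, Function.update_self, he', sub_self, ray_zero]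
  have hP'2 : P' 2 = ray ((h - 2, 0, 0) : BPoint) r 1 := by rw [hP'def, Function.update_of_ne (by decide), hN2]
  have hP'3 : P' 3 = ray ((h - 2, 0, 0) : BPoint) v 1 := by rw [hP'def, Function.update_of_ne (by decide), hN3]
  exact no_upper_origin_unit_two_unit_ceilings hU hG hS hP' (s₀ := 1) (s₁ := 0) (s₂ := 2) (s₃ := 3)
    (by decide) (by decide) (by decide) (by decide) (by decide) (by decide) hP'1 hP'0 hP'2 hP'3

/-- any-slot form of `no_upper_two_units_subapex_unitCeiling` (via `PermClosed`). -/
theorem no_upper_two_units_subapex_unitCeiling' {h : ℤ} {C : MConfig} (hU : C.InDiamond h) (hG : C.G1Closed) (hS : C.StaticH1)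
    {P : MCell} (hP : P ∈ C.upper) {s₀ s₁ s₂ s₃ : Fin 4} (h01 : s₀ ≠ s₁) (h02 : s₀ ≠ s₂) (h03 : s₀ ≠ s₃)
    (h12 : s₁ ≠ s₂) (h13 : s₁ ≠ s₃) (h23 : s₂ ≠ s₃) {a b v : Fin 4}
    (hP0 : P s₀ = ray ((0, 0, 0) : BPoint) a 1) (hP1 : P s₁ = ray ((0, 0, 0) : BPoint) b 1)
    (hP2 : P s₂ = ((h - 2, 0, 0) : BPoint)) (hP3 : P s₃ = ray ((h - 2, 0, 0) : BPoint) v 1) : False := by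
  obtain ⟨σ, h0, h1, h2, h3⟩ := exists_perm_fin4 h01 h02 h03 h12 h13 h23
  have hPσ : MCell.perm σ P ∈ C.upper := hG.2.1 _ _ hP
  have hev : ∀ g, MCell.perm σ P g = P (σ g) := fun g => rfl
  exact no_upper_two_units_subapex_unitCeiling hU hG hS hPσ (by rw [hev, h0, hP0]) (by rw [hev, h1, hP1])
    (by rw [hev, h2, hP2]) (by rw [hev, h3, hP3])

/-! ### §B4.6 (v0.3) THE GENERAL COORDINATE `A2I⁻` ENGINE — any original-world head letter, any depth, any co-slot — doc: sketch §22 (h)∕(k). -/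

/-- **THE GENERAL COORDINATE `A2I⁻` ENGINE (PROVED ∀ h).** -/
theorem aminus_fires_coord {C : MConfig} (hS : C.StaticH1) {Z q N' : MCell} (hZ : Z ∈ C.lower) (hq : q ∈ C.upper) (hN' : N' ∈ C.lower)
    {σ f' u v : Fin 4} {t c d e : ℤ} (hfσ : f' ≠ σ) (ht : 0 ≤ t) (hd1 : 1 ≤ d) (hdc : d ≤ c) (he : 1 ≤ e)
    (hZσ : Z σ = ray ((t, 0, 0) : BPoint) u c) (hqσ : q σ = ray ((t, 0, 0) : BPoint) u (c - d)) (hqg : ∀ g, g ≠ σ → q g = Z g)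
    (hN'f : N' f' = ray (q f') v e) (hN'g : ∀ g, g ≠ f' → N' g = q g)
    (hpres : ∀ P ∈ C.upper, ∀ w : Fin 4, w ≠ u → ¬ UPartner Z P σ w)
    (hinter : ∀ P ∈ C.upper, UPartner Z P σ u → (P σ).1 ≤ (q σ).1)
    (hdeep : ∀ P ∈ C.upper, ¬ UPartner q P σ u)
    (ha1w : ∀ P ∈ C.upper, NullBelow (P f') (Z f') →
      (MAgree P Z f' ∨ ∃ g : Fin 4, g ≠ f' ∧ MAgree2 P Z f' g ∧ NullBelow (P g) (Z g)) → Z f' = ray (P f') v ((Z f').1 - (P f').1))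
    (hpoll : ∀ P ∈ C.upper, (∀ g, g ≠ σ → g ≠ f' → P g = Z g) → OnULineBelowEq (P σ) (q σ) u →
      ¬ ((Z f').1 < (P f').1 ∧ (P f').1 ≤ (N' f').1 ∧ P f' = ray (Z f') v ((P f').1 - (Z f').1)) ∧
        ¬ (Effective (bsub (N' f') (P f')) ∧ Spacelike (bsub (P f') (Z f')))) : False := by
  have hc0 : 0 ≤ c := by omega
  refine hS.2.2 Z hZ q hq N' hN' σ u f' v ⟨?_, ?_, ?_, ?_, hfσ, ?_, hpres, hinter, hdeep, ha1w, hpoll⟩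
  · -- `Z_σ = t·I + c·ℓ_u` is charged
    rw [hZσ]; fin_cases u <;> simp [isApex] <;> omega
  · -- `EncDir`: original world, partner direction = own phase `u`
    rw [hZσ]
    left
    refine ⟨by simp; omega, ?_⟩
    rw [cabs_ray_apex t c u hc0, ray_fst]
    simp
  · -- `q` is the `u`-partner at depth `d`
    refine ⟨hqg, by rw [hqσ, hZσ, ray_fst, ray_fst]; simp; omega, ?_⟩
    rw [hqσ, hZσ, ray_ray_self, ray_fst, ray_fst]
    congr 1
    simp
  · -- the guard `d ≤ cabs = c`
    intro _
    rw [hqσ, hZσ, cabs_ray_apex t c u hc0, ray_fst, ray_fst]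
    simp; omega
  · -- `N′ = q(f′ ↦ q_{f′} + e·n_v)` is the server
    refine ⟨fun g hg => (hN'g g hg).symm, by rw [hN'f, ray_fst]; omega, ?_⟩
    rw [hN'f, ray_fst]
    congr 1
    omega

/-- **depth one**: the `inter` escape is automatic (`(P σ).1 < (Z σ).1 = (q σ).1 + 1`). -/
theorem aminus_fires_coord_depthOne {C : MConfig} (hS : C.StaticH1) {Z q N' : MCell} (hZ : Z ∈ C.lower) (hq : q ∈ C.upper)
    (hN' : N' ∈ C.lower) {σ f' u v : Fin 4} {t c e : ℤ} (hfσ : f' ≠ σ) (ht : 0 ≤ t) (hc : 1 ≤ c) (he : 1 ≤ e)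
    (hZσ : Z σ = ray ((t, 0, 0) : BPoint) u c) (hqσ : q σ = ray ((t, 0, 0) : BPoint) u (c - 1)) (hqg : ∀ g, g ≠ σ → q g = Z g)
    (hN'f : N' f' = ray (q f') v e) (hN'g : ∀ g, g ≠ f' → N' g = q g)
    (hpres : ∀ P ∈ C.upper, ∀ w : Fin 4, w ≠ u → ¬ UPartner Z P σ w)
    (hdeep : ∀ P ∈ C.upper, ¬ UPartner q P σ u)
    (ha1w : ∀ P ∈ C.upper, NullBelow (P f') (Z f') →
      (MAgree P Z f' ∨ ∃ g : Fin 4, g ≠ f' ∧ MAgree2 P Z f' g ∧ NullBelow (P g) (Z g)) → Z f' = ray (P f') v ((Z f').1 - (P f').1))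
    (hpoll : ∀ P ∈ C.upper, (∀ g, g ≠ σ → g ≠ f' → P g = Z g) → OnULineBelowEq (P σ) (q σ) u →
      ¬ ((Z f').1 < (P f').1 ∧ (P f').1 ≤ (N' f').1 ∧ P f' = ray (Z f') v ((P f').1 - (Z f').1)) ∧
        ¬ (Effective (bsub (N' f') (P f')) ∧ Spacelike (bsub (P f') (Z f')))) : False :=
  aminus_fires_coord hS hZ hq hN' hfσ ht le_rfl hc he hZσ hqσ hqg hN'f hN'g hpres
    (fun P _ hP => by
      have h1 := hP.2.1
      rw [hqσ, ray_fst]; rw [hZσ, ray_fst] at h1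
      simp at h1 ⊢; omega)
    hdeep ha1w hpoll

/-! ### §B4.7 (v0.3) THE GENERAL `X⁺` ENGINE — any charged head letter, any direction, nearest partner, any breaker slot — doc: sketch §22 (h)∕(k). -/

/-- **THE GENERAL `X⁺` ENGINE (PROVED ∀ h).** -/
theorem xplus_fires {C : MConfig} (hS : C.StaticH1) {P N₀ P₁ : MCell} (hP : P ∈ C.upper) (hN₀ : N₀ ∈ C.lower) (hP₁ : P₁ ∈ C.upper)
    {b f u r : Fin 4} (hfb : f ≠ b) (hch : ¬ isApex (P b)) (hpart : UPartner N₀ P b u)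
    (hnear : ∀ N ∈ C.lower, UPartner N P b u → (N₀ b).1 ≤ (N b).1)
    (hr : r ≠ u) (hsib : UPartner N₀ P₁ b r)
    (hcomp : ∀ N ∈ C.lower, (∀ g, g ≠ b → N g = P g) → (P₁ b).1 < (N b).1 → (N b).1 < (N₀ b).1 →
      N b ≠ ray (P₁ b) r ((N b).1 - (P₁ b).1))
    (hHe : ∀ N ∈ C.lower, (∀ g, g ≠ b → N g = P g) → N b ≠ P b → Effective (bsub (N b) (P₁ b)) → ¬ Timelike (bsub (P b) (N b)) →
      Effective (bsub (N₀ b) (N b)))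
    (hHb : ∀ N ∈ C.lower, (∀ g, g ≠ b → g ≠ f → N g = P g) → NullBelow (P f) (N f) → Effective (bsub (N b) (P₁ b)) →
      Timelike (bsub (P b) (N b)))
    (hW1 : ∀ N ∈ C.lower, (∀ g, g ≠ f → N g = P g) → ¬ NullBelow (P f) (N f))
    (hW2 : ∀ N ∈ C.lower, ∀ g, g ≠ f → (∀ g', g' ≠ f → g' ≠ g → N g' = P g') → NullBelow (P f) (N f) → ¬ NullBelow (P g) (N g)) :
    False := by
  have hN₀g : ∀ g, g ≠ b → N₀ g = P g := fun g hg => (hpart.1 g hg).symm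
  refine hS.2.1 (dualCell 0 P) (dualCell_mem_dual_lower hP) (dualCell 0 N₀) (dualCell_mem_dual_upper hN₀)
    (dualCell 0 P₁) (dualCell_mem_dual_lower hP₁) b u r f ⟨?_, hfb, ?_, ?_, hr, ?_, ?_, ?_, ?_, ?_⟩
  · -- the head letter is charged
    change ¬ isApex (dualPt 0 (P b))
    rw [isApex_dual]
    exact hch
  · -- `N₀^∨` is a `u`-partner of the head
    exact (uPartner_dual 0 N₀ P b u).mpr hpart
  · -- … and the topmost one in the dual world (= the nearest one above `P`)
    intro Q hQ hup
    obtain ⟨N, hN, rfl⟩ : ∃ N ∈ C.lower, dualCell 0 N = Q := ⟨_, mem_dual_upper.mp hQ, dualCell_dualCell 0 Q⟩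
    have hle := hnear N hN ((uPartner_dual 0 N P b u).mp hup)
    change 0 - (N b).1 ≤ 0 - (N₀ b).1
    omega
  · -- the sibling `P₁^∨`
    obtain ⟨hag', hlt', hray'⟩ := (uPartner_dual 0 N₀ P₁ b r).mpr hsib
    exact ⟨fun g hg => (hag' g hg).symm, hlt', hray'⟩
  · -- no companion strictly between `P₁ b` and `N₀ b` on the `r`-ray (hypothesis `hcomp`, read in the dual world)
    intro Q hQ hag hlt1 hlt2 hray
    obtain ⟨N, hN, rfl⟩ : ∃ N ∈ C.lower, dualCell 0 N = Q := ⟨_, mem_dual_upper.mp hQ, dualCell_dualCell 0 Q⟩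
    have h1 : (0 : ℤ) - (N₀ b).1 < 0 - (N b).1 := hlt1
    have h2 : (0 : ℤ) - (N b).1 < 0 - (P₁ b).1 := hlt2
    have hNg : ∀ g, g ≠ b → N g = P g := fun g hg => by
      have e := hag g hg
      change dualPt 0 (N g) = dualPt 0 (N₀ g) at e
      rw [hN₀g g hg] at e
      exact eq_of_dualPt_eq e
    refine hcomp N hN hNg (by omega) (by omega) ?_
    obtain ⟨-, -, hsray⟩ := hsib
    change dualPt 0 (N b) = ray (dualPt 0 (N₀ b)) r ((dualPt 0 (N b)).1 - (dualPt 0 (N₀ b)).1) at hray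
    generalize N b = nb at hray ⊢
    generalize P₁ b = pb at hsray ⊢
    generalize N₀ b = n0 at hray hsray
    obtain ⟨n1, n2, n3⟩ := nb
    obtain ⟨p1, p2, p3⟩ := pb
    obtain ⟨m1, m2, m3⟩ := n0
    simp only [dualPt, ray, Prod.mk.injEq] at hray hsray ⊢
    obtain ⟨-, hr2, hr3⟩ := hray
    obtain ⟨hs1, hs2, hs3⟩ := hsray
    exact ⟨by ring, by linear_combination hs2 - hr2, by linear_combination hs3 - hr3⟩
  · -- (H-e′), original-world form `hHe`
    intro Q hQ hag hne heff hntl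
    obtain ⟨N, hN, rfl⟩ : ∃ N ∈ C.lower, dualCell 0 N = Q := ⟨_, mem_dual_upper.mp hQ, dualCell_dualCell 0 Q⟩
    change Effective (bsub (dualPt 0 (P₁ b)) (dualPt 0 (N b))) at heff
    change ¬ Timelike (bsub (dualPt 0 (N b)) (dualPt 0 (P b))) at hntl
    change Effective (bsub (dualPt 0 (N b)) (dualPt 0 (N₀ b)))
    rw [bsub_dualPt] at heff hntl ⊢
    have hNg : ∀ g, g ≠ b → N g = P g := fun g hg => by
      have e := hag g hg
      change dualPt 0 (N g) = dualPt 0 (P g) at e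
      exact eq_of_dualPt_eq e
    have hne' : N b ≠ P b := fun e => hne (by change dualPt 0 (N b) = dualPt 0 (P b); rw [e])
    exact hHe N hN hNg hne' heff hntl
  · -- (H-b), original-world form `hHb`
    intro Q hQ hag2 hnb heff
    obtain ⟨N, hN, rfl⟩ : ∃ N ∈ C.lower, dualCell 0 N = Q := ⟨_, mem_dual_upper.mp hQ, dualCell_dualCell 0 Q⟩
    change NullBelow (dualPt 0 (N f)) (dualPt 0 (P f)) at hnb
    change Effective (bsub (dualPt 0 (P₁ b)) (dualPt 0 (N b))) at heff
    change Timelike (bsub (dualPt 0 (N b)) (dualPt 0 (P b)))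
    rw [nullBelow_dual_iff] at hnb
    rw [bsub_dualPt] at heff ⊢
    exact hHb N hN (fun g hgb hgf => eq_of_dualPt_eq (hag2 g hgb hgf)) hnb heff
  · -- `W_f = ∅`, original-world form `hW1` ∕ `hW2`
    intro Q hQ hnb
    obtain ⟨N, hN, rfl⟩ : ∃ N ∈ C.lower, dualCell 0 N = Q := ⟨_, mem_dual_upper.mp hQ, dualCell_dualCell 0 Q⟩
    change NullBelow (dualPt 0 (N f)) (dualPt 0 (P f)) at hnb
    rw [nullBelow_dual_iff] at hnb
    refine ⟨fun hag => hW1 N hN (fun g hg => eq_of_dualPt_eq (hag g hg)) hnb, fun g hgf hag2 hnb' => ?_⟩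
    change NullBelow (dualPt 0 (N g)) (dualPt 0 (P g)) at hnb'
    rw [nullBelow_dual_iff] at hnb'
    exact hW2 N hN g hgf (fun g' hg'f hg'g => eq_of_dualPt_eq (hag2 g' hg'f hg'g)) hnb hnb'

/-- `xplus_top_fires` IS the case `N₀ = P(b ↦ hI)`, `u = v + 2` of `xplus_fires` (consistency check of the abstraction; (H-e′) automatic at the top). -/
theorem xplus_top_fires_of_general {h : ℤ} {C : MConfig} (hU : C.InDiamond h) (hS : C.StaticH1)
    {P : MCell} (hP : P ∈ C.upper) {b f v : Fin 4} (hfb : f ≠ b) {t c : ℤ} (hc : 1 ≤ c) (hh : t + 2 * c = h)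
    (hPb : P b = ray ((t, 0, 0) : BPoint) v c)
    (hN₀ : Function.update P b ((h, 0, 0) : BPoint) ∈ C.lower)
    (htop : ∀ N ∈ C.lower, ∀ w : Fin 4, UPartner N P b w → (N b).1 = h)
    {P₁ : MCell} (hP₁ : P₁ ∈ C.upper) {r : Fin 4} (hr : r ≠ v + 2)
    (hsib : UPartner (Function.update P b ((h, 0, 0) : BPoint)) P₁ b r)
    (hcomp : ∀ N ∈ C.lower, (∀ g, g ≠ b → N g = P g) → (P₁ b).1 < (N b).1 → (N b).1 < h →
      N b ≠ ray (P₁ b) r ((N b).1 - (P₁ b).1))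
    (hHb : ∀ N ∈ C.lower, (∀ g, g ≠ b → g ≠ f → N g = P g) → NullBelow (P f) (N f) → Effective (bsub (N b) (P₁ b)) →
      Timelike (bsub (P b) (N b)))
    (hW1 : ∀ N ∈ C.lower, (∀ g, g ≠ f → N g = P g) → ¬ NullBelow (P f) (N f))
    (hW2 : ∀ N ∈ C.lower, ∀ g, g ≠ f → (∀ g', g' ≠ f → g' ≠ g → N g' = P g') → NullBelow (P f) (N f) → ¬ NullBelow (P g) (N g)) :
    False := by
  have hN₀b : Function.update P b ((h, 0, 0) : BPoint) b = ((h, 0, 0) : BPoint) := Function.update_self ..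
  have hPb1 : (P b).1 = t + c := by rw [hPb]
  refine xplus_fires hS hP hN₀ hP₁ hfb (by rw [hPb]; fin_cases v <;> simp [isApex] <;> omega)
    ⟨fun g hg => (Function.update_of_ne hg ..).symm, by rw [hN₀b, hPb1]; simp; omega, ?_⟩ ?_ hr hsib ?_ ?_ hHb hW1 hW2
  · have h1 : ((h, 0, 0) : BPoint).1 - (P b).1 = c := by rw [hPb1]; simp; omega
    rw [hN₀b, h1, hPb]
    exact top_eq_ray_ceiling hh v
  · intro N hN hup
    have e := htop N hN (v + 2) hup
    rw [hN₀b, e]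
  · intro N hN hag hlt1 hlt2
    rw [hN₀b] at hlt2
    exact hcomp N hN hag hlt1 hlt2
  · intro N hN _ _ _ _
    rw [hN₀b]
    have := effective_dual_top (hU.1 N hN b)
    rwa [bsub_dualPt] at this

/-! ### §B4.8 THE STAIRCASE TOP (anomaly g11, sketch v1.5 §21 (g); PROVED, h-uniform, RULE D only) — doc: sketch §22 (h)∕(k). -/

/-- **staircase, `P` entry with measure** (see the § header). -/
theorem fullHeight_of_ceiling_floor_upper_aux {h : ℤ} {C : MConfig} (hU : C.InDiamond h) (hS : C.StaticH1) :
    ∀ n : ℕ, ∀ P ∈ C.upper, ∀ (f₀ f₁ k₀ k₁ : Fin 4) (t₀ c₀ c₁ : ℤ), f₀ ≠ f₁ → 1 ≤ c₀ → t₀ + 2 * c₀ = h → 1 ≤ c₁ →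
      P f₀ = ray ((t₀, 0, 0) : BPoint) k₀ c₀ → P f₁ = ray ((0, 0, 0) : BPoint) k₁ c₁ → t₀ + (h - 2 * c₁) ≤ (n : ℤ) →
      ∃ Q : MCell, (Q ∈ C.lower ∨ Q ∈ C.upper) ∧ (∀ g, g ≠ f₀ → g ≠ f₁ → Q g = P g) ∧
        ∃ t c c' : ℤ, 0 ≤ t ∧ 1 ≤ c ∧ t + 2 * c = h ∧ 1 ≤ c' ∧ 2 * c' ≤ h ∧
          Q f₀ = ray ((t, 0, 0) : BPoint) k₀ c ∧ Q f₁ = ray ((0, 0, 0) : BPoint) k₁ c' ∧ (t = 0 ∨ 2 * c' = h) := by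
  intro n
  induction n with
  | zero =>
      intro P hP f₀ f₁ k₀ k₁ t₀ c₀ c₁ hf hc₀ hh₀ hc₁ hP0 hP1 hμ
      have ht₀ := node_nonneg_of_eq (by omega) hP0 (hU.2 P hP f₀)
      have hl₁ := line_le_of_eq (by omega) hP1 (hU.2 P hP f₁)
      exact ⟨P, Or.inr hP, fun g _ _ => rfl, t₀, c₀, c₁, ht₀, hc₀, hh₀, hc₁, by omega, hP0, hP1, Or.inl (by push_cast at hμ; omega)⟩
  | succ n ih =>
      intro P hP f₀ f₁ k₀ k₁ t₀ c₀ c₁ hf hc₀ hh₀ hc₁ hP0 hP1 hμ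
      have hμ' : t₀ + (h - 2 * c₁) ≤ (n : ℤ) + 1 := by push_cast at hμ; omega
      have ht₀ := node_nonneg_of_eq (by omega) hP0 (hU.2 P hP f₀)
      have hl₁ := line_le_of_eq (by omega) hP1 (hU.2 P hP f₁)
      by_cases ht : t₀ = 0
      · exact ⟨P, Or.inr hP, fun g _ _ => rfl, t₀, c₀, c₁, ht₀, hc₀, hh₀, hc₁, by omega, hP0, hP1, Or.inl ht⟩
      by_cases hc : 2 * c₁ = h
      · exact ⟨P, Or.inr hP, fun g _ _ => rfl, t₀, c₀, c₁, ht₀, hc₀, hh₀, hc₁, by omega, hP0, hP1, Or.inr hc⟩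
      obtain ⟨e, he, hle, hN⟩ := lower_mem_of_ceiling_floor hU (hS.1.2 P hP) hf hc₀ hh₀ hc₁ hc hP0 hP1
      have hN1 : Function.update P f₁ (ray ((0, 0, 0) : BPoint) k₁ (c₁ + e)) f₁ = ray ((0, 0, 0) : BPoint) k₁ (c₁ + e) := by simp
      have hN0 : Function.update P f₁ (ray ((0, 0, 0) : BPoint) k₁ (c₁ + e)) f₀ = ray ((t₀, 0, 0) : BPoint) k₀ c₀ := by
        rw [Function.update_of_ne hf]; exact hP0
      by_cases hce : 2 * (c₁ + e) = h
      · exact ⟨_, Or.inl hN, fun g _ hg1 => by rw [Function.update_of_ne hg1], t₀, c₀, c₁ + e, ht₀, hc₀, hh₀, by omega, by omega,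
          hN0, hN1, Or.inr hce⟩
      obtain ⟨d, hd, hdt, hP'⟩ :=
        upper_mem_of_floor_ceiling hU (hS.1.1 _ hN) (Ne.symm hf) (c₀ := c₁ + e) (t₁ := t₀) (c₁ := c₀) (by omega) hc₀ (by omega) hN1 hN0
      have hP'0 : Function.update (Function.update P f₁ (ray ((0, 0, 0) : BPoint) k₁ (c₁ + e))) f₀
          (ray ((t₀ - 2 * d, 0, 0) : BPoint) k₀ (c₀ + d)) f₀ = ray ((t₀ - 2 * d, 0, 0) : BPoint) k₀ (c₀ + d) := by simp
      have hP'1 : Function.update (Function.update P f₁ (ray ((0, 0, 0) : BPoint) k₁ (c₁ + e))) f₀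
          (ray ((t₀ - 2 * d, 0, 0) : BPoint) k₀ (c₀ + d)) f₁ = ray ((0, 0, 0) : BPoint) k₁ (c₁ + e) := by
        rw [Function.update_of_ne hf.symm]; exact hN1
      obtain ⟨Q, hQ, hQg, t, c, c', ht', hcQ, hhQ, hc'Q, hl', hQ0, hQ1, htop⟩ :=
        ih _ hP' f₀ f₁ k₀ k₁ (t₀ - 2 * d) (c₀ + d) (c₁ + e) hf (by omega) (by omega) (by omega) hP'0 hP'1 (by omega)
      refine ⟨Q, hQ, fun g hg0 hg1 => ?_, t, c, c', ht', hcQ, hhQ, hc'Q, hl', hQ0, hQ1, htop⟩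
      rw [hQg g hg0 hg1, Function.update_of_ne hg0, Function.update_of_ne hg1]

/-- **THE STAIRCASE TOP, `P` entry (PROVED ∀ h, rule D only).** A `P`-cell of a static configuration with a charged ceiling letter on `f₀` and a charged floor letter on `f₁` … (sketch §22). -/
theorem fullHeight_of_ceiling_floor_upper {h : ℤ} {C : MConfig} (hU : C.InDiamond h) (hS : C.StaticH1) {P : MCell} (hP : P ∈ C.upper)
    {f₀ f₁ k₀ k₁ : Fin 4} {t₀ c₀ c₁ : ℤ} (hf : f₀ ≠ f₁) (hc₀ : 1 ≤ c₀) (hh₀ : t₀ + 2 * c₀ = h) (hc₁ : 1 ≤ c₁)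
    (hP0 : P f₀ = ray ((t₀, 0, 0) : BPoint) k₀ c₀) (hP1 : P f₁ = ray ((0, 0, 0) : BPoint) k₁ c₁) :
    ∃ Q : MCell, (Q ∈ C.lower ∨ Q ∈ C.upper) ∧ (∀ g, g ≠ f₀ → g ≠ f₁ → Q g = P g) ∧
      ∃ t c c' : ℤ, 0 ≤ t ∧ 1 ≤ c ∧ t + 2 * c = h ∧ 1 ≤ c' ∧ 2 * c' ≤ h ∧
        Q f₀ = ray ((t, 0, 0) : BPoint) k₀ c ∧ Q f₁ = ray ((0, 0, 0) : BPoint) k₁ c' ∧ (t = 0 ∨ 2 * c' = h) :=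
  fullHeight_of_ceiling_floor_upper_aux hU hS (t₀ + (h - 2 * c₁)).toNat P hP f₀ f₁ k₀ k₁ t₀ c₀ c₁ hf hc₀ hh₀ hc₁ hP0 hP1
    (Int.self_le_toNat _)

/-- **THE STAIRCASE TOP, `N` entry (PROVED ∀ h, rule D only)**: the same for an `N`-cell with a charged floor letter on `f₁` and a charged ceiling letter `t₀·I + c₀·ℓ` on … (sketch §22). -/
theorem fullHeight_of_floor_ceiling_lower {h : ℤ} {C : MConfig} (hU : C.InDiamond h) (hS : C.StaticH1) {N : MCell} (hN : N ∈ C.lower)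
    {f₀ f₁ k₀ k₁ : Fin 4} {t₀ c₀ c₁ : ℤ} (hf : f₀ ≠ f₁) (hc₀ : 1 ≤ c₀) (hh₀ : t₀ + 2 * c₀ = h) (hc₁ : 1 ≤ c₁)
    (hN0 : N f₀ = ray ((t₀, 0, 0) : BPoint) k₀ c₀) (hN1 : N f₁ = ray ((0, 0, 0) : BPoint) k₁ c₁) :
    ∃ Q : MCell, (Q ∈ C.lower ∨ Q ∈ C.upper) ∧ (∀ g, g ≠ f₀ → g ≠ f₁ → Q g = N g) ∧
      ∃ t c c' : ℤ, 0 ≤ t ∧ 1 ≤ c ∧ t + 2 * c = h ∧ 1 ≤ c' ∧ 2 * c' ≤ h ∧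
        Q f₀ = ray ((t, 0, 0) : BPoint) k₀ c ∧ Q f₁ = ray ((0, 0, 0) : BPoint) k₁ c' ∧ (t = 0 ∨ 2 * c' = h) := by
  have ht₀ := node_nonneg_of_eq (by omega) hN0 (hU.1 N hN f₀)
  have hl₁ := line_le_of_eq (by omega) hN1 (hU.1 N hN f₁)
  by_cases ht : t₀ = 0
  · exact ⟨N, Or.inl hN, fun g _ _ => rfl, t₀, c₀, c₁, ht₀, hc₀, hh₀, hc₁, by omega, hN0, hN1, Or.inl ht⟩
  obtain ⟨d, hd, hdt, hP⟩ := upper_mem_of_floor_ceiling hU (hS.1.1 N hN) (Ne.symm hf) hc₁ hc₀ (by omega) hN1 hN0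
  have hP0 : Function.update N f₀ (ray ((t₀ - 2 * d, 0, 0) : BPoint) k₀ (c₀ + d)) f₀ = ray ((t₀ - 2 * d, 0, 0) : BPoint) k₀ (c₀ + d) := by simp
  have hP1 : Function.update N f₀ (ray ((t₀ - 2 * d, 0, 0) : BPoint) k₀ (c₀ + d)) f₁ = ray ((0, 0, 0) : BPoint) k₁ c₁ := by
    rw [Function.update_of_ne hf.symm]; exact hN1
  obtain ⟨Q, hQ, hQg, t, c, c', ht', hcQ, hhQ, hc'Q, hl', hQ0, hQ1, htop⟩ :=
    fullHeight_of_ceiling_floor_upper hU hS hP hf (by omega) (by omega) hc₁ hP0 hP1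
  exact ⟨Q, hQ, fun g hg0 hg1 => by rw [hQg g hg0 hg1, Function.update_of_ne hg0], t, c, c', ht', hcQ, hhQ, hc'Q, hl', hQ0, hQ1, htop⟩

/-- **the unit class enters the staircase (PROVED ∀ h)**: an `N`-cell with the ORIGIN on `f`, an interior unit letter `2I + ℓ_v` on `f₁` and a charged CEILING letter on `f₀` … (sketch §22). -/
theorem fullHeight_of_origin_i21_ceiling {h : ℤ} {C : MConfig} (hU : C.InDiamond h) (hS : C.StaticH1) {N : MCell} (hN : N ∈ C.lower)
    {f f₀ f₁ k₀ k₁ : Fin 4} {t₀ c₀ : ℤ} (hf1 : f ≠ f₁) (hf01 : f₀ ≠ f₁) (hc₀ : 1 ≤ c₀) (hh₀ : t₀ + 2 * c₀ = h)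
    (hNf : N f = ((0, 0, 0) : BPoint)) (hN0 : N f₀ = ray ((t₀, 0, 0) : BPoint) k₀ c₀) (hN1 : N f₁ = ray ((2, 0, 0) : BPoint) k₁ 1) :
    ∃ Q : MCell, (Q ∈ C.lower ∨ Q ∈ C.upper) ∧ (∀ g, g ≠ f₀ → g ≠ f₁ → Q g = N g) ∧
      ∃ t c c' : ℤ, 0 ≤ t ∧ 1 ≤ c ∧ t + 2 * c = h ∧ 1 ≤ c' ∧ 2 * c' ≤ h ∧
        Q f₀ = ray ((t, 0, 0) : BPoint) k₀ c ∧ Q f₁ = ray ((0, 0, 0) : BPoint) k₁ c' ∧ (t = 0 ∨ 2 * c' = h) := by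
  obtain ⟨d, hd, hdt, hP⟩ := upper_mem_of_origin_node hU (hS.1.1 N hN) hf1 (t₁ := 2) (c₁ := 1) le_rfl (by norm_num) hNf hN1
  have hd1 : d = 1 := by omega
  subst hd1
  have hP1 : Function.update N f₁ (ray ((2 - 2 * 1, 0, 0) : BPoint) k₁ (1 + 1)) f₁ = ray ((0, 0, 0) : BPoint) k₁ 2 := by simp
  have hP0 : Function.update N f₁ (ray ((2 - 2 * 1, 0, 0) : BPoint) k₁ (1 + 1)) f₀ = ray ((t₀, 0, 0) : BPoint) k₀ c₀ := by
    rw [Function.update_of_ne hf01]; exact hN0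
  obtain ⟨Q, hQ, hQg, t, c, c', ht', hcQ, hhQ, hc'Q, hl', hQ0, hQ1, htop⟩ :=
    fullHeight_of_ceiling_floor_upper hU hS hP hf01 hc₀ hh₀ (by norm_num) hP0 hP1
  exact ⟨Q, hQ, fun g hg0 hg1 => by rw [hQg g hg0 hg1, Function.update_of_ne hg1], t, c, c', ht', hcQ, hhQ, hc'Q, hl', hQ0, hQ1, htop⟩

/-! ### §B5 (v0.5, g12) EMPTY-CONTEXT CLASS KILLS CERTIFIED BY THE LOOKAHEAD TRACER — the `E₋`-sibling of §B4.5 and the first INTERIOR-letter class — doc: sketch §22 (h)∕(k). -/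

/-- **chain step below beside the ORIGIN (PROVED, h-uniform)**: `O` (f₀) and a charged FLOOR letter `c₁·ℓ_v` (f₁ ≠ f₀) of an `N`-cell force a `P`-cell equal to `Z` with the floor … (doc: sketch §22) -/
theorem upper_mem_of_origin_floor' {h : ℤ} {C : MConfig} (hU : C.InDiamond h) {Z : MCell} (hD : RuleDMu4N C Z)
    {f₀ f₁ k₁ : Fin 4} (hf : f₀ ≠ f₁) {c₁ : ℤ} (hc₁ : 1 ≤ c₁)
    (h0 : Z f₀ = ((0, 0, 0) : BPoint)) (h1 : Z f₁ = ray ((0, 0, 0) : BPoint) k₁ c₁) :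
    ∃ e, 1 ≤ e ∧ e ≤ c₁ ∧ Function.update Z f₁ (ray ((0, 0, 0) : BPoint) k₁ (c₁ - e)) ∈ C.upper := by
  have hne : coord (Z f₁) k₁ ≠ 0 := by rw [h1, coord_ray_apex_self]; omega
  obtain ⟨r, -, P, hP, hagree, hlt, hray⟩ :=
    settledBelow_of_origin hU hD h0 (Ne.symm hf) (by rw [h1]; exact adapted_ray_apex_self 0 c₁ k₁) hne
  rw [h1] at hray hlt
  have he : 0 < (ray ((0, 0, 0) : BPoint) k₁ c₁).1 - (P f₁).1 := by simp at hlt ⊢; omega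
  obtain ⟨-, hle, hpt⟩ := floor_move hc₁ he hray (hU.2 P hP f₁)
  refine ⟨(ray ((0, 0, 0) : BPoint) k₁ c₁).1 - (P f₁).1, by omega, hle, ?_⟩
  have hPeq : P = Function.update Z f₁ (ray ((0, 0, 0) : BPoint) k₁ (c₁ - ((ray ((0, 0, 0) : BPoint) k₁ c₁).1 - (P f₁).1))) := by
    funext g
    by_cases hg : g = f₁
    · subst hg; rw [Function.update_self]; exact hpt
    · rw [Function.update_of_ne hg]; exact hagree g hg
  rw [← hPeq]; exact hP

/-- **(L1) UNIT CLASS `N[ℓ_a | ℓ_b | (h-2)I | (h-2)I+ℓ_v] ∉ E₋` (PROVED, h-uniform, every phase triple `a, b, v`, no induction hypothesis)** — the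
`E₋`-cell with §B4.5's letters. -/
theorem no_lower_two_units_subapex_unitCeiling {h : ℤ} {C : MConfig} (hU : C.InDiamond h) (hG : C.G1Closed) (hS : C.StaticH1)
    {N : MCell} (hN : N ∈ C.lower) {a b v : Fin 4}
    (hN0 : N 0 = ray ((0, 0, 0) : BPoint) a 1) (hN1 : N 1 = ray ((0, 0, 0) : BPoint) b 1)
    (hN2 : N 2 = ((h - 2, 0, 0) : BPoint)) (hN3 : N 3 = ray ((h - 2, 0, 0) : BPoint) v 1) : False := by
  have h01 : (0 : Fin 4) ≠ 1 := by decide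
  have h23 : (2 : Fin 4) ≠ 3 := by decide
  have hP := upper_mem_of_unit_floor hU (hS.1.1 N hN) h01 (c₀ := 1) le_rfl hN0 hN1
  set P : MCell := Function.update N 1 ((0, 0, 0) : BPoint) with hPdef
  have hP0 : P 0 = ray ((0, 0, 0) : BPoint) a 1 := by rw [hPdef, Function.update_of_ne (by decide), hN0]
  have hP1 : P 1 = ((0, 0, 0) : BPoint) := by rw [hPdef, Function.update_self]
  have hP2 : P 2 = ((h - 2, 0, 0) : BPoint) := by rw [hPdef, Function.update_of_ne (by decide), hN2]
  have hP3 : P 3 = ray ((h - 2, 0, 0) : BPoint) v 1 := by rw [hPdef, Function.update_of_ne (by decide), hN3]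
  obtain ⟨r, e, he, hN'⟩ := lower_mem_of_ceiling_apex hU (hS.1.2 P hP) h23.symm (t₀ := h - 2) (c₀ := 1) (t := h - 2) le_rfl (by ring)
    hP3 hP2 (by omega)
  set N' : MCell := Function.update P 2 (ray ((h - 2, 0, 0) : BPoint) r e) with hN'def
  have he1 : e = 1 := by
    have hx : InDiamond h (N' 2) := hU.1 N' hN' 2
    rw [hN'def, Function.update_self] at hx
    have := line_le_of_ray_inDiamond (by omega : (0 : ℤ) ≤ e) hx
    omega
  have hN'0 : N' 0 = ray ((0, 0, 0) : BPoint) a 1 := by rw [hN'def, Function.update_of_ne (by decide), hP0]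
  have hN'1 : N' 1 = ((0, 0, 0) : BPoint) := by rw [hN'def, Function.update_of_ne (by decide), hP1]
  have hN'2 : N' 2 = ray ((h - 2, 0, 0) : BPoint) r 1 := by rw [hN'def, Function.update_self, he1]
  have hN'3 : N' 3 = ray ((h - 2, 0, 0) : BPoint) v 1 := by rw [hN'def, Function.update_of_ne (by decide), hP3]
  exact no_lower_origin_unit_two_unit_ceilings hU hG hS hN' (s₀ := 1) (s₁ := 0) (s₂ := 2) (s₃ := 3)
    (by decide) (by decide) (by decide) (by decide) (by decide) (by decide) hN'1 hN'0 hN'2 hN'3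

/-- any-slot form of `no_lower_two_units_subapex_unitCeiling` (via `PermClosed`). -/
theorem no_lower_two_units_subapex_unitCeiling' {h : ℤ} {C : MConfig} (hU : C.InDiamond h) (hG : C.G1Closed) (hS : C.StaticH1)
    {N : MCell} (hN : N ∈ C.lower) {s₀ s₁ s₂ s₃ : Fin 4} (h01 : s₀ ≠ s₁) (h02 : s₀ ≠ s₂) (h03 : s₀ ≠ s₃)
    (h12 : s₁ ≠ s₂) (h13 : s₁ ≠ s₃) (h23 : s₂ ≠ s₃) {a b v : Fin 4}
    (hN0 : N s₀ = ray ((0, 0, 0) : BPoint) a 1) (hN1 : N s₁ = ray ((0, 0, 0) : BPoint) b 1)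
    (hN2 : N s₂ = ((h - 2, 0, 0) : BPoint)) (hN3 : N s₃ = ray ((h - 2, 0, 0) : BPoint) v 1) : False := by
  obtain ⟨σ, h0, h1, h2, h3⟩ := exists_perm_fin4 h01 h02 h03 h12 h13 h23
  have hNσ : MCell.perm σ N ∈ C.lower := hG.1 _ _ hN
  have hev : ∀ g, MCell.perm σ N g = N (σ g) := fun g => rfl
  exact no_lower_two_units_subapex_unitCeiling hU hG hS hNσ (by rw [hev, h0, hN0]) (by rw [hev, h1, hN1])
    (by rw [hev, h2, hN2]) (by rw [hev, h3, hN3])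

/-- **(L2, step) (PROVED, h-uniform)**: below `N = [O | 2ℓ_a | (h-2)I+ℓ_u | hI] ∈ E₋` the floor letter is discharged by exactly one unit — the full discharge … (doc: sketch §22) -/
theorem upper_origin_unit_of_lower_origin_twoFloor {h : ℤ} {C : MConfig} (hU : C.InDiamond h) (hG : C.G1Closed) (hS : C.StaticH1)
    {N : MCell} (hN : N ∈ C.lower) {a u : Fin 4}
    (hN0 : N 0 = ((0, 0, 0) : BPoint)) (hN1 : N 1 = ray ((0, 0, 0) : BPoint) a 2)
    (hN2 : N 2 = ray ((h - 2, 0, 0) : BPoint) u 1) (hN3 : N 3 = ((h, 0, 0) : BPoint)) :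
    Function.update N 1 (ray ((0, 0, 0) : BPoint) a 1) ∈ C.upper := by
  obtain ⟨e, he1, he2, hQ⟩ := upper_mem_of_origin_floor' hU (hS.1.1 N hN) (f₀ := 0) (f₁ := 1) (by decide) (c₁ := 2) (by norm_num) hN0 hN1
  rcases (show e = 1 ∨ e = 2 by omega) with rfl | rfl
  · have h21 : (2 : ℤ) - 1 = 1 := by norm_num
    rw [h21] at hQ
    exact hQ
  · exfalso
    set Q : MCell := Function.update N 1 (ray ((0, 0, 0) : BPoint) a (2 - 2)) with hQdef
    have hQ0 : Q 0 = ((0, 0, 0) : BPoint) := by rw [hQdef, Function.update_of_ne (by decide), hN0]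
    have hQ1 : Q 1 = ((0, 0, 0) : BPoint) := by rw [hQdef, Function.update_self, sub_self, ray_zero]
    have hQ2 : Q 2 = ray ((h - 2, 0, 0) : BPoint) u 1 := by rw [hQdef, Function.update_of_ne (by decide), hN2]
    have hQ3 : Q 3 = ((h, 0, 0) : BPoint) := by rw [hQdef, Function.update_of_ne (by decide), hN3]
    refine not_upper_apex_unit_top hU hG hS hQ (b := 2) (g₁ := 3) (by decide) hQ2 hQ3 fun g hg => ?_
    rcases fin4_cases g with rfl | rfl | rfl | rfl
    · rw [hQ0]
    · rw [hQ1]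
    · exact absurd rfl hg
    · rw [hQ3]

/-- **(L2) CLASS `P[O | 2ℓ_a | (h-2)I+ℓ_v | (h-2)I+ℓ_w] ∉ E₊`, `v ≠ w` (PROVED, h-uniform, every phase `a`, no induction hypothesis).** -/
theorem no_upper_origin_twoFloor_two_unit_ceilings {h : ℤ} {C : MConfig} (hU : C.InDiamond h) (hG : C.G1Closed) (hS : C.StaticH1)
    {P : MCell} (hP : P ∈ C.upper) {a v w : Fin 4} (hvw : v ≠ w)
    (hP0 : P 0 = ((0, 0, 0) : BPoint)) (hP1 : P 1 = ray ((0, 0, 0) : BPoint) a 2)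
    (hP2 : P 2 = ray ((h - 2, 0, 0) : BPoint) v 1) (hP3 : P 3 = ray ((h - 2, 0, 0) : BPoint) w 1) : False := by
  have hN₁ := lower_mem_of_unit_ceiling hU (hS.1.2 P hP) (f₀ := 2) (f₁ := 3) (by decide) (t₀ := h - 2) (c₀ := 1) le_rfl (by ring) hP2 hP3
  set N₁ : MCell := Function.update P 3 ((h, 0, 0) : BPoint) with hN₁def
  have hN₁0 : N₁ 0 = ((0, 0, 0) : BPoint) := by rw [hN₁def, Function.update_of_ne (by decide), hP0]
  have hN₁1 : N₁ 1 = ray ((0, 0, 0) : BPoint) a 2 := by rw [hN₁def, Function.update_of_ne (by decide), hP1]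
  have hN₁2 : N₁ 2 = ray ((h - 2, 0, 0) : BPoint) v 1 := by rw [hN₁def, Function.update_of_ne (by decide), hP2]
  have hN₁3 : N₁ 3 = ((h, 0, 0) : BPoint) := by rw [hN₁def, Function.update_self]
  have hN₂ := lower_mem_of_unit_ceiling hU (hS.1.2 P hP) (f₀ := 3) (f₁ := 2) (by decide) (t₀ := h - 2) (c₀ := 1) le_rfl (by ring) hP3 hP2
  set N₂ : MCell := Function.update P 2 ((h, 0, 0) : BPoint) with hN₂def
  have hM := hG.1 (Equiv.swap (2 : Fin 4) 3) _ hN₂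
  set M : MCell := MCell.perm (Equiv.swap (2 : Fin 4) 3) N₂ with hMdef
  have hev : ∀ g, M g = N₂ (Equiv.swap (2 : Fin 4) 3 g) := fun g => rfl
  have hs0 : Equiv.swap (2 : Fin 4) 3 0 = 0 := by decide
  have hs1 : Equiv.swap (2 : Fin 4) 3 1 = 1 := by decide
  have hs2 : Equiv.swap (2 : Fin 4) 3 2 = 3 := by decide
  have hs3 : Equiv.swap (2 : Fin 4) 3 3 = 2 := by decide
  have hM0 : M 0 = ((0, 0, 0) : BPoint) := by rw [hev, hs0, hN₂def, Function.update_of_ne (by decide), hP0]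
  have hM1 : M 1 = ray ((0, 0, 0) : BPoint) a 2 := by rw [hev, hs1, hN₂def, Function.update_of_ne (by decide), hP1]
  have hM2 : M 2 = ray ((h - 2, 0, 0) : BPoint) w 1 := by rw [hev, hs2, hN₂def, Function.update_of_ne (by decide), hP3]
  have hM3 : M 3 = ((h, 0, 0) : BPoint) := by rw [hev, hs3, hN₂def, Function.update_self]
  have hP' := upper_origin_unit_of_lower_origin_twoFloor hU hG hS hN₁ hN₁0 hN₁1 hN₁2 hN₁3
  set P' : MCell := Function.update N₁ 1 (ray ((0, 0, 0) : BPoint) a 1) with hP'def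
  have hP'0 : P' 0 = ((0, 0, 0) : BPoint) := by rw [hP'def, Function.update_of_ne (by decide), hN₁0]
  have hP'1 : P' 1 = ray ((0, 0, 0) : BPoint) a 1 := by rw [hP'def, Function.update_self]
  have hP'2 : P' 2 = ray ((h - 2, 0, 0) : BPoint) v 1 := by rw [hP'def, Function.update_of_ne (by decide), hN₁2]
  have hP'3 : P' 3 = ((h, 0, 0) : BPoint) := by rw [hP'def, Function.update_of_ne (by decide), hN₁3]
  have hP'' := upper_origin_unit_of_lower_origin_twoFloor hU hG hS hM hM0 hM1 hM2 hM3
  set P'' : MCell := Function.update M 1 (ray ((0, 0, 0) : BPoint) a 1) with hP''def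
  have hP''0 : P'' 0 = ((0, 0, 0) : BPoint) := by rw [hP''def, Function.update_of_ne (by decide), hM0]
  have hP''1 : P'' 1 = ray ((0, 0, 0) : BPoint) a 1 := by rw [hP''def, Function.update_self]
  have hP''2 : P'' 2 = ray ((h - 2, 0, 0) : BPoint) w 1 := by rw [hP''def, Function.update_of_ne (by decide), hM2]
  have hP''3 : P'' 3 = ((h, 0, 0) : BPoint) := by rw [hP''def, Function.update_of_ne (by decide), hM3]
  refine not_upper_unit_top_pair hU hS hP' (b := 2) (g₁ := 3) (by decide) hP'2 hP'3 hP'' (Ne.symm hvw) hP''2 fun g hg => ?_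
  rcases fin4_cases g with rfl | rfl | rfl | rfl
  · rw [hP''0, hP'0]
  · rw [hP''1, hP'1]
  · exact absurd rfl hg
  · rw [hP''3, hP'3]

/-- any-slot form of `no_upper_origin_twoFloor_two_unit_ceilings` (via `PermClosed`). -/
theorem no_upper_origin_twoFloor_two_unit_ceilings' {h : ℤ} {C : MConfig} (hU : C.InDiamond h) (hG : C.G1Closed) (hS : C.StaticH1)
    {P : MCell} (hP : P ∈ C.upper) {s₀ s₁ s₂ s₃ : Fin 4} (h01 : s₀ ≠ s₁) (h02 : s₀ ≠ s₂) (h03 : s₀ ≠ s₃)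
    (h12 : s₁ ≠ s₂) (h13 : s₁ ≠ s₃) (h23 : s₂ ≠ s₃) {a v w : Fin 4} (hvw : v ≠ w)
    (hP0 : P s₀ = ((0, 0, 0) : BPoint)) (hP1 : P s₁ = ray ((0, 0, 0) : BPoint) a 2)
    (hP2 : P s₂ = ray ((h - 2, 0, 0) : BPoint) v 1) (hP3 : P s₃ = ray ((h - 2, 0, 0) : BPoint) w 1) : False := by
  obtain ⟨σ, h0, h1, h2, h3⟩ := exists_perm_fin4 h01 h02 h03 h12 h13 h23
  have hPσ : MCell.perm σ P ∈ C.upper := hG.2.1 _ _ hP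
  have hev : ∀ g, MCell.perm σ P g = P (σ g) := fun g => rfl
  exact no_upper_origin_twoFloor_two_unit_ceilings hU hG hS hPσ hvw (by rw [hev, h0, hP0]) (by rw [hev, h1, hP1])
    (by rw [hev, h2, hP2]) (by rw [hev, h3, hP3])

/-- **(L3) INTERIOR-LETTER CLASS `N[O | 2I+ℓ_a | (h-2)I+ℓ_v | (h-2)I+ℓ_w] ∉ E₋`, `v ≠ w` (PROVED, h-uniform, every phase `a`, no induction hypothesis)** — (DN) the interior unit … (doc: sketch §22) -/
theorem no_lower_origin_i21_two_unit_ceilings {h : ℤ} {C : MConfig} (hU : C.InDiamond h) (hG : C.G1Closed) (hS : C.StaticH1)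
    {N : MCell} (hN : N ∈ C.lower) {a v w : Fin 4} (hvw : v ≠ w)
    (hN0 : N 0 = ((0, 0, 0) : BPoint)) (hN1 : N 1 = ray ((2, 0, 0) : BPoint) a 1)
    (hN2 : N 2 = ray ((h - 2, 0, 0) : BPoint) v 1) (hN3 : N 3 = ray ((h - 2, 0, 0) : BPoint) w 1) : False := by
  obtain ⟨d, hd, hdt, hP⟩ :=
    upper_mem_of_origin_node hU (hS.1.1 N hN) (f₀ := 0) (f₁ := 1) (by decide) (t₁ := 2) (c₁ := 1) le_rfl (by norm_num) hN0 hN1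
  have hd1 : d = 1 := by omega
  subst hd1
  set P : MCell := Function.update N 1 (ray ((2 - 2 * 1, 0, 0) : BPoint) a (1 + 1)) with hPdef
  have hP0 : P 0 = ((0, 0, 0) : BPoint) := by rw [hPdef, Function.update_of_ne (by decide), hN0]
  have hP1 : P 1 = ray ((0, 0, 0) : BPoint) a 2 := by rw [hPdef, Function.update_self]; norm_num
  have hP2 : P 2 = ray ((h - 2, 0, 0) : BPoint) v 1 := by rw [hPdef, Function.update_of_ne (by decide), hN2]
  have hP3 : P 3 = ray ((h - 2, 0, 0) : BPoint) w 1 := by rw [hPdef, Function.update_of_ne (by decide), hN3]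
  exact no_upper_origin_twoFloor_two_unit_ceilings hU hG hS hP hvw hP0 hP1 hP2 hP3

/-- any-slot form of `no_lower_origin_i21_two_unit_ceilings` (via `PermClosed`). -/
theorem no_lower_origin_i21_two_unit_ceilings' {h : ℤ} {C : MConfig} (hU : C.InDiamond h) (hG : C.G1Closed) (hS : C.StaticH1)
    {N : MCell} (hN : N ∈ C.lower) {s₀ s₁ s₂ s₃ : Fin 4} (h01 : s₀ ≠ s₁) (h02 : s₀ ≠ s₂) (h03 : s₀ ≠ s₃)
    (h12 : s₁ ≠ s₂) (h13 : s₁ ≠ s₃) (h23 : s₂ ≠ s₃) {a v w : Fin 4} (hvw : v ≠ w)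
    (hN0 : N s₀ = ((0, 0, 0) : BPoint)) (hN1 : N s₁ = ray ((2, 0, 0) : BPoint) a 1)
    (hN2 : N s₂ = ray ((h - 2, 0, 0) : BPoint) v 1) (hN3 : N s₃ = ray ((h - 2, 0, 0) : BPoint) w 1) : False := by
  obtain ⟨σ, h0, h1, h2, h3⟩ := exists_perm_fin4 h01 h02 h03 h12 h13 h23
  have hNσ : MCell.perm σ N ∈ C.lower := hG.1 _ _ hN
  have hev : ∀ g, MCell.perm σ N g = N (σ g) := fun g => rfl
  exact no_lower_origin_i21_two_unit_ceilings hU hG hS hNσ hvw (by rw [hev, h0, hN0]) (by rw [hev, h1, hN1])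
    (by rw [hev, h2, hN2]) (by rw [hev, h3, hN3])


/-! ### §B6 (v0.6, g12) THE `C2`-COLUMN CLASSES — `C2 = (h-4)I+2ℓ` beside a unit floor letter and `O` (PROVED ∀ h, no IH) — doc: sketch §22 (h)∕(k). -/

/-- (DP) under the TOP APEX `hI` (f₀): a charged ceiling letter `t₁·I + c₁·ℓ` on `f₁` is discharged by some `1 ≤ e ≤ c₁` (the unit case is
`lower_mem_of_unit_top`). -/
theorem lower_mem_of_top_ceiling' {h : ℤ} {C : MConfig} (hU : C.InDiamond h) {P : MCell} (hD : RuleDMu4P C P)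
    {f₀ f₁ k₁ : Fin 4} (hf : f₀ ≠ f₁) {t₁ c₁ : ℤ} (hc₁ : 1 ≤ c₁) (hh₁ : t₁ + 2 * c₁ = h)
    (h0 : P f₀ = ((h, 0, 0) : BPoint)) (h1 : P f₁ = ray ((t₁, 0, 0) : BPoint) k₁ c₁) :
    ∃ e, 1 ≤ e ∧ e ≤ c₁ ∧ Function.update P f₁ (ray ((t₁ + 2 * e, 0, 0) : BPoint) k₁ (c₁ - e)) ∈ C.lower := by
  have hne : coord (P f₁) (k₁ + 2) ≠ h := by rw [h1, coord_ray_apex_antip]; omega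
  obtain ⟨r, -, N, hN, hagree, hlt, hray⟩ :=
    settledAbove_of_top hU hD h0 (Ne.symm hf) (by rw [h1]; exact adapted_ray_apex_antip t₁ c₁ k₁) hne
  have hy : InDiamond h (ray (P f₁) r ((N f₁).1 - (P f₁).1)) := by rw [← hray]; exact hU.1 N hN f₁
  rw [h1] at hy hlt
  have he : 0 < (N f₁).1 - (ray ((t₁, 0, 0) : BPoint) k₁ c₁).1 := by simp at hlt ⊢; omega
  obtain ⟨-, hle, hpt⟩ := ceiling_move hc₁ hh₁ he hy
  refine ⟨(N f₁).1 - (ray ((t₁, 0, 0) : BPoint) k₁ c₁).1, by omega, hle, ?_⟩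
  have hNeq : N = Function.update P f₁ (ray ((t₁ + 2 * ((N f₁).1 - (ray ((t₁, 0, 0) : BPoint) k₁ c₁).1), 0, 0) : BPoint) k₁
      (c₁ - ((N f₁).1 - (ray ((t₁, 0, 0) : BPoint) k₁ c₁).1))) := by
    funext g
    by_cases hg : g = f₁
    · subst hg; rw [Function.update_self, ← hpt, ← h1]; nth_rewrite 1 [hray]; rw [h1]
    · rw [Function.update_of_ne hg]; exact (hagree g hg).symm
  rw [← hNeq]; exact hN

/-- thin column one step early: `[ℓ_a | O | (h-2)I+ℓ_w | hI] ∉ E₋` ((DN) `ℓ_a ↦ O`, then (K1′)). -/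
theorem not_lower_unit_origin_unitCeiling_top {h : ℤ} {C : MConfig} (hU : C.InDiamond h) (hG : C.G1Closed) (hS : C.StaticH1)
    {N : MCell} (hN : N ∈ C.lower) {a w : Fin 4} (hN0 : N 0 = ray ((0, 0, 0) : BPoint) a 1) (hN1 : N 1 = ((0, 0, 0) : BPoint))
    (hN2 : N 2 = ray ((h - 2, 0, 0) : BPoint) w 1) (hN3 : N 3 = ((h, 0, 0) : BPoint)) : False := by
  have hQ := upper_mem_of_unit_origin hU (hS.1.1 N hN) (f₀ := 1) (f₁ := 0) (by decide) hN1 hN0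
  refine not_upper_apex_unit_top hU hG hS hQ (b := 2) (g₁ := 3) (by decide) (by rw [Function.update_of_ne (by decide), hN2])
    (by rw [Function.update_of_ne (by decide), hN3]) fun g hg => ?_
  rcases fin4_cases g with rfl | rfl | rfl | rfl
  · rw [Function.update_self]
  · rw [Function.update_of_ne (by decide), hN1]
  · exact absurd rfl hg
  · rw [Function.update_of_ne (by decide), hN3]

/-! ### §B6.0 (v1.0, g12) CHARGE INDUCTION ON THE CEILING SHELL AND ON A COLUMN (PROVED ∀ h, all charges, all phases) — doc: sketch §22 (h)∕(k). -/

/-- `A2I⁻` SELF-STEP for a unit floor letter (PROVED, h-uniform, any slots): `Z ∈ E₋`, `Z b = ℓ_a`, `Z o = O` ⇒ the cell with the two letters exchanged lies in `E₊` … (doc: sketch §22) -/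
theorem upper_swap_of_lower_unitFloor_origin {h : ℤ} {C : MConfig} (hU : C.InDiamond h) (hG : C.G1Closed) (hS : C.StaticH1)
    {Z : MCell} (hZ : Z ∈ C.lower) {b o a : Fin 4} (hob : o ≠ b) (hZb : Z b = ray ((0, 0, 0) : BPoint) a 1)
    (hZo : Z o = ((0, 0, 0) : BPoint)) :
    Function.update (Function.update Z b ((0, 0, 0) : BPoint)) o (ray ((0, 0, 0) : BPoint) a 1) ∈ C.upper := by
  by_contra hP
  have hq := upper_mem_of_unit_origin hU (hS.1.1 Z hZ) hob hZo hZb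
  have hev : ∀ g, MCell.perm (Equiv.swap b o) Z g = Z (Equiv.swap b o g) := fun g => rfl
  refine aminus_floor_origin_fires_cells hU hS hZ hob (c := 1) le_rfl hZb hZo hq (fun d hd hdc _ => by omega)
    (hG.1 (Equiv.swap b o) Z hZ) (v := a) ⟨fun g hg => ?_, ?_, ?_⟩ fun e he hele hP' => ?_
  · by_cases hgb : g = b
    · subst hgb; rw [Function.update_self, hev, Equiv.swap_apply_left, hZo]
    · rw [Function.update_of_ne hgb, hev, Equiv.swap_apply_of_ne_of_ne hgb hg]
  · rw [Function.update_of_ne hob, hZo, hev, Equiv.swap_apply_right, hZb]; simp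
  · rw [Function.update_of_ne hob, hZo, hev, Equiv.swap_apply_right, hZb]; simp
  · rw [hev, Equiv.swap_apply_right, hZb] at hele
    simp at hele
    obtain rfl : e = 1 := by omega
    exact hP hP'

/-- slots-(0,1) form of the self-step: `N = [O | ℓ_a | x | y] ∈ E₋` ⇒ some `P = [O | ℓ_a | x | y] ∈ E₊` (same letters). -/
theorem upper_of_lower_origin_unitFloor {h : ℤ} {C : MConfig} (hU : C.InDiamond h) (hG : C.G1Closed) (hS : C.StaticH1)
    {N : MCell} (hN : N ∈ C.lower) {a : Fin 4} (hN0 : N 0 = ((0, 0, 0) : BPoint)) (hN1 : N 1 = ray ((0, 0, 0) : BPoint) a 1) :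
    ∃ P ∈ C.upper, P 0 = ((0, 0, 0) : BPoint) ∧ P 1 = ray ((0, 0, 0) : BPoint) a 1 ∧ P 2 = N 2 ∧ P 3 = N 3 := by
  have hU' := upper_swap_of_lower_unitFloor_origin hU hG hS hN (b := 1) (o := 0) (by decide) hN1 hN0
  refine ⟨_, hG.2.1 (Equiv.swap (0 : Fin 4) 1) _ hU', ?_, ?_, ?_, ?_⟩ <;>
    simp only [MCell.perm, Equiv.swap_apply_left, Equiv.swap_apply_right, Equiv.swap_apply_of_ne_of_ne, Fin.isValue,
      Function.update_self, Function.update_of_ne, ne_eq, Fin.reduceEq, not_false_eq_true]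

/-- **(L9) CEILING-SHELL DESCENT (PROVED ∀ h, every charge `c ≥ 1`, all phases): `P[O | ℓ_a | (h-2c)I+cℓ_b | (h-2)I+ℓ_v] ∉ E₊`.** (DP) `C_c ↦ C_{c-e}` against `C1_v`; `e = c` … (doc: sketch §22) -/
theorem no_upper_origin_unit_ceilingCharge_unitCeiling {h : ℤ} {C : MConfig} (hU : C.InDiamond h) (hG : C.G1Closed) (hS : C.StaticH1)
    {P : MCell} (hP : P ∈ C.upper) {a b v : Fin 4} {c : ℤ} (hc : 1 ≤ c)
    (hP0 : P 0 = ((0, 0, 0) : BPoint)) (hP1 : P 1 = ray ((0, 0, 0) : BPoint) a 1)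
    (hP2 : P 2 = ray ((h - 2 * c, 0, 0) : BPoint) b c) (hP3 : P 3 = ray ((h - 2, 0, 0) : BPoint) v 1) : False := by
  obtain ⟨n, hn⟩ : ∃ n : ℕ, c ≤ n := ⟨c.toNat, Int.self_le_toNat c⟩
  induction n generalizing c P with
  | zero => omega
  | succ n ih =>
    obtain ⟨e, he1, hec, hM⟩ := lower_mem_of_two_ceiling' hU (hS.1.2 P hP) (f₀ := 3) (f₁ := 2) (by decide) (c₀ := 1) le_rfl
      (by ring) hc (t₁ := h - 2 * c) (by ring) hP3 hP2
    rcases lt_or_eq_of_le hec with hlt | rfl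
    · obtain ⟨P', hP', h0, h1, h2, h3⟩ := upper_of_lower_origin_unitFloor hU hG hS hM (a := a)
        (by rw [Function.update_of_ne (by decide), hP0]) (by rw [Function.update_of_ne (by decide), hP1])
      exact ih hP' (c := c - e) (by omega) h0 h1 (by rw [h2, Function.update_self, show h - 2 * c + 2 * e = h - 2 * (c - e) by ring])
        (by rw [h3, Function.update_of_ne (by decide), hP3]) (by omega)
    · rw [sub_self, ray_zero, show h - 2 * e + 2 * e = h by ring] at hM
      obtain ⟨σ, h0, h1, h2, h3⟩ := exists_perm_fin4 (s₀ := (1 : Fin 4)) (s₁ := 0) (s₂ := 3) (s₃ := 2) (by decide) (by decide)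
        (by decide) (by decide) (by decide) (by decide)
      have hev : ∀ g, MCell.perm σ (Function.update P 2 ((h, 0, 0) : BPoint)) g = Function.update P 2 ((h, 0, 0) : BPoint) (σ g) :=
        fun g => rfl
      exact not_lower_unit_origin_unitCeiling_top hU hG hS (hG.1 σ _ hM) (a := a) (w := v)
        (by rw [hev, h0, Function.update_of_ne (by decide), hP1]) (by rw [hev, h1, Function.update_of_ne (by decide), hP0])
        (by rw [hev, h2, Function.update_of_ne (by decide), hP3]) (by rw [hev, h3, Function.update_self])

/-- **(L10) COLUMN CLIMB (PROVED ∀ h, all `t`, `c ≥ 1` with `t + 2c ≤ h`, all phases): `P[O | ℓ_a | tI+cℓ_b | (h-2)I+ℓ_v] ∉ E₊`.** On the ceiling (`t + 2c = h`) this is (L9); … (doc: sketch §22) -/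
theorem no_upper_origin_unit_column_unitCeiling {h : ℤ} {C : MConfig} (hU : C.InDiamond h) (hG : C.G1Closed) (hS : C.StaticH1)
    {P : MCell} (hP : P ∈ C.upper) {a b v : Fin 4} {t c : ℤ} (hc : 1 ≤ c) (hth : t + 2 * c ≤ h)
    (hP0 : P 0 = ((0, 0, 0) : BPoint)) (hP1 : P 1 = ray ((0, 0, 0) : BPoint) a 1)
    (hP2 : P 2 = ray ((t, 0, 0) : BPoint) b c) (hP3 : P 3 = ray ((h - 2, 0, 0) : BPoint) v 1) : False := by
  obtain ⟨n, hn⟩ : ∃ n : ℕ, h - t - 2 * c ≤ n := ⟨(h - t - 2 * c).toNat, Int.self_le_toNat _⟩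
  induction n generalizing c P with
  | zero =>
    exact no_upper_origin_unit_ceilingCharge_unitCeiling hU hG hS hP hc hP0 hP1 (by rw [hP2, show t = h - 2 * c by omega]) hP3
  | succ n ih =>
    rcases eq_or_lt_of_le hth with heq | hlt
    · exact no_upper_origin_unit_ceilingCharge_unitCeiling hU hG hS hP hc hP0 hP1 (by rw [hP2, show t = h - 2 * c by omega]) hP3
    obtain ⟨e, he1, hle, hN⟩ := lower_mem_of_ceiling_line hU (hS.1.2 P hP) (f₀ := 3) (y := 2) (by decide) (c₀ := 1) le_rfl
      (by ring) hc hlt hP3 hP2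
    obtain ⟨P', hP', h0, h1, h2, h3⟩ := upper_of_lower_origin_unitFloor hU hG hS hN (a := a)
      (by rw [Function.update_of_ne (by decide), hP0]) (by rw [Function.update_of_ne (by decide), hP1])
    exact ih hP' (c := c + e) (by omega) (by omega) h0 h1 (by rw [h2, Function.update_self])
      (by rw [h3, Function.update_of_ne (by decide), hP3]) (by omega)

/-- (L9∕L10-N) `N[O | ℓ_a | tI+cℓ_b | (h-2)I+ℓ_v] ∉ E₋` for all `t`, `c ≥ 1`, `t + 2c ≤ h` (the `A2I⁻` self-step, then (L10)). -/
theorem no_lower_origin_unit_column_unitCeiling {h : ℤ} {C : MConfig} (hU : C.InDiamond h) (hG : C.G1Closed) (hS : C.StaticH1)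
    {N : MCell} (hN : N ∈ C.lower) {a b v : Fin 4} {t c : ℤ} (hc : 1 ≤ c) (hth : t + 2 * c ≤ h)
    (hN0 : N 0 = ((0, 0, 0) : BPoint)) (hN1 : N 1 = ray ((0, 0, 0) : BPoint) a 1)
    (hN2 : N 2 = ray ((t, 0, 0) : BPoint) b c) (hN3 : N 3 = ray ((h - 2, 0, 0) : BPoint) v 1) : False := by
  obtain ⟨P, hP, h0, h1, h2, h3⟩ := upper_of_lower_origin_unitFloor hU hG hS hN hN0 hN1
  exact no_upper_origin_unit_column_unitCeiling hU hG hS hP hc hth h0 h1 (h2.trans hN2) (h3.trans hN3)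

/-- **(L4) CLASS `P[O | ℓ_a | (h-4)I+2ℓ_b | (h-2)I+ℓ_v] ∉ E₊` (PROVED, h-uniform, all phases, any slots)**: (DP) `C2 ↦ C1` is (R1-N₀), `C2 ↦ hI` then (DN) `ℓ_a ↦ O` is the thin … (doc: sketch §22) -/
theorem no_upper_origin_unit_twoCeiling_unitCeiling {h : ℤ} {C : MConfig} (hU : C.InDiamond h) (hG : C.G1Closed) (hS : C.StaticH1)
    {P : MCell} (hP : P ∈ C.upper) {s₀ s₁ s₂ s₃ : Fin 4} (h01 : s₀ ≠ s₁) (h02 : s₀ ≠ s₂) (h03 : s₀ ≠ s₃)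
    (h12 : s₁ ≠ s₂) (h13 : s₁ ≠ s₃) (h23 : s₂ ≠ s₃) {a b v : Fin 4}
    (hP0 : P s₀ = ((0, 0, 0) : BPoint)) (hP1 : P s₁ = ray ((0, 0, 0) : BPoint) a 1)
    (hP2 : P s₂ = ray ((h - 4, 0, 0) : BPoint) b 2) (hP3 : P s₃ = ray ((h - 2, 0, 0) : BPoint) v 1) : False := by
  obtain ⟨σ, h0, h1, h2, h3⟩ := exists_perm_fin4 h01 h02 h03 h12 h13 h23
  have hev : ∀ g, MCell.perm σ P g = P (σ g) := fun g => rfl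
  exact no_upper_origin_unit_column_unitCeiling hU hG hS (hG.2.1 σ P hP) (t := h - 4) (c := 2) (by norm_num) (by omega)
    (by rw [hev, h0, hP0]) (by rw [hev, h1, hP1]) (by rw [hev, h2, hP2]) (by rw [hev, h3, hP3])

/-- **(L4-N) CLASS `N[O | ℓ_a | (h-4)I+2ℓ_b | (h-2)I+ℓ_v] ∉ E₋` (PROVED, h-uniform, all phases, any slots)**: `A2I⁻` self-step, then (L4). -/
theorem no_lower_origin_unit_twoCeiling_unitCeiling {h : ℤ} {C : MConfig} (hU : C.InDiamond h) (hG : C.G1Closed) (hS : C.StaticH1)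
    {Z : MCell} (hZ : Z ∈ C.lower) {s₀ s₁ s₂ s₃ : Fin 4} (h01 : s₀ ≠ s₁) (h02 : s₀ ≠ s₂) (h03 : s₀ ≠ s₃)
    (h12 : s₁ ≠ s₂) (h13 : s₁ ≠ s₃) (h23 : s₂ ≠ s₃) {a b v : Fin 4}
    (hZ0 : Z s₀ = ((0, 0, 0) : BPoint)) (hZ1 : Z s₁ = ray ((0, 0, 0) : BPoint) a 1)
    (hZ2 : Z s₂ = ray ((h - 4, 0, 0) : BPoint) b 2) (hZ3 : Z s₃ = ray ((h - 2, 0, 0) : BPoint) v 1) : False := by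
  refine not_lower_unit_origin hU hG hS hZ h01 hZ1 hZ0 fun P hP hPo hPb hPg => ?_
  exact no_upper_origin_unit_twoCeiling_unitCeiling hU hG hS hP h01.symm h12 h13 h02 h03 h23 hPb hPo
    (by rw [hPg s₂ h12.symm h02.symm, hZ2]) (by rw [hPg s₃ h13.symm h03.symm, hZ3])

/-- **PHASE UNIQUENESS AT A `C2` LETTER OVER A THIN BASE (PROVED, h-uniform)**: `Q = [ℓ_a | O | (h-4)I+2ℓ_b | hI]` and a `Q′ ∈ E₊` agreeing with `Q` off slot `2` with … (doc: sketch §22) -/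
theorem not_upper_unit_origin_twoCeiling_top_pair {h : ℤ} {C : MConfig} (hU : C.InDiamond h) (hG : C.G1Closed) (hS : C.StaticH1)
    {Q : MCell} (hQ : Q ∈ C.upper) {a b c : Fin 4} (hbc : b ≠ c) (hQ0 : Q 0 = ray ((0, 0, 0) : BPoint) a 1)
    (hQ1 : Q 1 = ((0, 0, 0) : BPoint)) (hQ2 : Q 2 = ray ((h - 4, 0, 0) : BPoint) b 2) (hQ3 : Q 3 = ((h, 0, 0) : BPoint))
    {Q' : MCell} (hQ' : Q' ∈ C.upper) (hQ'2 : Q' 2 = ray ((h - 4, 0, 0) : BPoint) c 2) (hQ'g : ∀ g, g ≠ 2 → Q' g = Q g) :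
    False := by
  have thin : ∀ w : Fin 4, Function.update Q 2 (ray ((h - 2, 0, 0) : BPoint) w 1) ∉ C.lower := fun w hN =>
    not_lower_unit_origin_unitCeiling_top hU hG hS hN (by rw [Function.update_of_ne (by decide), hQ0])
      (by rw [Function.update_of_ne (by decide), hQ1]) (Function.update_self ..) (by rw [Function.update_of_ne (by decide), hQ3])
  obtain ⟨e, he1, he2, hN₀⟩ := lower_mem_of_top_ceiling' hU (hS.1.2 Q hQ) (f₀ := 3) (f₁ := 2) (by decide) (t₁ := h - 4) (c₁ := 2)
    (by norm_num) (by ring) hQ3 hQ2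
  rcases (show e = 1 ∨ e = 2 by omega) with rfl | rfl
  · rw [(by ring : h - 4 + 2 * 1 = h - 2), (by norm_num : (2 : ℤ) - 1 = 1)] at hN₀
    exact thin b hN₀
  rw [(by ring : h - 4 + 2 * 2 = h), sub_self, ray_zero] at hN₀
  have hfst : (ray ((h - 4, 0, 0) : BPoint) c 2).1 = h - 2 := by rw [ray_fst]; ring
  refine xplus_top_fires_topslot_cells hU hS hQ (b := 2) (f := 3) (by decide) (t := h - 4) (c := 2) (by norm_num) (by ring) hQ2 hQ3 hN₀
    (fun e he1 he2 hN => ?_) hQ' (r := c + 2) (fun heq => hbc (add_right_cancel heq).symm)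
    ⟨fun g hg => by rw [Function.update_of_ne hg]; exact hQ'g g hg, ?_, ?_⟩ fun d hd hdh hN => ?_
  · obtain rfl : e = 1 := by omega
    rw [(by ring : h - 4 + 2 * 1 = h - 2), (by norm_num : (2 : ℤ) - 1 = 1)] at hN
    exact thin b hN
  · rw [Function.update_self, hQ'2, hfst]; simp
  · rw [Function.update_self, hQ'2, hfst, (by ring : h - (h - 2) = 2)]
    exact top_eq_ray_ceiling (by ring) c
  · rw [hQ'2, hfst] at hdh
    obtain rfl : d = 1 := by omega
    rw [hQ'2, ray_ray_antip, (by ring : h - 4 + 2 * 1 = h - 2), (by norm_num : (2 : ℤ) - 1 = 1)] at hN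
    exact thin c hN

/-- (L5, step) `P[O | ℓ_a | C2_b | C2_c] ∈ E₊ ⇒ P(3 ↦ hI) ∈ E₋` (the discharge `C2_c ↦ C1_c` is (L4-N)-dead). -/
theorem lower_top_of_upper_origin_unit_two_twoCeilings {h : ℤ} {C : MConfig} (hU : C.InDiamond h) (hG : C.G1Closed) (hS : C.StaticH1)
    {P : MCell} (hP : P ∈ C.upper) {a b c : Fin 4}
    (hP0 : P 0 = ((0, 0, 0) : BPoint)) (hP1 : P 1 = ray ((0, 0, 0) : BPoint) a 1)
    (hP2 : P 2 = ray ((h - 4, 0, 0) : BPoint) b 2) (hP3 : P 3 = ray ((h - 4, 0, 0) : BPoint) c 2) :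
    Function.update P 3 ((h, 0, 0) : BPoint) ∈ C.lower := by
  obtain ⟨e, he1, he2, hN⟩ := lower_mem_of_two_ceiling' hU (hS.1.2 P hP) (f₀ := 2) (f₁ := 3) (by decide) (t₀ := h - 4) (c₀ := 2)
    (t₁ := h - 4) (c₁ := 2) (by norm_num) (by ring) (by norm_num) (by ring) hP2 hP3
  rcases (show e = 1 ∨ e = 2 by omega) with rfl | rfl
  · rw [(by ring : h - 4 + 2 * 1 = h - 2), (by norm_num : (2 : ℤ) - 1 = 1)] at hN
    exact absurd (no_lower_origin_unit_twoCeiling_unitCeiling hU hG hS hN (s₀ := 0) (s₁ := 1) (s₂ := 2) (s₃ := 3) (by decide) (by decide)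
      (by decide) (by decide) (by decide) (by decide) (by rw [Function.update_of_ne (by decide), hP0])
      (by rw [Function.update_of_ne (by decide), hP1]) (by rw [Function.update_of_ne (by decide), hP2]) (Function.update_self ..)) not_false
  · rw [(by ring : h - 4 + 2 * 2 = h), sub_self, ray_zero] at hN
    exact hN

/-- **(L5) CLASS `P[O | ℓ_a | (h-4)I+2ℓ_b | (h-4)I+2ℓ_c] ∉ E₊`, `b ≠ c` (PROVED, h-uniform, every `a`, no IH)**: both full discharges are present (L5, step); the `A2I⁻` … (doc: sketch §22) -/
theorem no_upper_origin_unit_two_twoCeilings {h : ℤ} {C : MConfig} (hU : C.InDiamond h) (hG : C.G1Closed) (hS : C.StaticH1)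
    {P : MCell} (hP : P ∈ C.upper) {a b c : Fin 4} (hbc : b ≠ c)
    (hP0 : P 0 = ((0, 0, 0) : BPoint)) (hP1 : P 1 = ray ((0, 0, 0) : BPoint) a 1)
    (hP2 : P 2 = ray ((h - 4, 0, 0) : BPoint) b 2) (hP3 : P 3 = ray ((h - 4, 0, 0) : BPoint) c 2) : False := by
  have hNb := lower_top_of_upper_origin_unit_two_twoCeilings hU hG hS hP hP0 hP1 hP2 hP3
  have hPσ : MCell.perm (Equiv.swap (2 : Fin 4) 3) P ∈ C.upper := hG.2.1 _ _ hP
  have hev : ∀ g, MCell.perm (Equiv.swap (2 : Fin 4) 3) P g = P (Equiv.swap (2 : Fin 4) 3 g) := fun g => rfl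
  have hNc := lower_top_of_upper_origin_unit_two_twoCeilings hU hG hS hPσ
    (by rw [hev, Equiv.swap_apply_of_ne_of_ne (by decide) (by decide), hP0])
    (by rw [hev, Equiv.swap_apply_of_ne_of_ne (by decide) (by decide), hP1])
    (by rw [hev, Equiv.swap_apply_left, hP3]) (by rw [hev, Equiv.swap_apply_right, hP2])
  refine not_lower_unit_origin hU hG hS hNb (b := 1) (o := 0) (by decide) (by rw [Function.update_of_ne (by decide), hP1])
    (by rw [Function.update_of_ne (by decide), hP0]) fun Q hQ hQ0 hQ1 hQg => ?_
  have hQ2 : Q 2 = ray ((h - 4, 0, 0) : BPoint) b 2 := by rw [hQg 2 (by decide) (by decide), Function.update_of_ne (by decide), hP2]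
  have hQ3 : Q 3 = ((h, 0, 0) : BPoint) := by rw [hQg 3 (by decide) (by decide), Function.update_self]
  refine not_lower_unit_origin hU hG hS hNc (b := 1) (o := 0) (by decide)
    (by rw [Function.update_of_ne (by decide), hev, Equiv.swap_apply_of_ne_of_ne (by decide) (by decide), hP1])
    (by rw [Function.update_of_ne (by decide), hev, Equiv.swap_apply_of_ne_of_ne (by decide) (by decide), hP0]) fun Q' hQ' hQ'0 hQ'1 hQ'g => ?_
  have hQ'2 : Q' 2 = ray ((h - 4, 0, 0) : BPoint) c 2 := by
    rw [hQ'g 2 (by decide) (by decide), Function.update_of_ne (by decide), hev, Equiv.swap_apply_left, hP3]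
  have hQ'3 : Q' 3 = ((h, 0, 0) : BPoint) := by rw [hQ'g 3 (by decide) (by decide), Function.update_self]
  exact not_upper_unit_origin_twoCeiling_top_pair hU hG hS hQ hbc hQ0 hQ1 hQ2 hQ3 hQ' hQ'2 fun g hg => by
    rcases fin4_cases g with rfl | rfl | rfl | rfl
    · rw [hQ'0, hQ0]
    · rw [hQ'1, hQ1]
    · exact absurd rfl hg
    · rw [hQ'3, hQ3]

/-- (L5), any slots. -/
theorem no_upper_origin_unit_two_twoCeilings' {h : ℤ} {C : MConfig} (hU : C.InDiamond h) (hG : C.G1Closed) (hS : C.StaticH1)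
    {P : MCell} (hP : P ∈ C.upper) {s₀ s₁ s₂ s₃ : Fin 4} (h01 : s₀ ≠ s₁) (h02 : s₀ ≠ s₂) (h03 : s₀ ≠ s₃)
    (h12 : s₁ ≠ s₂) (h13 : s₁ ≠ s₃) (h23 : s₂ ≠ s₃) {a b c : Fin 4} (hbc : b ≠ c)
    (hP0 : P s₀ = ((0, 0, 0) : BPoint)) (hP1 : P s₁ = ray ((0, 0, 0) : BPoint) a 1)
    (hP2 : P s₂ = ray ((h - 4, 0, 0) : BPoint) b 2) (hP3 : P s₃ = ray ((h - 4, 0, 0) : BPoint) c 2) : False := by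
  obtain ⟨σ, h0, h1, h2, h3⟩ := exists_perm_fin4 h01 h02 h03 h12 h13 h23
  have hev : ∀ g, MCell.perm σ P g = P (σ g) := fun g => rfl
  exact no_upper_origin_unit_two_twoCeilings hU hG hS (hG.2.1 _ _ hP) hbc (by rw [hev, h0, hP0]) (by rw [hev, h1, hP1])
    (by rw [hev, h2, hP2]) (by rw [hev, h3, hP3])

/-- **(L5-N) CLASS `N[O | ℓ_a | (h-4)I+2ℓ_b | (h-4)I+2ℓ_c] ∉ E₋`, `b ≠ c` (PROVED, h-uniform, any slots)**: `A2I⁻` self-step, then (L5). -/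
theorem no_lower_origin_unit_two_twoCeilings {h : ℤ} {C : MConfig} (hU : C.InDiamond h) (hG : C.G1Closed) (hS : C.StaticH1)
    {Z : MCell} (hZ : Z ∈ C.lower) {s₀ s₁ s₂ s₃ : Fin 4} (h01 : s₀ ≠ s₁) (h02 : s₀ ≠ s₂) (h03 : s₀ ≠ s₃)
    (h12 : s₁ ≠ s₂) (h13 : s₁ ≠ s₃) (h23 : s₂ ≠ s₃) {a b c : Fin 4} (hbc : b ≠ c)
    (hZ0 : Z s₀ = ((0, 0, 0) : BPoint)) (hZ1 : Z s₁ = ray ((0, 0, 0) : BPoint) a 1)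
    (hZ2 : Z s₂ = ray ((h - 4, 0, 0) : BPoint) b 2) (hZ3 : Z s₃ = ray ((h - 4, 0, 0) : BPoint) c 2) : False := by
  refine not_lower_unit_origin hU hG hS hZ h01 hZ1 hZ0 fun P hP hPo hPb hPg => ?_
  exact no_upper_origin_unit_two_twoCeilings' hU hG hS hP h01.symm h12 h13 h02 h03 h23 hbc hPb hPo
    (by rw [hPg s₂ h12.symm h02.symm, hZ2]) (by rw [hPg s₃ h13.symm h03.symm, hZ3])

/-- **(L6) CLASS `N[ℓ_a | ℓ_b | (h-4)I+2ℓ_c | hI] ∉ E₋` for `a ≠ b` (PROVED, h-uniform, every `c`, no IH; M24 class `N T F1 F1 C2`, the 6 distinct-phase orbits; the `C2`-analogue … (doc: sketch §22) -/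
theorem no_lower_two_units_twoCeiling_top {h : ℤ} {C : MConfig} (hU : C.InDiamond h) (hG : C.G1Closed) (hS : C.StaticH1)
    {Z : MCell} (hZ : Z ∈ C.lower) {a b c : Fin 4} (hab : a ≠ b)
    (hZ0 : Z 0 = ray ((0, 0, 0) : BPoint) a 1) (hZ1 : Z 1 = ray ((0, 0, 0) : BPoint) b 1)
    (hZ2 : Z 2 = ray ((h - 4, 0, 0) : BPoint) c 2) (hZ3 : Z 3 = ((h, 0, 0) : BPoint)) : False := by
  have hQ := upper_mem_of_unit_floor hU (hS.1.1 Z hZ) (f₀ := 0) (f₁ := 1) (by decide) (c₀ := 1) le_rfl hZ0 hZ1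
  set m : Fin 4 := 3 * (a - b) with hmdef
  have hZ' := delta_iter_mem_lower hG m.val hZ
  set Z' : MCell := fun f => deltaPt^[m.val] (Z f) with hZ'def
  have hZ'0 : Z' 0 = ray ((0, 0, 0) : BPoint) (a + 3 * m) 1 := by show deltaPt^[m.val] (Z 0) = _; rw [hZ0, deltaPt_iter_ray_apex]
  have hZ'1 : Z' 1 = ray ((0, 0, 0) : BPoint) a 1 := by show deltaPt^[m.val] (Z 1) = _; rw [hZ1, deltaPt_iter_ray_apex, hmdef, rot_phase]
  have hZ'2 : Z' 2 = ray ((h - 4, 0, 0) : BPoint) (c + 3 * m) 2 := by show deltaPt^[m.val] (Z 2) = _; rw [hZ2, deltaPt_iter_ray_apex]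
  have hZ'3 : Z' 3 = ((h, 0, 0) : BPoint) := by show deltaPt^[m.val] (Z 3) = _; rw [hZ3, deltaPt_iter_apex]
  have hQ₂ := upper_mem_of_unit_floor hU (hS.1.1 Z' hZ') (f₀ := 1) (f₁ := 0) (by decide) (c₀ := 1) le_rfl hZ'1 hZ'0
  have hev : ∀ g, MCell.perm (Equiv.swap (0 : Fin 4) 1) (Function.update Z' 0 ((0, 0, 0) : BPoint)) g =
      Function.update Z' 0 ((0, 0, 0) : BPoint) (Equiv.swap (0 : Fin 4) 1 g) := fun g => rfl
  refine not_upper_unit_origin_twoCeiling_top_pair hU hG hS hQ (b := c) (c := c + 3 * m) (rot_ne hab.symm c).symm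
    (by rw [Function.update_of_ne (by decide), hZ0]) (Function.update_self ..) (by rw [Function.update_of_ne (by decide), hZ2])
    (by rw [Function.update_of_ne (by decide), hZ3]) (hG.2.1 (Equiv.swap (0 : Fin 4) 1) _ hQ₂)
    (by rw [hev, Equiv.swap_apply_of_ne_of_ne (by decide) (by decide), Function.update_of_ne (by decide), hZ'2]) fun g hg => ?_
  rcases fin4_cases g with rfl | rfl | rfl | rfl
  · rw [hev, Equiv.swap_apply_left, Function.update_of_ne (by decide), hZ'1, Function.update_of_ne (by decide), hZ0]
  · rw [hev, Equiv.swap_apply_right, Function.update_self, Function.update_self]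
  · exact absurd rfl hg
  · rw [hev, Equiv.swap_apply_of_ne_of_ne (by decide) (by decide), Function.update_of_ne (by decide), hZ'3,
      Function.update_of_ne (by decide), hZ3]

/-- **(L7) CLASS `N[O | 2ℓ_a | (h-2)I+ℓ_v | (h-2)I+ℓ_w] ∉ E₋`, `v ≠ w` (PROVED, h-uniform, every `a`, no IH; M24 class `N O F2 C1 C1`, the `E₋`-sibling of (L2))**: the partial … (doc: sketch §22) -/
theorem no_lower_origin_twoFloor_two_unit_ceilings {h : ℤ} {C : MConfig} (hU : C.InDiamond h) (hG : C.G1Closed) (hS : C.StaticH1)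
    {N : MCell} (hN : N ∈ C.lower) {a v w : Fin 4} (hvw : v ≠ w)
    (hN0 : N 0 = ((0, 0, 0) : BPoint)) (hN1 : N 1 = ray ((0, 0, 0) : BPoint) a 2)
    (hN2 : N 2 = ray ((h - 2, 0, 0) : BPoint) v 1) (hN3 : N 3 = ray ((h - 2, 0, 0) : BPoint) w 1) : False := by
  have part : Function.update N 1 (ray ((0, 0, 0) : BPoint) a 1) ∉ C.upper := fun hP =>
    no_upper_origin_unit_two_unit_ceilings hU hG hS hP (s₀ := 0) (s₁ := 1) (s₂ := 2) (s₃ := 3) (by decide) (by decide)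
      (by decide) (by decide) (by decide) (by decide) (by rw [Function.update_of_ne (by decide), hN0]) (Function.update_self ..)
      (by rw [Function.update_of_ne (by decide), hN2]) (by rw [Function.update_of_ne (by decide), hN3])
  obtain ⟨e, he1, he2, hq⟩ :=
    upper_mem_of_origin_floor' hU (hS.1.1 N hN) (f₀ := 0) (f₁ := 1) (by decide) (c₁ := 2) (by norm_num) hN0 hN1
  rcases (show e = 1 ∨ e = 2 by omega) with rfl | rfl
  · rw [(by norm_num : (2 : ℤ) - 1 = 1)] at hq
    exact part hq
  rw [sub_self, ray_zero] at hq
  have hev : ∀ g, MCell.perm (Equiv.swap (1 : Fin 4) 0) N g = N (Equiv.swap (1 : Fin 4) 0 g) := fun g => rfl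
  refine aminus_floor_origin_fires_cells hU hS hN (b := 1) (o := 0) (by decide) (c := 2) (by norm_num) hN1 hN0 hq
    (fun d hd hdc hP => ?_) (hG.1 (Equiv.swap (1 : Fin 4) 0) N hN) (v := a) ⟨fun g hg => ?_, ?_, ?_⟩ fun e he hele hP => ?_
  · obtain rfl : d = 1 := by omega
    rw [(by norm_num : (2 : ℤ) - 1 = 1)] at hP
    exact part hP
  · rcases fin4_cases g with rfl | rfl | rfl | rfl
    · exact absurd rfl hg
    · rw [Function.update_self, hev, Equiv.swap_apply_left, hN0]
    · rw [Function.update_of_ne (by decide), hev, Equiv.swap_apply_of_ne_of_ne (by decide) (by decide)]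
    · rw [Function.update_of_ne (by decide), hev, Equiv.swap_apply_of_ne_of_ne (by decide) (by decide)]
  · rw [Function.update_of_ne (by decide), hN0, hev, Equiv.swap_apply_right, hN1]; simp
  · rw [Function.update_of_ne (by decide), hN0, hev, Equiv.swap_apply_right, hN1]; simp
  · rw [hev, Equiv.swap_apply_right, hN1] at hele
    simp at hele
    rcases (show e = 1 ∨ e = 2 by omega) with rfl | rfl
    · exact no_upper_origin_unit_two_unit_ceilings hU hG hS hP (s₀ := 1) (s₁ := 0) (s₂ := 2) (s₃ := 3) (by decide) (by decide)
        (by decide) (by decide) (by decide) (by decide) (by rw [Function.update_of_ne (by decide), Function.update_self])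
        (Function.update_self ..) (by rw [Function.update_of_ne (by decide), Function.update_of_ne (by decide), hN2])
        (by rw [Function.update_of_ne (by decide), Function.update_of_ne (by decide), hN3])
    · exact no_upper_origin_twoFloor_two_unit_ceilings' hU hG hS hP (s₀ := 1) (s₁ := 0) (s₂ := 2) (s₃ := 3) (by decide)
        (by decide) (by decide) (by decide) (by decide) (by decide) hvw (by rw [Function.update_of_ne (by decide), Function.update_self])
        (Function.update_self ..) (by rw [Function.update_of_ne (by decide), Function.update_of_ne (by decide), hN2])
        (by rw [Function.update_of_ne (by decide), Function.update_of_ne (by decide), hN3])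

/-- **(L8) CLASS `P[O | 2I+ℓ_a | (h-2)I+ℓ_v | (h-2)I+ℓ_w] ∉ E₊`, `v ≠ w` (PROVED, h-uniform, every `a`, no IH; UP-dead at ◇₈ under the floor reading, M24-D8 `P O i21 C1 C1` … (doc: sketch §22) -/
theorem no_upper_origin_i21_two_unit_ceilings {h : ℤ} {C : MConfig} (hU : C.InDiamond h) (hG : C.G1Closed) (hS : C.StaticH1)
    {P : MCell} (hP : P ∈ C.upper) {a v w : Fin 4} (hvw : v ≠ w)
    (hP0 : P 0 = ((0, 0, 0) : BPoint)) (hP1 : P 1 = ray ((2, 0, 0) : BPoint) a 1)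
    (hP2 : P 2 = ray ((h - 2, 0, 0) : BPoint) v 1) (hP3 : P 3 = ray ((h - 2, 0, 0) : BPoint) w 1) : False := by
  have step : ∀ {s t : Fin 4} (hst : s ≠ t) (hs0 : s ≠ 0) (hs1 : s ≠ 1) (ht0 : t ≠ 0) (ht1 : t ≠ 1) {u u' : Fin 4},
      P s = ray ((h - 2, 0, 0) : BPoint) u 1 → P t = ray ((h - 2, 0, 0) : BPoint) u' 1 →
      ∃ Q ∈ C.upper, Q 0 = ((0, 0, 0) : BPoint) ∧ Q 1 = ray ((0, 0, 0) : BPoint) a 2 ∧ Q s = ray ((h - 2, 0, 0) : BPoint) u 1 ∧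
        Q t = ((h, 0, 0) : BPoint) := by
    intro s t hst hs0 hs1 ht0 ht1 u u' hs ht
    have hN := lower_mem_of_unit_ceiling hU (hS.1.2 P hP) hst (t₀ := h - 2) (c₀ := 1) le_rfl (by ring) hs ht
    obtain ⟨d, hd, hdt, hQ⟩ := upper_mem_of_origin_node hU (hS.1.1 _ hN) (f₀ := 0) (f₁ := 1) (by decide) (t₁ := 2) (c₁ := 1) le_rfl
      (by norm_num) (by rw [Function.update_of_ne ht0.symm, hP0]) (by rw [Function.update_of_ne ht1.symm, hP1])
    obtain rfl : d = 1 := by omega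
    refine ⟨_, hQ, ?_, ?_, ?_, ?_⟩
    · rw [Function.update_of_ne (by decide), Function.update_of_ne ht0.symm, hP0]
    · rw [Function.update_self]; norm_num
    · rw [Function.update_of_ne hs1, Function.update_of_ne hst, hs]
    · rw [Function.update_of_ne ht1, Function.update_self]
  obtain ⟨Q, hQ, hQ0, hQ1, hQ2, hQ3⟩ := step (s := 2) (t := 3) (by decide) (by decide) (by decide) (by decide) (by decide) hP2 hP3
  obtain ⟨R, hR, hR0, hR1, hR3, hR2⟩ := step (s := 3) (t := 2) (by decide) (by decide) (by decide) (by decide) (by decide) hP3 hP2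
  have hev : ∀ g, MCell.perm (Equiv.swap (2 : Fin 4) 3) R g = R (Equiv.swap (2 : Fin 4) 3 g) := fun g => rfl
  refine not_upper_unit_top_pair hU hS hQ (b := 2) (g₁ := 3) (by decide) hQ2 hQ3 (hG.2.1 (Equiv.swap (2 : Fin 4) 3) R hR) (Ne.symm hvw)
    (by rw [hev, Equiv.swap_apply_left, hR3]) fun g hg => ?_
  rcases fin4_cases g with rfl | rfl | rfl | rfl
  · rw [hev, Equiv.swap_apply_of_ne_of_ne (by decide) (by decide), hR0, hQ0]
  · rw [hev, Equiv.swap_apply_of_ne_of_ne (by decide) (by decide), hR1, hQ1]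
  · exact absurd rfl hg
  · rw [hev, Equiv.swap_apply_right, hR2, hQ3]

end LawCore

end AnomalyLens

end Summit.Ventures.HSemireg.Pad4Tower
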